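import Summits.QuantumAdvantage.QuantumAdvantage.Theses.CubicForrelation
import Summits.QuantumAdvantage.QuantumAdvantage.Theorems.CubicForrelationNearExactIsExactDerivDegree
import Summits.QuantumAdvantage.QuantumAdvantage.Theorems.CubicForrelationNearExactIsExactRmWeight
import Summits.QuantumAdvantage.QuantumAdvantage.Theorems.CubicForrelationNearExactIsExactMmNormalForm
import Summits.QuantumAdvantage.QuantumAdvantage.Theorems.CubicForrelationNearExactIsExactMmFormCeiling
import Summits.QuantumAdvantage.QuantumAdvantage.Theorems.CubicForrelationNearExactIsExactBentDuality
import Summits.QuantumAdvantage.QuantumAdvantage.Theorems.CubicForrelationNearExactIsExactAxParity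
import Summits.QuantumAdvantage.QuantumAdvantage.Theorems.CubicForrelationNearExactIsExactHouCubic
import Summits.QuantumAdvantage.QuantumAdvantage.Theorems.CubicForrelationNearExactIsExactAmmWalsh
import Summits.QuantumAdvantage.QuantumAdvantage.Theorems.CubicForrelationNearExactIsExactAmmNormalForm
import Summits.QuantumAdvantage.QuantumAdvantage.Theorems.CubicForrelationNearExactIsExactRankTwoPencil
import Summits.QuantumAdvantage.QuantumAdvantage.Theorems.CubicForrelationNearExactIsExactAmmAccounting
import Summits.QuantumAdvantage.QuantumAdvantage.Theorems.CubicForrelationNearExactIsExactAmmCeiling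
import Summits.QuantumAdvantage.QuantumAdvantage.Theorems.CubicForrelationNearExactIsExactFourPoint
import Summits.QuantumAdvantage.QuantumAdvantage.Theorems.CubicForrelationNearExactIsExactQuadWalshPlateau
import Summits.QuantumAdvantage.QuantumAdvantage.Theorems.CubicForrelationNearExactIsExactDyadicPin
import Summits.QuantumAdvantage.QuantumAdvantage.Theorems.CubicForrelationNearExactIsExactPerturbRow
import Summits.QuantumAdvantage.QuantumAdvantage.Theorems.CubicForrelationNearExactIsExactInvariantWeight
import Summits.QuantumAdvantage.QuantumAdvantage.Theorems.CubicForrelationNearExactIsExactLrdrPin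
import Summits.QuantumAdvantage.QuantumAdvantage.Theorems.CubicForrelationNearExactIsExactUniformRowDefect
import Summits.QuantumAdvantage.QuantumAdvantage.Theorems.CubicForrelationNearExactIsExactLrdrBand
import Summits.QuantumAdvantage.QuantumAdvantage.Theorems.CubicForrelationNearExactIsExactAutocorr
import Summits.QuantumAdvantage.QuantumAdvantage.Theorems.CubicForrelationNearExactIsExactQuadPerturb
import Summits.QuantumAdvantage.QuantumAdvantage.Theorems.CubicForrelationNearExactIsExactFibreAverage
import Summits.QuantumAdvantage.QuantumAdvantage.Theorems.CubicForrelationNearExactIsExactCarletCriterion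
import Summits.QuantumAdvantage.QuantumAdvantage.Theorems.CubicForrelationNearExactIsExactFibreAverageRelabeled
import Summits.QuantumAdvantage.QuantumAdvantage.Theorems.CubicForrelationNearExactIsExactTemplateRigidity
import Summits.QuantumAdvantage.QuantumAdvantage.Theorems.CubicForrelationNearExactIsExactWalshTower
import Summits.QuantumAdvantage.QuantumAdvantage.Theorems.CubicForrelationNearExactIsExactLevelCapacity
import Summits.QuantumAdvantage.QuantumAdvantage.Theorems.CubicForrelationNearExactIsExactLevelBent
import Summits.QuantumAdvantage.QuantumAdvantage.Theorems.CubicForrelationNearExactIsExactTowerWalk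
import Summits.QuantumAdvantage.QuantumAdvantage.Theorems.CubicForrelationNearExactIsExactLinearTransport
import Summits.QuantumAdvantage.QuantumAdvantage.Theorems.CubicForrelationNearExactIsExactLevelOnHyperplane
import Summits.QuantumAdvantage.QuantumAdvantage.Theorems.CubicForrelationNearExactIsExactQuadBalancedStructure
import Summits.QuantumAdvantage.QuantumAdvantage.Theorems.CubicForrelationNearExactIsExactTypeE8
import Summits.QuantumAdvantage.QuantumAdvantage.Theorems.CubicForrelationNearExactIsExactTenPeel
import Summits.QuantumAdvantage.QuantumAdvantage.Theorems.CubicForrelationNearExactIsExactBasisWithTwo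
import Summits.QuantumAdvantage.QuantumAdvantage.Theorems.CubicForrelationNearExactIsExactEightBitEndgame
import Summits.QuantumAdvantage.QuantumAdvantage.Theorems.CubicForrelationNearExactIsExactAffineForm
import Summits.QuantumAdvantage.QuantumAdvantage.Theorems.CubicForrelationSignedCubicForrelationNotPrBPPStubKernelNormalFormDegree
import Summits.QuantumAdvantage.QuantumAdvantage.Theorems.CubicForrelationNearExactIsExactTenUnbalancedCells
import Literature.Computability.QuantumComplexity.SignedForrelationGadget
import Literature.Computability.QuantumComplexity.ForrelationDirectSum
import Literature.Computability.QuantumComplexity.ForrelationDerivativeTables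
import Literature.Computability.QuantumComplexity.ForrelationSignTransport

/-!
# Crux `CubicForrelation.NearExactIsExact` (stmt-QuantumAdvantage-14043) — line `direct-sum-amplification`

Crux (route `CubicForrelation`, rank 2; verbatim shape):
`∃ θ < 1, ∀ n, Even n → ∀ f g : (Fin n → Bool) → Bool, IsDegLeFun 3 f → IsDegLeFun 3 g → θ < Φ(f,g) → Φ(f,g) = 1`
— isolation of exactness for CUBIC pairs. Known: `15/16` is attained (landed Negative lemma
`Negative.forrelation_f16_g16`, n = 16), so every admissible `θ ≥ 15/16`; Maiorana–McFarland-SHAPED pairs have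
`Φ ∈ {1} ∪ [−1, 31/32]` (Disproof.lean §3, paper).

## The line (crux idea `direct-sum-amplification`, ideator 2, round 1; triage r1: pass / pass / pass)

LEVER (PROVED here, sorry-free): the value set `𝒞 = {Φ(f,g) : n even, f g cubic}` is a multiplicative monoid
(`forrelation_directSum` + `isDegLeFun_directSum`) inside `[−1, 1]` (`forrelation_le_one`, from the tree's robust
transposition identity `sum_sq_sub_eq`), hence **window amplification** (`window_amplification`): if `𝒞` omits an open
window `(θ₁, θ₂)` with `0 < θ₁ < θ₂ ≤ 1` then `𝒞` omits `(θ₁/θ₂, 1)`, i.e. the crux holds with `θ = θ₁/θ₂`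
(`nearExactIsExact_of_window`; converse `window_of_nearExactIsExact`). Checked corollary of the landed witness:
an empty window has ratio `θ₂/θ₁ ≤ 16/15` (`ratio_le_of_windowEmpty`), and `(15/16)^k ∈ 𝒞`.

WHAT THE ADAPTER BUYS. A window statement never looks at pairs with defect `1 − Φ < 1 − θ₂`: the regime of
infinitesimal defect — where the classification-at-exactness core (route item r5 `ExactPairsMaioranaMcFarland`, "is every
(near-)exact cubic pair MM?") lives — is NOT an obligation of this line. The price (noted by the planner): the usual
"WLOG ⊕-indecomposable" reduction is unavailable for windows (the factors of a window pair may sit in the unanalysed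
top `[θ₂, 1)`), so the stubs below are stated for ALL pairs, decomposable or not.

THE WINDOW. Maiorana–McFarland-shaped pairs may take values anywhere in `(15/16, 31/32]` (`1 − 2·wt(h ⊕ k∘π)/2^m`,
`deg ≤ 6`; Disproof §3(ii) is open), so the MM-free windows are exactly those inside `(31/32, 1)`: the line's window is
`(31/32, θ₂)` with `θ₁ = 31/32` PINNED (the MM ceiling; it must be common to the two open stubs) and `θ₂ > 31/32` left
EXISTENTIAL in each open stub (the composition takes `min θ₂ θ₂' 1`). Conclusion: `θ = (31/32)/θ₂ < 1`.

STATUS 2026-08-17T10:3xZ (lead c6, cycle 2, session 3): n = 10 at 7/8 is FORMALLY CLOSED MODULO A FINITE PROPOSITION — `ten_unbalanced_cells` (Theorems/…TenUnbalancedCells.lean p153605: window ∧ unbalanced split ⇒ ∃ cubic E, quadratic D Q on 8 bits, bh with Q unbalanced of |bias| < 128, all heavy cell sums Σ_{D=a,Q=bh} signOf(E w)·twist w x = 8·odd and all light (Q = ¬bh) = 4·odd; via `stub_periodLemma` p152502, `stub_cellDecomposition` p150933, `stub_heavyEnergyBound` p152746, TenWindow, LOH, Wiener–Khinchin) and `isolation_ten_78_of_census`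 (…TenIsolation78.lean p154385: CENSUS₁₀ → ∀ cubic f g on 10 bits, 7/8 < Φ ⇒ Φ = 1). CENSUS₁₀ is being certified by the lead's exact, cross-validated, O(Q_h)-orbit-reduced census (kit j025070–j025074; every instance so far NSOL = 0). Registered open stubs = the crux core BL/NB only. Earlier STATUS 2026-08-17T07:0xZ (lead c6, cycle 2, after waves 2–3): ALL EIGHT finite-family stubs LANDED (typeE8 p142573, quadBalancedStructure p142378, levelOnHyperplane p142370, linearTransport p142006, tenPeel p143037, basisWithTwo p143055, affineForm p142945, eightBitEndgame p143042) and the lead's ASSEMBLY is sorry-free: `ten_splitDerivative_unbalanced` / `ten_window_derivative_unbalanced` (Theorems/…TenBalancedA.lean p143748 + …TenBalanced.lean + …TenWindow.lean) — in the window 7/8 < Φ < 1 on 10 bits the split-covector derivative of g (and of f) is an UNBALANCED quadratic: the balanced split is EMPTY; what remains of n = 10 at 7/8 is the unbalanced split (rank-2h cell structure, h ∈ {2,3,4}; single-cell obstruction numerically, no proof yet). Registered open stubs = the crux core BL/NB only. Earlier STATUS 2026-08-17T04:4xZ (lead c6, cycle 2): §4g — the next finite family `n = 10` at `θ = 7/8`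 dissected: the BALANCED split case is EMPTY modulo four worker stubs (`stub_typeE8` — every quadratic perturbation of a cubic bent function on 8 bits has `W ≡ 0 mod 16`, confirmed by the exhaustive scan kit j022588; `stub_quadBalancedStructure`; `stub_levelOnHyperplane`; `stub_linearTransport`) + Hou at `n = 8`; the UNBALANCED split case (`g` affine on cosets of a plane, Walsh = cell sums over two quadrics) is the remaining finite target; p140552 `window_nonBent_structure` (type-O structure of the non-bent core) LANDED. Earlier STATUS 2026-08-17T03:2xZ (lead c6): T/LCap/LB2 LANDED (p138237/p138673/p138930), assembly …IsolationSmallN p139479 (isolation_eight = n=8 at 7/8, NO computation) and the tower WALK …TowerWalk (nonBentBand_le_28, isolation_window_le_28: the window is EMPTY for every n ≤ 28): core re-cut — `stub_nonBentBand` now from n = 30 (was n = 10), `stub_bentBandLarge` from n = 42; the crux ⇔ its restriction to n ≥ 30. Earlier STATUS 2026-08-17T02:3xZ (lead c6, CERTIFICATE PIVOT): reshape §4f — the 2-ADIC WALSH TOWER (stubs T `stub_walshTower`, LCap `stub_levelCapacity`, LB2 `stub_levelBent`; sorry-free compositions `isolation_eight` (n = 8 at the conjectured 7/8, TIGHT,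 = the ccert seat's exhaustive scan8 as a theorem), `isolation_ten` (15/16), `isolation_twelve` (31/32), `isolation_fourteen` (31/32), `isolation_sixteen` (63/64), `capacity_eight`): certified finite-n isolation with NO computation. Earlier STATUS 2026-08-16T23:3xZ (lead c4): reshape §4d — LOW-RANK DYADIC RIGIDITY of the partner (crux idea `low-rank-dyadic-rigidity`: stubs QW DP PR IW LP → LB, the bent core now also assumes the partner is NOT (8,11)-low-rank-spanned) + the every-direction row-defect tool UR (crux idea `dyadic-table-incidence-rigidity`) feeding the non-bent core; composition `windowEmpty_of_hexachotomy`. Earlier STATUS 2026-08-16T23Z (lead c3): the almost-MM level §4b is FULLY LANDED (AN p128130, AW p127998, FP p129831, RP p129164, AA p129700, AC p129733, all plugged by import); registered open stubs = the core BL, NB (§4c). Earlier STATUS 2026-08-16T10:5xZ: the five KNOWN stubs below are LANDED (p88834, p90739, p90729, p87562, p89649+p90712) — see the comments at each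
`sorry`; helper theorems landed for the open core: BentDuality p90631, ConcatAveraging p90802, QuadPerturb p93756, ConcatMSubspace p93783, Rothaus p94557,
RankTwoCeilingA p95175 (rank-2 perturbation ceiling); analysis in Cruxes/NearExactIsExact/NOTES.md. STUBS (7 registered after the lead's reshape of 2026-08-16; the planner's trichotomy of a cubic pair on `m + m` bits is
kept, its KNOWN branch is split into worker-sized pieces):
* `stub_derivDegree` (D) — KNOWN: a discrete derivative lowers algebraic degree by one. Size M.
* `stub_rmWeight` (R) — KNOWN, from D: minimum weight `2^{m−d}` of `RM(d,m)` in `IsDegLeFun` vocabulary. Size M.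
* `stub_mmNormalForm` (N) — KNOWN, from D: an M-subspace of a cubic `g` straightens, by a linear/transpose-inverse pair of
  coordinate changes preserving `Φ` and degrees, to the sign form `(−1)^{g₁(y₁‖y₂)} = (−1)^{y₁·π(y₂)}(−1)^{h(y₂)}` with `π`
  quadratic, `h` cubic (Dillon; the tree's `…DillonNormalForm` lemmas supply the linear algebra). Size L.
* `stub_mmWalsh` (F1) — KNOWN: McFarland's Walsh sum for the sign form ⇒ `Φ = 2^{−2m} Σ_{y₂} (−1)^{h} Σ_{x₂} (−1)^{f(π y₂‖x₂)+x₂·y₂}`. Size M.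
* `stub_mmFormCeiling` (F2) — KNOWN (Disproof §3 in derivative form), from D, R, F1: for the sign form with `f` cubic,
  `π` quadratic, `h` cubic, `Φ = 1 ∨ Φ ≤ 31/32`. Size L.
  `mmShapeCeiling_of_parts : D → R → N → F1 → F2 → (HasMSubspace g ∧ f g cubic ⇒ Φ = 1 ∨ Φ ≤ 31/32)` is PROVED below.
* `stub_bentSidedBand` — OPEN (bent branch): for cubic pairs with `g` BENT and NEITHER side MM-shaped there is a
  forbidden band `(31/32, θ₂)`: `Φ ≤ 31/32 ∨ θ₂ ≤ Φ`. Size XL.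
* `stub_nonBentBand` — OPEN (non-bent branch, HARDEST): same band for cubic pairs with NEITHER side bent and neither
  MM-shaped. Size XL.
Composition `NearExactIsExact_of : D → R → N → F1 → F2 → stub_bentSidedBand → stub_nonBentBand → CubicForrelation.NearExactIsExact`
is REAL (MM ceiling from parts; cases MM-g / MM-f by symmetry / bent-g / bent-f by symmetry / neither; then window
amplification); `NearExactIsExact_of_stubs` plugs the sorried stubs in. Disproof used: no `_false_without_` theorem is
landed for this crux (Disproof §4 `not_cruxWithoutDegF` is itself `sorry`); cubicity of BOTH functions is kept in every
stub that needs it (§4: `IsDegLeFun 3 f` is load-bearing — F2 uses it at the affineness/constancy tests); the landed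
Negative witness `15/16 ∈ 𝒞` is USED as the hypothesis `h15` of the sanity statements (`ratio_le_of_windowEmpty`,
`sq_fifteen_sixteenths_mem`): no stub asserts an empty window of ratio `> 16/15` or below `15/16`; the witness is MM-shaped
on both sides, i.e. an instance of the KNOWN branch with `15/16 ≤ 31/32`.
-/

set_option linter.dupNamespace false -- D-0017: single-problem summit ⇒ `QuantumAdvantage.QuantumAdvantage` by design

noncomputable section

namespace Summit.QuantumAdvantage.QuantumAdvantage.Cruxes.NearExactIsExact.DirectSumAmplification

open Finset
open Literature.Computability.QuantumComplexity
open Literature.Computability.QuantumComplexity.BuzetChailloux (bxor zeroVec signOf_sq)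
open Literature.Computability.QuantumComplexity.DerivativeWalsh (W dwt fsum fsum_signOf_eq sum_sq_sub_eq)
open Summit.QuantumAdvantage.QuantumAdvantage.Theses.CubicForrelation (NearExactIsExact)
open Summit.QuantumAdvantage.QuantumAdvantage.Theorems.ExactPairsMaioranaMcFarland.Negative (ind)
open scoped Matrix

variable {n : ℕ}

/-! ## §0 Vocabulary (three one-line predicates over tree declarations) -/

/-- The VALUE SET `𝒞 := {Φ(f,g) : n even, f g : 𝔽₂ⁿ → 𝔽₂ of degree ≤ 3}` of cubic 2-fold forrelation. -/
def CubicValueSet : Set ℝ :=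
  {ρ | ∃ n : ℕ, Even n ∧ ∃ f g : (Fin n → Bool) → Bool, IsDegLeFun 3 f ∧ IsDegLeFun 3 g ∧ forrelation f g = ρ}

/-- The open window `(θ₁, θ₂)` contains no value: `∀ ρ ∈ 𝒞, ρ ≤ θ₁ ∨ θ₂ ≤ ρ`. -/
def WindowEmpty (θ₁ θ₂ : ℝ) : Prop :=
  ∀ ρ ∈ CubicValueSet, ρ ≤ θ₁ ∨ θ₂ ≤ ρ

/-- `g` is **Maiorana–McFarland-SHAPED**: it has an M-subspace — a half-dimensional subspace `V` (a finset `∋ 0`,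
closed under `⊕`, `|V|² = 2ⁿ`) on every coset of which `g` is affine (all second differences along `V` vanish).
Same hypothesis shape as the tree's `DerivativeWalsh.dual_affine_on_perp_cosets`; for `g = y′·π(y″) ⊕ h(y″)` take
`V =` the `y′`-block; for BENT `g` this is membership in the completed MM class (Dillon, Carlet2020 Prop. 54). -/
def HasMSubspace (g : (Fin n → Bool) → Bool) : Prop :=
  ∃ V : Finset (Fin n → Bool), zeroVec ∈ V ∧ (∀ x ∈ V, ∀ y ∈ V, bxor x y ∈ V) ∧ V.card * V.card = 2 ^ n ∧
    ∀ u ∈ V, ∀ v ∈ V, ∀ y, (g y ^^ g (bxor y u) ^^ g (bxor y v) ^^ g (bxor y (bxor u v))) = false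

/-- `g` is **almost-Maiorana–McFarland-SHAPED** (lead c3): it has a RELATIVE M-subspace of dimension `n/2 − 1` — a finset
`V ∋ 0`, closed under `⊕`, with `4|V|² = 2ⁿ`, on every coset of which `g` is affine.  For `g = y₁·φ(y₂) ⊕ h(y₂)` with
`y₁ ∈ 𝔽₂^{m−1}` take `V =` the `y₁`-block (the class `GMM_{m+1}` of arXiv:2508.14265). -/
def HasAMSubspace (g : (Fin n → Bool) → Bool) : Prop :=
  ∃ V : Finset (Fin n → Bool), zeroVec ∈ V ∧ (∀ x ∈ V, ∀ y ∈ V, bxor x y ∈ V) ∧ V.card * V.card * 4 = 2 ^ n ∧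
    ∀ u ∈ V, ∀ v ∈ V, ∀ y, (g y ^^ g (bxor y u) ^^ g (bxor y v) ^^ g (bxor y (bxor u v))) = false

/-- `g` is **bent**: `W_{(-1)^g}(x)² = 2ⁿ` for every `x` (vacuous-false for odd `n`). -/
def IsBentFun (g : (Fin n → Bool) → Bool) : Prop :=
  ∀ x, W (fun y => signOf (g y)) x ^ 2 = (2 : ℝ) ^ n

/-! ## §1 `|Φ| ≤ 1` (from the tree's robust transposition identity) and symmetry -/

/-- `Φ(f,g)² ≤ 1`: `0 ≤ ∑_{h,u} (T_f(h,u) − T_g(u,h))² = 2·8ⁿ − 2·S² = 2·8ⁿ(1 − Φ²)` (`sum_sq_sub_eq`). [folklore] -/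
theorem forrelation_sq_le_one (f g : (Fin n → Bool) → Bool) : forrelation f g ^ 2 ≤ 1 := by
  have h2 : (0 : ℝ) ≤ ∑ h, ∑ u, (dwt (fun x => signOf (f x)) h u - dwt (fun y => signOf (g y)) u h) ^ 2 :=
    Finset.sum_nonneg fun h _ => Finset.sum_nonneg fun u _ => sq_nonneg _
  rw [sum_sq_sub_eq _ _ (fun x => signOf_sq (f x)) (fun y => signOf_sq (g y)), fsum_signOf_eq, mul_pow,
    Real.sq_sqrt (by positivity)] at h2
  have h8 : (8 : ℝ) ^ n = (2 : ℝ) ^ (3 * n) := by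
    rw [pow_mul]; norm_num
  have hpos : (0 : ℝ) < (2 : ℝ) ^ (3 * n) := by positivity
  rw [h8] at h2
  by_contra hlt
  push Not at hlt
  have := mul_lt_mul_of_pos_left hlt hpos
  linarith

/-- `Φ(f,g) ≤ 1`. [folklore] -/
theorem forrelation_le_one (f g : (Fin n → Bool) → Bool) : forrelation f g ≤ 1 := by
  nlinarith [forrelation_sq_le_one f g, sq_nonneg (forrelation f g - 1)]

/-- `−1 ≤ Φ(f,g)`. [folklore] -/
theorem neg_one_le_forrelation (f g : (Fin n → Bool) → Bool) : -1 ≤ forrelation f g := by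
  nlinarith [forrelation_sq_le_one f g, sq_nonneg (forrelation f g + 1)]

/-- `Φ(f,g) = Φ(g,f)` (the twist is symmetric). [folklore] -/
theorem forrelation_comm (f g : (Fin n → Bool) → Bool) : forrelation f g = forrelation g f := by
  unfold forrelation
  congr 1
  rw [Finset.sum_comm]
  refine Finset.sum_congr rfl fun y _ => Finset.sum_congr rfl fun x _ => ?_
  rw [twist_comm]; ring

/-! ## §2 Direct sums: `𝒞` is a multiplicative monoid -/

/-- The Boolean function of a sum of polynomials over `𝔽₂` is the xor (as in the Negative file). [folklore] -/
theorem polyPhase_add' (p q : MvPolynomial (Fin n) (ZMod 2)) (x : Fin n → Bool) :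
    polyPhase (p + q) x = xor (polyPhase p x) (polyPhase q x) := by
  have key : ∀ a b : ZMod 2, decide (a + b = 1) = xor (decide (a = 1)) (decide (b = 1)) := by decide
  rw [polyPhase_apply, polyPhase_apply, polyPhase_apply, map_add]
  exact key _ _

/-- Degree `≤ d` is preserved by direct sums `x ↦ f₁(x|₁) ⊕ f₂(x|₂)` (rename the variables of the two polynomials
into the two blocks and add). [cite: Carlet2020, §2.2.1 Def. 6] -/
theorem isDegLeFun_directSum {n₁ n₂ d : ℕ} {f₁ : (Fin n₁ → Bool) → Bool} {f₂ : (Fin n₂ → Bool) → Bool}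
    (h₁ : IsDegLeFun d f₁) (h₂ : IsDegLeFun d f₂) :
    IsDegLeFun d (fun x : Fin (n₁ + n₂) → Bool =>
      xor (f₁ fun i => x (Fin.castAdd n₂ i)) (f₂ fun j => x (Fin.natAdd n₁ j))) := by
  obtain ⟨p₁, hp₁, hf₁⟩ := h₁
  obtain ⟨p₂, hp₂, hf₂⟩ := h₂
  refine ⟨MvPolynomial.rename (Fin.castAdd n₂) p₁ + MvPolynomial.rename (Fin.natAdd n₁) p₂, ?_, fun x => ?_⟩
  · exact (MvPolynomial.totalDegree_add _ _).trans
      (max_le ((MvPolynomial.totalDegree_rename_le _ _).trans hp₁)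
        ((MvPolynomial.totalDegree_rename_le _ _).trans hp₂))
  · show xor (f₁ fun i => x (Fin.castAdd n₂ i)) (f₂ fun j => x (Fin.natAdd n₁ j)) = _
    rw [polyPhase_add', hf₁, hf₂]
    simp only [polyPhase_apply, MvPolynomial.eval_rename, Function.comp_def]

/-- **`𝒞 · 𝒞 ⊆ 𝒞`**: `Φ(f₁ ⊕ f₂, g₁ ⊕ g₂) = Φ(f₁,g₁)·Φ(f₂,g₂)` (`forrelation_directSum`), degrees and evenness are
preserved. [cite: AaronsonAmbainis2018, §1.1.1] -/
theorem mul_mem_cubicValueSet {ρ₁ ρ₂ : ℝ} (h₁ : ρ₁ ∈ CubicValueSet) (h₂ : ρ₂ ∈ CubicValueSet) :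
    ρ₁ * ρ₂ ∈ CubicValueSet := by
  obtain ⟨n₁, hn₁, f₁, g₁, hf₁, hg₁, rfl⟩ := h₁
  obtain ⟨n₂, hn₂, f₂, g₂, hf₂, hg₂, rfl⟩ := h₂
  exact ⟨n₁ + n₂, hn₁.add hn₂, _, _, isDegLeFun_directSum hf₁ hf₂, isDegLeFun_directSum hg₁ hg₂,
    forrelation_directSum f₁ g₁ f₂ g₂⟩

/-- Powers stay in `𝒞`: `ρ ∈ 𝒞 ⇒ ρ^{k+1} ∈ 𝒞` (`k`-fold direct sum of the pair with itself). -/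
theorem pow_succ_mem_cubicValueSet {ρ : ℝ} (h : ρ ∈ CubicValueSet) : ∀ k : ℕ, ρ ^ (k + 1) ∈ CubicValueSet
  | 0 => by simpa using h
  | k + 1 => by
    rw [pow_succ]
    exact mul_mem_cubicValueSet (pow_succ_mem_cubicValueSet h k) h

/-- `𝒞 ⊆ (−∞, 1]`. -/
theorem le_one_of_mem_cubicValueSet {ρ : ℝ} (h : ρ ∈ CubicValueSet) : ρ ≤ 1 := by
  obtain ⟨n, -, f, g, -, -, rfl⟩ := h
  exact forrelation_le_one f g

/-- The value of a cubic pair on an even number of bits is in `𝒞` (definitional). -/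
theorem forrelation_mem_cubicValueSet (hn : Even n) {f g : (Fin n → Bool) → Bool} (hf : IsDegLeFun 3 f)
    (hg : IsDegLeFun 3 g) : forrelation f g ∈ CubicValueSet :=
  ⟨n, hn, f, g, hf, hg, rfl⟩

/-- FARM NOTE (planner, 2026-08-16T05:48Z). The landed Negative witness `15/16 ∈ 𝒞`
(`Theorems/NearExactIsExact/Negative/FifteenSixteenths.lean`, proposal p80085 ACCEPTED, commit 3d7042a997d9) is the term
`⟨8 + 8, ⟨8, rfl⟩, Negative.f16, Negative.g16, Negative.isDegLeFun_f16, Negative.isDegLeFun_g16, Negative.forrelation_f16_g16⟩`;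
at filing time the farm snapshot had not yet BUILT that module (`lean check` rc 75 `remote:stale:58:unbuilt:…FifteenSixteenths`,
05:33Z–05:48Z), so in this published copy the witness enters the three sanity statements below as the hypothesis
`(h15 : (15/16 : ℝ) ∈ CubicValueSet)`. The import-variant (identical file + `import …Negative.FifteenSixteenths` + the term above,
scratch-checked rc 0 with the witness sorried) is in the planner folder as `line-direct-sum-amplification-import.lean` and is
attached as item evidence; the lead (or this planner on resume) swaps it in once the module is built.
No stub depends on `h15`. -/
theorem sq_fifteen_sixteenths_mem (h15 : (15 / 16 : ℝ) ∈ CubicValueSet) : (225 / 256 : ℝ) ∈ CubicValueSet := by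
  have h := pow_succ_mem_cubicValueSet h15 1
  norm_num at h
  exact h

/-! ## §3 Window amplification (the idea's lever, proved) -/

/-- **Window amplification.** If no cubic pair has `Φ ∈ (θ₁, θ₂)` (`0 < θ₁ < θ₂ ≤ 1`) then no cubic pair has
`Φ ∈ (θ₁/θ₂, 1)`: for a hypothetical `ρ ∈ 𝒞 ∩ (θ₁/θ₂, 1)` ALL powers `ρ^{k+1}` stay above `θ₁` (induction: a power
above `θ₁` is a value, hence `≥ θ₂`, and the next one is `≥ ρθ₂ > θ₁`) — absurd since `ρ^k → 0`. [folklore] -/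
theorem window_amplification {θ₁ θ₂ : ℝ} (h0 : 0 < θ₁) (h12 : θ₁ < θ₂) (h2 : θ₂ ≤ 1)
    (hwin : WindowEmpty θ₁ θ₂) {ρ : ℝ} (hρ : ρ ∈ CubicValueSet) (hlt : θ₁ / θ₂ < ρ) : ρ = 1 := by
  have hθ₂ : 0 < θ₂ := h0.trans h12
  have hρ1 : ρ ≤ 1 := le_one_of_mem_cubicValueSet hρ
  by_contra hne
  have hρlt1 : ρ < 1 := lt_of_le_of_ne hρ1 hne
  have hq : 0 < θ₁ / θ₂ := div_pos h0 hθ₂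
  have hρpos : 0 < ρ := hq.trans hlt
  have hall : ∀ k : ℕ, θ₁ < ρ ^ (k + 1) := by
    intro k
    induction k with
    | zero =>
      rw [zero_add, pow_one]
      calc θ₁ ≤ θ₁ / θ₂ := by rw [le_div_iff₀ hθ₂]; exact mul_le_of_le_one_right h0.le h2
        _ < ρ := hlt
    | succ k ih =>
      rcases hwin _ (pow_succ_mem_cubicValueSet hρ k) with hle | hge
      · exact absurd hle (not_le.2 ih)
      · rw [pow_succ]
        calc θ₁ = θ₂ * (θ₁ / θ₂) := by field_simp
          _ < θ₂ * ρ := mul_lt_mul_of_pos_left hlt hθ₂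
          _ ≤ ρ ^ (k + 1) * ρ := mul_le_mul_of_nonneg_right hge hρpos.le
  obtain ⟨k, hk⟩ := exists_pow_lt_of_lt_one h0 hρlt1
  have hk' := hall k
  have hmono : ρ ^ (k + 1) ≤ ρ ^ k := pow_le_pow_of_le_one hρpos.le hρ1 (Nat.le_succ k)
  linarith

/-- **The adapter** (`Transfer` of the idea card, as a theorem): an empty window `(θ₁, θ₂)`, `0 < θ₁ < θ₂ ≤ 1`,
gives the crux with `θ = θ₁/θ₂`. The conclusion is the crux UNFOLDED (definitionally `NearExactIsExact` — `Iff.rfl`, cf.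
`Negative.nearExactIsExact_iff`), so that the first theorem of the file concluding the route decl BY NAME is the registered
skeleton `NearExactIsExact_of` below (skeleton lint: its hypotheses must be exactly the stubs). [folklore] -/
theorem nearExactIsExact_of_window {θ₁ θ₂ : ℝ} (h0 : 0 < θ₁) (h12 : θ₁ < θ₂) (h2 : θ₂ ≤ 1)
    (hwin : WindowEmpty θ₁ θ₂) :
    ∃ θ : ℝ, θ < 1 ∧ ∀ n : ℕ, Even n → ∀ f g : (Fin n → Bool) → Bool, IsDegLeFun 3 f → IsDegLeFun 3 g →
      θ < forrelation f g → forrelation f g = 1 := by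
  have hθ₂ : 0 < θ₂ := h0.trans h12
  refine ⟨θ₁ / θ₂, (div_lt_one hθ₂).2 h12, fun n hn f g hf hg hlt => ?_⟩
  exact window_amplification h0 h12 h2 hwin (forrelation_mem_cubicValueSet hn hf hg) hlt

/-- Converse (so the reformulation is an EQUIVALENCE): the crux with threshold `θ` is the empty window `(θ, 1)`.
[folklore] -/
theorem window_of_nearExactIsExact (h : NearExactIsExact) : ∃ θ : ℝ, θ < 1 ∧ WindowEmpty θ 1 := by
  obtain ⟨θ, hθ, h⟩ := h
  refine ⟨θ, hθ, fun ρ hρ => ?_⟩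
  obtain ⟨n, hn, f, g, hf, hg, rfl⟩ := hρ
  by_cases hlt : θ < forrelation f g
  · exact Or.inr (h n hn f g hf hg hlt).ge
  · exact Or.inl (not_lt.1 hlt)

/-- **Checked against the landed Negative lemma** (`h15` = `Negative.exists_cubic_pair_forrelation_eq`, see FARM NOTE): an
empty window has ratio `θ₂/θ₁ ≤ 16/15` — precisely `15/16 ≤ θ₁/θ₂` — because `15/16 ∈ 𝒞` would otherwise be amplified to `1`.
So no stub below may claim an empty window of larger ratio (none does: the line's window sits inside `(31/32, 1)`). [folklore] -/
theorem ratio_le_of_windowEmpty (h15 : (15 / 16 : ℝ) ∈ CubicValueSet) {θ₁ θ₂ : ℝ} (h0 : 0 < θ₁) (h12 : θ₁ < θ₂)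
    (h2 : θ₂ ≤ 1) (hwin : WindowEmpty θ₁ θ₂) : 15 / 16 ≤ θ₁ / θ₂ := by
  by_contra hlt
  push Not at hlt
  have h := window_amplification h0 h12 h2 hwin h15 hlt
  norm_num at h

/-- In particular NO window containing `15/16` is empty, e.g. `(7/8, 31/32)` (the crux text's old conjecture `θ = 7/8`
in window form) — agrees with `Negative.not_nearExact_at_seven_eighths`. -/
example (h15 : (15 / 16 : ℝ) ∈ CubicValueSet) : ¬ WindowEmpty (7 / 8) (31 / 32) := by
  intro hwin
  rcases hwin _ h15 with h | h <;> norm_num at h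

/-! ## §4 Registered stubs (7; lead reshape 2026-08-16: the KNOWN stub `stub_mmShapeCeiling` of the planner's
skeleton is split into five worker-sized pieces D, R, N, F1, F2 whose composition `mmShapeCeiling_of_parts` is proved
below; the two OPEN band stubs are unchanged) -/

/-- **stub_derivDegree** (D; KNOWN, folklore — Carlet2020 §2.2: `deg D_t f ≤ deg f − 1`). A discrete derivative
`x ↦ e(x) ⊕ e(x ⊕ t)` of a function of algebraic degree `≤ d + 1` has algebraic degree `≤ d`: the top homogeneous part
of a polynomial is translation invariant (`(X + t)^s − X^s` has total degree `< |s|`). Used by R (induction), N (the map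
`π` of the normal form is a derivative of the cubic `g`, hence quadratic) and F2 (first and second `x″`-derivatives of the
cubic `f`). Size M (pure `MvPolynomial` bookkeeping over `ZMod 2`). -/
theorem stub_derivDegree :
    ∀ (n d : ℕ) (e : (Fin n → Bool) → Bool) (t : Fin n → Bool), IsDegLeFun (d + 1) e →
      IsDegLeFun d (fun x => e x ^^ e (bxor x t)) :=
  -- LANDED (accepted): plugged in by import.
  Summit.QuantumAdvantage.QuantumAdvantage.Theorems.CubicForrelation.NearExactIsExact.stub_derivDegree

/-- **stub_rmWeight** (R; KNOWN — minimum distance of the Reed–Muller code `RM(d,m)`, Carlet2020 Thm 7 p. 192, in the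
tree's `Bool`/`IsDegLeFun` vocabulary, from D): a function of degree `≤ d` on `m` bits that takes the value `true`
somewhere takes it on at least `2^{m−d}` points, written division-free as `2^m ≤ 2^d · wt(e)` (so `d ≥ m` is the trivial
`wt ≥ 1`). Proof: induction on `m`, splitting the last coordinate: `wt(e) = wt(e₀) + wt(e₁)` with `e_b = e(·, b)` of degree
`≤ d` on `m − 1` bits; if `e₀ = e₁` both are nonzero and `wt ≥ 2·2^{m−1−d}`; otherwise `e₀ ⊕ e₁` (the derivative in the
last direction, degree `≤ d − 1` by D, restricted) is nonzero and `wt(e₀) + wt(e₁) ≥ wt(e₀ ⊕ e₁) ≥ 2^{m−d}`; `d = 0`: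
`totalDegree p = 0 ⇒ p = C _`, a nonzero constant has full weight. Size M. -/
theorem stub_rmWeight :
    (∀ (n d : ℕ) (e : (Fin n → Bool) → Bool) (t : Fin n → Bool), IsDegLeFun (d + 1) e →
      IsDegLeFun d (fun x => e x ^^ e (bxor x t))) →
    ∀ (m d : ℕ) (e : (Fin m → Bool) → Bool), IsDegLeFun d e → (∃ x, e x = true) →
      2 ^ m ≤ 2 ^ d * (univ.filter fun x => e x = true).card :=
  -- LANDED (accepted): plugged in by import.
  Summit.QuantumAdvantage.QuantumAdvantage.Theorems.CubicForrelation.NearExactIsExact.stub_rmWeight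

/-- **stub_mmNormalForm** (N; KNOWN — Dillon/McFarland straightening, Carlet2020 Prop 54, from D). If the cubic `g` on
`m + m` bits has an M-subspace `V` (`HasMSubspace`: `0 ∈ V`, xor-closed, `|V|² = 2ⁿ`, all second differences along `V`
vanish) then, for some LINEAR change of coordinates sending `V` to the `y₁`-block and the transpose-inverse change on the
`f`-side (which preserves `x·y`, hence `Φ`, and all degrees), the pair becomes `(f₁, g₁)` with
`(−1)^{g₁(y₁ ‖ y₂)} = (−1)^{y₁·π(y₂)} (−1)^{h(y₂)}`, `π` coordinatewise quadratic (a `y₁`-derivative of the cubic `g₁`,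
by D) and `h = g₁(0 ‖ ·)` cubic. NO bijectivity of `π` is claimed or needed. The straightening linear algebra
(`dnf_exists_submodule`, `dnf_finrank_eq`, `dnf_exists_linearEquiv`, `dnf_affine`, `dnf_sum_reindex`) is in
`Theorems/CubicForrelationExactPairsMaioranaMcFarlandDillonNormalForm.lean`; degree transport under linear substitutions is
`Literature…PowerSumNonvanishing.totalDegree_aeval_le_of_forall_le_one`. Size L. -/
theorem stub_mmNormalForm :
    (∀ (n d : ℕ) (e : (Fin n → Bool) → Bool) (t : Fin n → Bool), IsDegLeFun (d + 1) e →
      IsDegLeFun d (fun x => e x ^^ e (bxor x t))) →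
    ∀ (m : ℕ) (f g : (Fin (m + m) → Bool) → Bool), IsDegLeFun 3 f → IsDegLeFun 3 g →
      (∃ V : Finset (Fin (m + m) → Bool), zeroVec ∈ V ∧ (∀ x ∈ V, ∀ y ∈ V, bxor x y ∈ V) ∧
        V.card * V.card = 2 ^ (m + m) ∧
        ∀ u ∈ V, ∀ v ∈ V, ∀ y, (g y ^^ g (bxor y u) ^^ g (bxor y v) ^^ g (bxor y (bxor u v))) = false) →
      ∃ (f₁ g₁ : (Fin (m + m) → Bool) → Bool) (π : (Fin m → Bool) → (Fin m → Bool)) (h : (Fin m → Bool) → Bool),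
        IsDegLeFun 3 f₁ ∧ (∀ i : Fin m, IsDegLeFun 2 (fun y => π y i)) ∧ IsDegLeFun 3 h ∧
        (∀ y₁ y₂ : Fin m → Bool, signOf (g₁ (Fin.append y₁ y₂)) = twist y₁ (π y₂) * signOf (h y₂)) ∧
        forrelation f₁ g₁ = forrelation f g :=
  -- LANDED (accepted): plugged in by import.
  Summit.QuantumAdvantage.QuantumAdvantage.Theorems.CubicForrelation.NearExactIsExact.stub_mmNormalForm

/-! ### F1 tools (verbatim copies of the LANDED lemmas of `Theorems/CubicForrelationNearExactIsExactMmWalsh.lean`, p87562;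
inlined because the farm does not serve that module's olean — delete and import once it does) -/
namespace F1

/-- Character orthogonality on the linear block: `∑_{y₁} (-1)^{x₁·y₁} (-1)^{y₁·z} = 2^m [z = x₁]`. [folklore] -/
theorem mw_sum_linear_block {m : ℕ} (x₁ z : Fin m → Bool) :
    ∑ y₁ : Fin m → Bool, twist x₁ y₁ * twist y₁ z = if z = x₁ then (2 : ℝ) ^ m else 0 := by
  have e : ∀ y₁ : Fin m → Bool, twist x₁ y₁ * twist y₁ z = twist y₁ (bxor x₁ z) := by
    intro y₁
    rw [BuzetChailloux.twist_bxor_right, twist_comm x₁ y₁]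
  rw [sum_congr rfl fun y₁ _ => e y₁, BuzetChailloux.sum_twist_left]
  refine if_congr ?_ rfl rfl
  rw [BuzetChailloux.bxor_eq_zeroVec_iff]
  exact eq_comm

/-- McFarland's dual sum for a Maiorana–McFarland sign form with an arbitrary map `π`. [folklore] -/
theorem mw_walsh_signForm {m : ℕ} (g : (Fin (m + m) → Bool) → Bool) (π : (Fin m → Bool) → (Fin m → Bool))
    (h : (Fin m → Bool) → Bool)
    (hg : ∀ y₁ y₂ : Fin m → Bool, signOf (g (Fin.append y₁ y₂)) = twist y₁ (π y₂) * signOf (h y₂))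
    (c : ℝ) (x₁ x₂ : Fin m → Bool) :
    ∑ y : Fin (m + m) → Bool, c * twist (Fin.append x₁ x₂) y * signOf (g y) =
      (2 : ℝ) ^ m * ∑ y₂ : Fin m → Bool, (if π y₂ = x₁ then c * twist x₂ y₂ * signOf (h y₂) else 0) := by
  rw [sum_append, Finset.sum_comm, mul_sum]
  refine sum_congr rfl fun y₂ _ => ?_
  have e : ∀ y₁ : Fin m → Bool,
      c * twist (Fin.append x₁ x₂) (Fin.append y₁ y₂) * signOf (g (Fin.append y₁ y₂)) =
        c * twist x₂ y₂ * signOf (h y₂) * (twist x₁ y₁ * twist y₁ (π y₂)) := by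
    intro y₁
    rw [twist_append, hg]
    ring
  rw [sum_congr rfl fun y₁ _ => e y₁, ← mul_sum, mw_sum_linear_block]
  split_ifs <;> ring

/-- The unnormalised forrelation sum of a Maiorana–McFarland sign form. [folklore] -/
theorem mw_fsum_signForm {m : ℕ} (f g : (Fin (m + m) → Bool) → Bool) (π : (Fin m → Bool) → (Fin m → Bool))
    (h : (Fin m → Bool) → Bool)
    (hg : ∀ y₁ y₂ : Fin m → Bool, signOf (g (Fin.append y₁ y₂)) = twist y₁ (π y₂) * signOf (h y₂)) :
    ∑ x : Fin (m + m) → Bool, ∑ y : Fin (m + m) → Bool, signOf (f x) * twist x y * signOf (g y) =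
      (2 : ℝ) ^ m * ∑ y₂ : Fin m → Bool, signOf (h y₂) *
        ∑ x₂ : Fin m → Bool, signOf (f (Fin.append (π y₂) x₂)) * twist x₂ y₂ := by
  calc ∑ x : Fin (m + m) → Bool, ∑ y : Fin (m + m) → Bool, signOf (f x) * twist x y * signOf (g y)
      = ∑ x₁ : Fin m → Bool, ∑ x₂ : Fin m → Bool, (2 : ℝ) ^ m * ∑ y₂ : Fin m → Bool,
          (if π y₂ = x₁ then signOf (f (Fin.append x₁ x₂)) * twist x₂ y₂ * signOf (h y₂) else 0) := by
        rw [sum_append]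
        exact sum_congr rfl fun x₁ _ => sum_congr rfl fun x₂ _ => mw_walsh_signForm g π h hg _ x₁ x₂
    _ = (2 : ℝ) ^ m * ∑ x₂ : Fin m → Bool, ∑ x₁ : Fin m → Bool, ∑ y₂ : Fin m → Bool,
          (if π y₂ = x₁ then signOf (f (Fin.append x₁ x₂)) * twist x₂ y₂ * signOf (h y₂) else 0) := by
        rw [mul_sum, Finset.sum_comm]
        exact sum_congr rfl fun x₂ _ => (mul_sum _ _ _).symm
    _ = (2 : ℝ) ^ m * ∑ x₂ : Fin m → Bool, ∑ y₂ : Fin m → Bool,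
          signOf (f (Fin.append (π y₂) x₂)) * twist x₂ y₂ * signOf (h y₂) := by
        congr 1
        refine sum_congr rfl fun x₂ _ => ?_
        rw [Finset.sum_comm]
        refine sum_congr rfl fun y₂ _ => ?_
        rw [Finset.sum_ite_eq, if_pos (mem_univ _)]
    _ = (2 : ℝ) ^ m * ∑ y₂ : Fin m → Bool, signOf (h y₂) *
          ∑ x₂ : Fin m → Bool, signOf (f (Fin.append (π y₂) x₂)) * twist x₂ y₂ := by
        rw [Finset.sum_comm]
        congr 1
        refine sum_congr rfl fun y₂ _ => ?_
        rw [mul_sum]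
        refine sum_congr rfl fun x₂ _ => ?_
        ring

/-- The normalisation of `Φ` on `m + m` bits: `√(2^{3(m+m)}) = 2^m · 2^{2m}`. [folklore] -/
theorem mw_sqrt_two_pow (m : ℕ) : Real.sqrt ((2 : ℝ) ^ (3 * (m + m))) = (2 : ℝ) ^ m * (2 : ℝ) ^ (2 * m) := by
  rw [show (2 : ℝ) ^ (3 * (m + m)) = ((2 : ℝ) ^ m * (2 : ℝ) ^ (2 * m)) ^ 2 by ring,
    Real.sqrt_sq (by positivity)]

end F1

/-- **stub_mmWalsh** (F1; KNOWN — McFarland's Walsh sum, pattern `Negative.W_g16` / `fsum_f16_g16` for general `m`):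
for `g` in Maiorana–McFarland sign form with an ARBITRARY map `π`, summing over the linear block `y₁` first
(`ForrelationDirectSum.sum_append`, `twist_append`, `Simon.sum_twist`) gives `W_g(x₁ ‖ x₂) = 2^m Σ_{y₂ : π y₂ = x₁}
(−1)^{h(y₂)} (−1)^{x₂·y₂}`, hence `Φ(f,g) = 2^{−2m} Σ_{y₂} (−1)^{h(y₂)} Σ_{x₂} (−1)^{f(π(y₂) ‖ x₂)} (−1)^{x₂·y₂}` — the
average over `y₂` of the signed, `y₂`-twisted bias of `f` on the fibre `{x₁ = π(y₂)}`. A pure identity (no degree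
hypotheses). Size M. -/
theorem stub_mmWalsh :
    ∀ (m : ℕ) (f g : (Fin (m + m) → Bool) → Bool) (π : (Fin m → Bool) → (Fin m → Bool)) (h : (Fin m → Bool) → Bool),
      (∀ y₁ y₂ : Fin m → Bool, signOf (g (Fin.append y₁ y₂)) = twist y₁ (π y₂) * signOf (h y₂)) →
      forrelation f g = ((2 : ℝ) ^ (2 * m))⁻¹ *
        ∑ y₂ : Fin m → Bool, signOf (h y₂) * ∑ x₂ : Fin m → Bool, signOf (f (Fin.append (π y₂) x₂)) * twist x₂ y₂ := by
  -- LANDED as Summit.QuantumAdvantage.QuantumAdvantage.Theorems.CubicForrelation.NearExactIsExact.stub_mmWalsh (p87562, ACCEPTED).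
  -- The farm does not serve that module's olean (remote:stale:unbuilt, 2026-08-16T06Z–21Z), so the landed proof is INLINED here
  -- verbatim (lemmas `F1.mw_*` above, copied from Theorems/CubicForrelationNearExactIsExactMmWalsh.lean) — lead c2.
  intro m f g π h hg
  unfold forrelation
  rw [F1.mw_fsum_signForm f g π h hg, F1.mw_sqrt_two_pow, mul_inv, mul_mul_mul_comm,
    inv_mul_cancel₀ (by positivity : (2 : ℝ) ^ m ≠ 0), one_mul]

/-- **stub_mmFormCeiling** (F2; KNOWN in print-form — Disproof §3 = `AlignedCapture`, here in DERIVATIVE form, from D, R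
and the identity F1). For cubic `f`, coordinatewise-quadratic `π`, cubic `h` and `g` in MM sign form:
`Φ(f,g) = 1 ∨ Φ(f,g) ≤ 31/32`. Proof. By F1, `Φ = E_{y₂} (−1)^{h(y₂)} β(y₂)` with `β(y₂)` the bias of the cubic
`e_{y₂} : x₂ ↦ f(π(y₂) ‖ x₂) ⊕ x₂·y₂`; by R (d = 3, applied to `e` and `¬e`) `|β| ≤ 3/4` unless `e_{y₂}` is affine, `β = 0`
if it is affine non-constant (R, d = 1), `β = ±1` if constant. AFFINENESS TEST: `e_{y₂}` affine iff all second derivatives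
`u_{ij}(y₂,x₂) := (D_{e_i}D_{e_j} f)(π(y₂) ‖ x₂)` vanish in `x₂`; `D_iD_j f` has degree `≤ 1` (D twice), so `u_{ij}` has
degree `≤ 2` in `(y₂,x₂)` (substitution of the quadratic `π`: `totalDegree (bind₁ q p) ≤ 2·totalDegree p`), and if some
`u_{ij}(y₀,x₀) ≠ 0` then `y₂ ↦ u_{ij}(y₂,x₀)` is a nonzero function of degree `≤ 2`, nonzero on `≥ 1/4` of the `y₂` (R),
each such `y₂` being non-affine: so either every `e_{y₂}` is affine or `Φ ≤ 3/4 + (1/4)(3/4) = 15/16`. CONSTANCY TEST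
(all `e_{y₂}` affine): `e_{y₂}` constant iff all `w_i(y₂,x₂) := (D_{e_i} f)(π(y₂) ‖ x₂) ⊕ (y₂)_i` vanish; degree `≤ 4`;
a failure at `(y₀,x₀)` gives `≥ 1/16` non-constant (bias-0) fibres (R, d = 4): `Φ ≤ 15/16`, else every fibre is constant
and `Φ = E_{y₂} (−1)^{h(y₂) ⊕ f(π(y₂) ‖ 0)}`, a word of degree `≤ 6`: `Φ = 1` or `Φ ≤ 1 − 2·2^{−6} = 31/32` (R, d = 6).
Uses `hf` essentially (Disproof §4: with `f` of unbounded degree the `𝔽_{2^r}` pencil has `Φ → 1`). Size L. -/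
theorem stub_mmFormCeiling :
    (∀ (n d : ℕ) (e : (Fin n → Bool) → Bool) (t : Fin n → Bool), IsDegLeFun (d + 1) e →
      IsDegLeFun d (fun x => e x ^^ e (bxor x t))) →
    (∀ (m d : ℕ) (e : (Fin m → Bool) → Bool), IsDegLeFun d e → (∃ x, e x = true) →
      2 ^ m ≤ 2 ^ d * (univ.filter fun x => e x = true).card) →
    (∀ (m : ℕ) (f g : (Fin (m + m) → Bool) → Bool) (π : (Fin m → Bool) → (Fin m → Bool)) (h : (Fin m → Bool) → Bool),
      (∀ y₁ y₂ : Fin m → Bool, signOf (g (Fin.append y₁ y₂)) = twist y₁ (π y₂) * signOf (h y₂)) →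
      forrelation f g = ((2 : ℝ) ^ (2 * m))⁻¹ *
        ∑ y₂ : Fin m → Bool, signOf (h y₂) * ∑ x₂ : Fin m → Bool, signOf (f (Fin.append (π y₂) x₂)) * twist x₂ y₂) →
    ∀ (m : ℕ) (f g : (Fin (m + m) → Bool) → Bool) (π : (Fin m → Bool) → (Fin m → Bool)) (h : (Fin m → Bool) → Bool),
      IsDegLeFun 3 f → (∀ i : Fin m, IsDegLeFun 2 (fun y => π y i)) → IsDegLeFun 3 h →
      (∀ y₁ y₂ : Fin m → Bool, signOf (g (Fin.append y₁ y₂)) = twist y₁ (π y₂) * signOf (h y₂)) →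
      forrelation f g = 1 ∨ forrelation f g ≤ 31 / 32 :=
  -- LANDED (accepted): plugged in by import.
  Summit.QuantumAdvantage.QuantumAdvantage.Theorems.CubicForrelation.NearExactIsExact.stub_mmFormCeiling

/-- **stub_axParity** (AX; KNOWN — Ax 1964 / McEliece 1972 for `q = 2`, Carlet2020 §4.1 "McEliece's theorem": the
weights of `RM(d,k)` are divisible by `2^{⌈k/d⌉−1}`, equivalently the bias sum `Σ_x (−1)^{h(x)}` of a degree-`≤ d` function on
`k` bits is divisible by `2^{⌈k/d⌉}`), stated on COORDINATE CUBES so that it applies verbatim to restrictions: for `h` of degree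
`≤ d` (`d ≥ 1`) on `n` bits and a coordinate set `K`, `Σ_{x : supp x ⊆ K} (−1)^{h(x)} ∈ 2^{⌈|K|/d⌉} ℤ` (`⌈k/d⌉ = (k+d−1)/d`).
Elementary proof (no Gauss sums): with `p = Σ_{s ∈ supp p} X^s` representing `h` (coefficients in `𝔽₂`, so every monomial in
the support has coefficient `1`; on `{0,1}`-points `X^s(x) = [supp s ⊆ supp x]`), `(−1)^{h(x)} = Π_{s} (1 − 2·[supp s ⊆ supp x])
= Σ_{S ⊆ supp p} (−2)^{|S|} [U_S ⊆ supp x]` with `U_S = ⋃_{s∈S} supp s` (`Finset.prod_one_add` / `prod_sub`), and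
`#{x : U_S ⊆ supp x ⊆ K} = 2^{|K|−|U_S|}·[U_S ⊆ K]`; the `S`-term has 2-adic valuation `|S| + |K| − |U_S| ≥ max(|S|, |K| − (d−1)|S|)
≥ ⌈|K|/d⌉` because `|U_S| ≤ min(|K|, d|S|)` (`|supp s| ≤ deg s ≤ d`). Used by HOU below with `d = 3`. Size M. -/
theorem stub_axParity :
    ∀ (n d : ℕ) (h : (Fin n → Bool) → Bool) (K : Finset (Fin n)), 1 ≤ d → IsDegLeFun d h →
      ∃ z : ℤ, ∑ x ∈ {u : Fin n → Bool | ∀ i, u i = true → i ∈ K}, signOf (h x) =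
        (2 : ℝ) ^ ((K.card + d - 1) / d) * (z : ℝ) :=
  -- LANDED as Summit.QuantumAdvantage.QuantumAdvantage.Theorems.CubicForrelation.NearExactIsExact.stub_axParity (p102054, ACCEPTED): plugged in by import.
  Summit.QuantumAdvantage.QuantumAdvantage.Theorems.CubicForrelation.NearExactIsExact.stub_axParity

/-- **stub_houCubic** (HOU; KNOWN — Hou 2000 / Carlet2020 Prop 74 specialised to cubic bent functions: the dual of a
cubic bent function on `m + m` bits has degree `≤ ⌊(m+3)/2⌋`), from AX by Rothaus' parity method already in the tree
(`bb_poisson`, `bb_moebius_isDegLeFun`, pattern of `bb_rothaus_isDegLeFun`): for a coordinate set `I` with `|I| = i`, POISSON gives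
`2^m Σ_{u ∈ E_I} (−1)^{d(u)} = 2^{i} Σ_{x ∈ E_{Iᶜ}} (−1)^{g(x)}` and AX (`K = Iᶜ`, `|K| = 2m − i`, `d = 3`) makes the right side
`2^{i + ⌈(2m−i)/3⌉} z`; with `Σ_{E_I} (−1)^d = 2^i − 2A_I` (`A_I = #{u ∈ E_I : d u = 1}`, `bb_sum_signOf`) this is
`2^{m+1} A_I = 2^{m+i} − 2^{i+⌈(2m−i)/3⌉} z`, so `A_I` is even as soon as `i ≥ 2` and `i + ⌈(2m−i)/3⌉ ≥ m + 2`, which holds for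
every `i ≥ ⌊(m+3)/2⌋ + 1` (check `m = 2a`: `a+2+⌈(3a−2)/3⌉ = 2a+2`; `m = 2a+1`: `a+3+⌈(3a−1)/3⌉ = 2a+3`; the left side is
non-decreasing in `i`); MÖBIUS (`bb_moebius_isDegLeFun`) then gives `deg d ≤ ⌊(m+3)/2⌋`. (`m ≤ 1`: every function on `m+m ≤ 2`
bits has degree `≤ 2 ≤ …`, `bb_isDegLeFun_card`.) EXACTLY the hypothesis `hHou` of the landed `bb_band_of_small_m`. Size M. -/
theorem stub_houCubic :
    (∀ (n d : ℕ) (h : (Fin n → Bool) → Bool) (K : Finset (Fin n)), 1 ≤ d → IsDegLeFun d h →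
      ∃ z : ℤ, ∑ x ∈ {u : Fin n → Bool | ∀ i, u i = true → i ∈ K}, signOf (h x) =
        (2 : ℝ) ^ ((K.card + d - 1) / d) * (z : ℝ)) →
    ∀ (m : ℕ) (g d : (Fin (m + m) → Bool) → Bool), IsDegLeFun 3 g →
      (∀ x, W (fun y => signOf (g y)) x = (2 : ℝ) ^ m * signOf (d x)) → IsDegLeFun ((m + 3) / 2) d :=
  -- LANDED as Summit.QuantumAdvantage.QuantumAdvantage.Theorems.CubicForrelation.NearExactIsExact.stub_houCubic (p103574, ACCEPTED): plugged in by import.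
  Summit.QuantumAdvantage.QuantumAdvantage.Theorems.CubicForrelation.NearExactIsExact.stub_houCubic

/-! ### §4b The almost-Maiorana–McFarland level (lead reshape c3, 2026-08-16): relative M-subspaces of dimension `m − 1`

Every cubic `g` on `2m` bits is affine on the cosets of SOME subspace; the largest such ("relative M-subspace") has
dimension `m − k`, and `k = 0` is MM-shape (ceiling `31/32`, landed).  Level `k = 1` is the shape
`(−1)^{g(y₁ ‖ y₂)} = (−1)^{y₁·φ(y₂)} (−1)^{h(y₂)}` with `y₁ ∈ 𝔽₂^{a}`, `y₂ ∈ 𝔽₂^{a+2}` (`m = a + 1`), `φ` coordinatewise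
quadratic, `h` cubic — the generalized Maiorana–McFarland class `GMM_{m+1}` ("almost-MM", Kudin–Pasalic–Polujan–Zhang,
arXiv:2508.14265, IEEE TIT 2025, where its BENT members are characterised: `φ` is 4-to-1 onto 2-flats on which `h` has
odd weight; it contains cubic bent functions outside `MM#`).  THEOREM (lead c3, paper proof in the crux NOTES): for
cubic `f` and almost-MM-shaped cubic `g`, `Φ(f,g) = 1`, or `g` is MM-shaped (then the landed ceiling applies), or
`Φ ≤ 1 − 2⁻⁹`.  Pieces: AN (normal form), AW (Walsh/fibre identity), FP (four-point Walsh concentration), RP (rank-two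
pencils of alternating forms), AC (the ceiling, from D, R, AW, FP, RP). -/

/-- **stub_ammNormalForm** (AN; KNOWN-type, size L — the `(a, a+2)`-split twin of N). If the cubic `g` on
`(a+1)+(a+1)` bits is affine on every coset of an `a`-dimensional subspace `V` (`0 ∈ V`, xor-closed, `4|V|² = 2ⁿ`, all
second differences along `V` vanish) then a LINEAR change of coordinates sending `V` to the `y₁`-block `𝔽₂^a` (and the
transpose-inverse change on the `f`-side, preserving `⟨x,y⟩`, hence `Φ`, and all degrees) puts the pair in the sign form
`(−1)^{g₁(y₁ ‖ y₂)} = (−1)^{y₁·φ(y₂)} (−1)^{h(y₂)}` on `a + (a+2)` bits with `φ` coordinatewise quadratic (a restricted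
`y₁`-derivative of the cubic `g₁`, by D) and `h = g₁(0 ‖ ·)` cubic; moreover an M-subspace of `g₁` (dimension `a+1`) pulls
back to an M-subspace of `g` (the coordinate change is linear).  Template: `Theorems/…NearExactIsExactMmNormalForm.lean`
(`dnf_exists_submodule`, `dnf_finrank_eq`, a `dnf_exists_linearEquiv` variant for `finrank S = a` inside `𝔽₂^{(a+1)+(a+1)}`
with target blocks `Fin a` / `Fin (a+2)`, `dnf_affine`, `nf_isDegLeFun_mulVec`, `nf_isDegLeFun_restrict`). -/
theorem stub_ammNormalForm :
    (∀ (n d : ℕ) (e : (Fin n → Bool) → Bool) (t : Fin n → Bool), IsDegLeFun (d + 1) e →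
      IsDegLeFun d (fun x => e x ^^ e (bxor x t))) →
    ∀ (a : ℕ) (f g : (Fin ((a + 1) + (a + 1)) → Bool) → Bool), IsDegLeFun 3 f → IsDegLeFun 3 g →
      (∃ V : Finset (Fin ((a + 1) + (a + 1)) → Bool), zeroVec ∈ V ∧ (∀ x ∈ V, ∀ y ∈ V, bxor x y ∈ V) ∧
        V.card * V.card * 4 = 2 ^ ((a + 1) + (a + 1)) ∧
        ∀ u ∈ V, ∀ v ∈ V, ∀ y, (g y ^^ g (bxor y u) ^^ g (bxor y v) ^^ g (bxor y (bxor u v))) = false) →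
      ∃ (f₁ g₁ : (Fin (a + (a + 2)) → Bool) → Bool) (φ : (Fin (a + 2) → Bool) → (Fin a → Bool))
        (h : (Fin (a + 2) → Bool) → Bool),
        IsDegLeFun 3 f₁ ∧ (∀ i : Fin a, IsDegLeFun 2 (fun y => φ y i)) ∧ IsDegLeFun 3 h ∧
        (∀ (y₁ : Fin a → Bool) (y₂ : Fin (a + 2) → Bool),
          signOf (g₁ (Fin.append y₁ y₂)) = twist y₁ (φ y₂) * signOf (h y₂)) ∧
        forrelation f₁ g₁ = forrelation f g ∧
        ((∃ V : Finset (Fin (a + (a + 2)) → Bool), zeroVec ∈ V ∧ (∀ x ∈ V, ∀ y ∈ V, bxor x y ∈ V) ∧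
            V.card * V.card = 2 ^ (a + (a + 2)) ∧
            ∀ u ∈ V, ∀ v ∈ V, ∀ y, (g₁ y ^^ g₁ (bxor y u) ^^ g₁ (bxor y v) ^^ g₁ (bxor y (bxor u v))) = false) →
          ∃ V : Finset (Fin ((a + 1) + (a + 1)) → Bool), zeroVec ∈ V ∧ (∀ x ∈ V, ∀ y ∈ V, bxor x y ∈ V) ∧
            V.card * V.card = 2 ^ ((a + 1) + (a + 1)) ∧
            ∀ u ∈ V, ∀ v ∈ V, ∀ y, (g y ^^ g (bxor y u) ^^ g (bxor y v) ^^ g (bxor y (bxor u v))) = false) :=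
  -- LANDED as Summit.QuantumAdvantage.QuantumAdvantage.Theorems.CubicForrelation.NearExactIsExact.stub_ammNormalForm (p128130, ACCEPTED): plugged in by import.
  Summit.QuantumAdvantage.QuantumAdvantage.Theorems.CubicForrelation.NearExactIsExact.stub_ammNormalForm

/-- **stub_ammWalsh** (AW; KNOWN-type, size M — the `(a, a+2)`-split twin of F1 = `stub_mmWalsh`). For `g` in the
almost-MM sign form with an ARBITRARY map `φ : 𝔽₂^{a+2} → 𝔽₂^a`, summing over the linear block `y₁ ∈ 𝔽₂^a` first gives
`W_g(x₁ ‖ x₂) = 2^a Σ_{y₂ : φ y₂ = x₁} (−1)^{h(y₂)} (−1)^{x₂·y₂}`, hence (with `n = 2a+2`, `√(2^{3n}) = 2^{3a+3}`)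
`Φ(f,g) = 2^{−(2a+3)} Σ_{y₂} (−1)^{h(y₂)} Σ_{x₂} (−1)^{f(φ(y₂) ‖ x₂)} (−1)^{x₂·y₂}` — the average over `y₂` of the signed,
`y₂`-twisted bias of `f` on the fibre `{x₁ = φ(y₂)}`.  A pure identity (no degree hypotheses).  Template: the lemmas
`F1.mw_*` above / `Theorems/…NearExactIsExactMmWalsh.lean` with the blocks `Fin a`, `Fin (a+2)`. -/
theorem stub_ammWalsh :
    ∀ (a : ℕ) (f g : (Fin (a + (a + 2)) → Bool) → Bool) (φ : (Fin (a + 2) → Bool) → (Fin a → Bool))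
      (h : (Fin (a + 2) → Bool) → Bool),
      (∀ (y₁ : Fin a → Bool) (y₂ : Fin (a + 2) → Bool),
        signOf (g (Fin.append y₁ y₂)) = twist y₁ (φ y₂) * signOf (h y₂)) →
      forrelation f g = ((2 : ℝ) ^ (2 * a + 3))⁻¹ *
        ∑ y₂ : Fin (a + 2) → Bool, signOf (h y₂) *
          ∑ x₂ : Fin (a + 2) → Bool, signOf (f (Fin.append (φ y₂) x₂)) * twist x₂ y₂ :=
  -- LANDED as Summit.QuantumAdvantage.QuantumAdvantage.Theorems.CubicForrelation.NearExactIsExact.stub_ammWalsh (p127998, ACCEPTED): plugged in by import.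
  Summit.QuantumAdvantage.QuantumAdvantage.Theorems.CubicForrelation.NearExactIsExact.stub_ammWalsh

/-- **stub_fourPoint** (FP; NEW, size M — four-point Walsh concentration). If a function `c` of degree `≤ 3` on `k` bits
puts more than `15/8 · 2^k` of absolute Walsh mass on four distinct characters `y₁..y₄` (the maximum over ALL Boolean `c`
is `2 · 2^k`, attained only in the aligned case), then the four characters form a 2-flat `s + ⟨u, v⟩` and `c` is the
ALIGNED rank-2 quadratic `(u·x)(v·x) ⊕ s·x ⊕ e`, i.e. `(−1)^{c} = (−1)^e (−1)^{s·x} (1 + U + V − UV)/2` with `U = (−1)^{u·x}`,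
`V = (−1)^{v·x}` (so `|ĉ| = 2^{k−1}` on the flat and `0` elsewhere).  Proof: WLOG `y₁ = 0` (replace `c` by `c ⊕ y₁·x`);
`Σ_S ĉ² ≥ (Σ_S |ĉ|)²/4 > (15/16)² 4^k > (7/8) 4^k`, so `ψ := Σ_{y ∈ S} ĉ(y) χ_y` has `‖(−1)^c − ψ‖₂² < 4^k/8·…` (Parseval) and
the Boolean `k(x) := [ψ(x) < 0]`, a function of the three linear forms `y₂·x, y₃·x, y₄·x` (degree `≤ 3`,
`fc_isDegLeFun_comp`-style), differs from `c` on `< 2^k/8` points; two degree-`≤ 3` functions that close coincide (R with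
`d = 3`), so `c` depends on `≤ 3` linear forms and `ĉ` lives on their span `U`.  If `dim U = 3` the sum of the four
`|κ̂|` at `{0, e₁, e₂, e₃}` over all `κ : 𝔽₂³ → 𝔽₂` is `≤ 3/2 · 2^k` (finite check, 256 functions) — contradiction; so
`y₄ = y₂ ⊕ y₃` (a 2-flat) and `c = κ(y₂·x, y₃·x)` with all four Walsh values of `κ` of modulus `1/2`, i.e. `κ = z₁z₂ ⊕` affine. -/
theorem stub_fourPoint :
    ∀ (k : ℕ) (c : (Fin k → Bool) → Bool) (y₁ y₂ y₃ y₄ : Fin k → Bool), IsDegLeFun 3 c →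
      y₁ ≠ y₂ → y₁ ≠ y₃ → y₁ ≠ y₄ → y₂ ≠ y₃ → y₂ ≠ y₄ → y₃ ≠ y₄ →
      (15 / 8 : ℝ) * (2 : ℝ) ^ k < |W (fun x => signOf (c x)) y₁| + |W (fun x => signOf (c x)) y₂| +
        |W (fun x => signOf (c x)) y₃| + |W (fun x => signOf (c x)) y₄| →
      ∃ (s u v : Fin k → Bool) (e : Bool), u ≠ zeroVec ∧ v ≠ zeroVec ∧ u ≠ v ∧
        (∀ x, signOf (c x) = signOf e * twist s x * ((1 + twist u x + twist v x - twist u x * twist v x) / 2)) ∧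
        ({y₁, y₂, y₃, y₄} : Finset (Fin k → Bool)) = {s, bxor s u, bxor s v, bxor s (bxor u v)} :=
  -- LANDED as Summit.QuantumAdvantage.QuantumAdvantage.Theorems.CubicForrelation.NearExactIsExact.stub_fourPoint (p129831, ACCEPTED; worker): plugged in by import.
  Summit.QuantumAdvantage.QuantumAdvantage.Theorems.CubicForrelation.NearExactIsExact.stub_fourPoint

/-- **stub_rankTwoPencil** (RP; NEW, size L — affine pencils of alternating matrices of rank `≤ 2` over `𝔽₂`). Let
`x ↦ M x` be an AFFINE family (`M(x ⊕ x′) = M x ⊕ M x′ ⊕ M 0`) of symmetric zero-diagonal `k × k` Boolean matrices indexed by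
`x ∈ 𝔽₂^a`, each satisfying the Plücker/Pfaffian identities `M_{ij}M_{i′j′} ⊕ M_{ii′}M_{jj′} ⊕ M_{ij′}M_{ji′} = 0` (⟺ rank
`≤ 2` ⟺ `M x = 0` or `M x = u vᵀ + v uᵀ` with rows spanning the plane `⟨u,v⟩`), and suppose `M z = 0` for some `z`.  Then
the image `{M x}` is a LINEAR space of rank-`≤ 2` forms; two of its planes always meet in a line (else their sum has rank 4,
violating Plücker at dual vectors), and planes pairwise meeting in lines either all contain a common line `⟨w⟩` — then `w`
lies in the row space of every non-zero `M x` (first disjunct; `w = Σ_i s_i · row_i(M x)` over `𝔽₂`) — or all lie in a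
common 3-space `W`, whence at most `8` distinct matrices occur and the zero-fibre `Z = {z : M z = 0}`, a coset of the kernel
of the linear part, has `|Z| ≥ 2^a/8` (second disjunct).  [folklore linear algebra; cf. arXiv:2508.14265 Prop. 4.1 for
the use of the common vector] -/
theorem stub_rankTwoPencil :
    ∀ (a k : ℕ) (M : (Fin a → Bool) → Fin k → Fin k → Bool),
      (∀ x i, M x i i = false) → (∀ x i j, M x i j = M x j i) →
      (∀ x x' i j, M (bxor x x') i j = (M x i j ^^ M x' i j ^^ M zeroVec i j)) →
      (∀ x i j i' j', ((M x i j && M x i' j') ^^ (M x i i' && M x j j') ^^ (M x i j' && M x j i')) = false) →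
      (∃ z, ∀ i j, M z i j = false) →
      (∃ w : Fin k → Bool, w ≠ zeroVec ∧ ∀ x, (∃ i j, M x i j = true) →
          ∃ s : Fin k → Bool, ∀ l, (if w l then (1 : ZMod 2) else 0) =
            ∑ i, (if s i then (1 : ZMod 2) else 0) * (if M x i l then (1 : ZMod 2) else 0)) ∨
      2 ^ a ≤ 8 * (univ.filter fun z : Fin a → Bool => ∀ i j, M z i j = false).card :=
  -- LANDED as Summit.QuantumAdvantage.QuantumAdvantage.Theorems.CubicForrelation.NearExactIsExact.stub_rankTwoPencil (p129164, ACCEPTED; worker): plugged in by import.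
  Summit.QuantumAdvantage.QuantumAdvantage.Theorems.CubicForrelation.NearExactIsExact.stub_rankTwoPencil

/-- **stub_ammAccounting** (AA; NEW, size L — the fibre accounting of the almost-MM ceiling, from FP). For cubic `f`
on `a + (a+2)` bits, ANY map `φ : 𝔽₂^{a+2} → 𝔽₂^a` and any `h`, write `K = 2^{a+2}`, `c_{x₁} = f(x₁ ‖ ·)`,
`W_{x₁}(y) = W_{(−1)^{c_{x₁}}}(y)` (so `Σ_y W_{x₁}(y)² = K²`), `T(y) = (−1)^{h y} W_{φ y}(y)` and
`Φ′ := 2^{−(2a+3)} Σ_y T(y)` (`= Φ(f,g)` for `g` in almost-MM sign form, by AW).  Call `x₁` GOOD when its fibre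
`φ⁻¹(x₁)` has exactly 4 points and `T = K/2` on them.  Then `#BAD ≤ 2^{a+4}(1 − Φ′)`.  Proof (crux NOTES §AMM): the exact
identity `Σ_y (T(y) − K/2)² + Σ_{x₁} SP(x₁) = 2^{a+1}K²(1 − Φ′)` with `SP(x₁) = Σ_{y ∉ φ⁻¹(x₁)} W_{x₁}(y)² ≥ 0`
(fibrewise Parseval); per fibre `S` of size `n` with `v = Σ_S (T − K/2)²`: `K Σ_S |W| ≥ K²(1 + n/4) − (SP + v)` while the
integrality bound `(2k+2) Σ_x |Σ_{y∈S} ±(−1)^{x·y}| ≤ K(n + k(k+2))` (`k ≡ n (2)`; pointwise `(|ψ|−k)(|ψ|−k−2) ≥ 0` +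
Parseval) gives `Σ_S |W| ≤ K(n+3)/4` (`n` odd), `≤ K` (`n = 2`), `≤ K(n+8)/6` (`n` even); so `SP + v < K²/6 ⇒ n = 4`, and then
`SP + v < K²/8 ⇒ Σ_S |W| > 15K/8 ⇒` (FP, `c_{x₁}` is cubic) `|W| = K/2` on `S`, `SP = 0`, every mismatch costs `K²` in `v`
`⇒` GOOD.  Hence BAD `⇒ SP + v ≥ K²/8` and `#BAD · K²/8 ≤ 2^{a+1}K²(1 − Φ′)`. -/
theorem stub_ammAccounting :
    (∀ (k : ℕ) (c : (Fin k → Bool) → Bool) (y₁ y₂ y₃ y₄ : Fin k → Bool), IsDegLeFun 3 c →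
      y₁ ≠ y₂ → y₁ ≠ y₃ → y₁ ≠ y₄ → y₂ ≠ y₃ → y₂ ≠ y₄ → y₃ ≠ y₄ →
      (15 / 8 : ℝ) * (2 : ℝ) ^ k < |W (fun x => signOf (c x)) y₁| + |W (fun x => signOf (c x)) y₂| +
        |W (fun x => signOf (c x)) y₃| + |W (fun x => signOf (c x)) y₄| →
      ∃ (s u v : Fin k → Bool) (e : Bool), u ≠ zeroVec ∧ v ≠ zeroVec ∧ u ≠ v ∧
        (∀ x, signOf (c x) = signOf e * twist s x * ((1 + twist u x + twist v x - twist u x * twist v x) / 2)) ∧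
        ({y₁, y₂, y₃, y₄} : Finset (Fin k → Bool)) = {s, bxor s u, bxor s v, bxor s (bxor u v)}) →
    ∀ (a : ℕ) (f : (Fin (a + (a + 2)) → Bool) → Bool) (φ : (Fin (a + 2) → Bool) → (Fin a → Bool))
      (h : (Fin (a + 2) → Bool) → Bool), IsDegLeFun 3 f →
      ((univ.filter fun x₁ : Fin a → Bool => ¬ ((univ.filter fun y : Fin (a + 2) → Bool => φ y = x₁).card = 4 ∧
          ∀ y : Fin (a + 2) → Bool, φ y = x₁ →
            signOf (h y) * W (fun x₂ => signOf (f (Fin.append x₁ x₂))) y = (2 : ℝ) ^ (a + 2) / 2)).card : ℝ) ≤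
        (2 : ℝ) ^ (a + 4) * (1 - ((2 : ℝ) ^ (2 * a + 3))⁻¹ *
          ∑ y₂ : Fin (a + 2) → Bool, signOf (h y₂) *
            ∑ x₂ : Fin (a + 2) → Bool, signOf (f (Fin.append (φ y₂) x₂)) * twist x₂ y₂) :=
  -- LANDED as Summit.QuantumAdvantage.QuantumAdvantage.Theorems.CubicForrelation.NearExactIsExact.stub_ammAccounting (p129700, ACCEPTED; worker): plugged in by import.
  Summit.QuantumAdvantage.QuantumAdvantage.Theorems.CubicForrelation.NearExactIsExact.stub_ammAccounting

/-- **stub_ammCeiling** (AC; NEW, size XL, HELD BY THE LEAD — the almost-MM ceiling, from D, R, AW, FP, RP, AA). For cubic `f`,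
coordinatewise-quadratic `φ : 𝔽₂^{a+2} → 𝔽₂^a`, cubic `h` and `g` in almost-MM sign form: `Φ(f,g) = 1`, or
`Φ(f,g) ≤ 1 − 2⁻¹⁰`, or `g` has an M-subspace (dimension `a+1`).  Proof (crux NOTES §AMM): by AW, `Φ = 2^{−(a+1)} Σ_y t(y)`
with `t(y) = (−1)^{h y} ĉ_{φ y}(y)`, `c_{x₁} = f(x₁ ‖ ·)`; the EXACT accounting identity
`Σ_y (t(y) − 1/2)² + Σ_{x₁} spill(x₁) = 2^{a+1}(1 − Φ)` (fibrewise Parseval) plus the integrality bound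
`E|Σ_{y∈S} ±χ_y| ≤ (|S| + k(k+2))/(2k+2)` and FP make every fibre `x₁` with `spill + v < 1/8` GOOD (`|φ⁻¹(x₁)| = 4`, a 2-flat,
`c_{x₁}` the aligned rank-2 quadratic, signs of `h` matching): bad fraction `≤ 16(1 − Φ)`.  Walls in `x₁ ∈ 𝔽₂^a` (R): the
Plücker identities of the second-difference form `B_{x₁}(s,t) = (D_s D_t f)(x₁ ‖ 0)` (entries of degree `≤ 1` in `x₁` by D)
have degree `≤ 2` (need bad `< 1/4`); the corner identities `B_{ij}(x₁)·[φ(a′(x₁) ⊕ σ row_i ⊕ τ row_j) = x₁]` have degree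
`≤ 5` (need bad `< 1/32`, i.e. `1 − Φ < 2⁻⁹`); then `Φ ≤ 1 − |Z|/2^{a+1}` with `Z = {B_{x₁} = 0}`; RP: a common direction
`w` makes `φ` `w`-periodic (an affine map vanishing on `> 1/2` of `𝔽₂^{a+2}`), i.e. `y₁`-block `⊕ ⟨w⟩` is an M-subspace of `g`
(arXiv:2508.14265 Prop 4.1); else `|Z| ≥ 2^{a−3}` and `Φ ≤ 15/16`; `Z = ∅`: all fibres are the corner flats,
`Φ = 1 − #mismatches/2^{a+1}`, and a non-zero mismatch indicator `B_{ij}·μ` of degree `≤ 7` forces `1 − Φ ≥ 2⁻⁸`. -/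
theorem stub_ammCeiling :
    (∀ (n d : ℕ) (e : (Fin n → Bool) → Bool) (t : Fin n → Bool), IsDegLeFun (d + 1) e →
      IsDegLeFun d (fun x => e x ^^ e (bxor x t))) →
    (∀ (m d : ℕ) (e : (Fin m → Bool) → Bool), IsDegLeFun d e → (∃ x, e x = true) →
      2 ^ m ≤ 2 ^ d * (univ.filter fun x => e x = true).card) →
    (∀ (a : ℕ) (f g : (Fin (a + (a + 2)) → Bool) → Bool) (φ : (Fin (a + 2) → Bool) → (Fin a → Bool))
      (h : (Fin (a + 2) → Bool) → Bool),
      (∀ (y₁ : Fin a → Bool) (y₂ : Fin (a + 2) → Bool),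
        signOf (g (Fin.append y₁ y₂)) = twist y₁ (φ y₂) * signOf (h y₂)) →
      forrelation f g = ((2 : ℝ) ^ (2 * a + 3))⁻¹ *
        ∑ y₂ : Fin (a + 2) → Bool, signOf (h y₂) *
          ∑ x₂ : Fin (a + 2) → Bool, signOf (f (Fin.append (φ y₂) x₂)) * twist x₂ y₂) →
    (∀ (k : ℕ) (c : (Fin k → Bool) → Bool) (y₁ y₂ y₃ y₄ : Fin k → Bool), IsDegLeFun 3 c →
      y₁ ≠ y₂ → y₁ ≠ y₃ → y₁ ≠ y₄ → y₂ ≠ y₃ → y₂ ≠ y₄ → y₃ ≠ y₄ →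
      (15 / 8 : ℝ) * (2 : ℝ) ^ k < |W (fun x => signOf (c x)) y₁| + |W (fun x => signOf (c x)) y₂| +
        |W (fun x => signOf (c x)) y₃| + |W (fun x => signOf (c x)) y₄| →
      ∃ (s u v : Fin k → Bool) (e : Bool), u ≠ zeroVec ∧ v ≠ zeroVec ∧ u ≠ v ∧
        (∀ x, signOf (c x) = signOf e * twist s x * ((1 + twist u x + twist v x - twist u x * twist v x) / 2)) ∧
        ({y₁, y₂, y₃, y₄} : Finset (Fin k → Bool)) = {s, bxor s u, bxor s v, bxor s (bxor u v)}) →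
    (∀ (a k : ℕ) (M : (Fin a → Bool) → Fin k → Fin k → Bool),
      (∀ x i, M x i i = false) → (∀ x i j, M x i j = M x j i) →
      (∀ x x' i j, M (bxor x x') i j = (M x i j ^^ M x' i j ^^ M zeroVec i j)) →
      (∀ x i j i' j', ((M x i j && M x i' j') ^^ (M x i i' && M x j j') ^^ (M x i j' && M x j i')) = false) →
      (∃ z, ∀ i j, M z i j = false) →
      (∃ w : Fin k → Bool, w ≠ zeroVec ∧ ∀ x, (∃ i j, M x i j = true) →
          ∃ s : Fin k → Bool, ∀ l, (if w l then (1 : ZMod 2) else 0) =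
            ∑ i, (if s i then (1 : ZMod 2) else 0) * (if M x i l then (1 : ZMod 2) else 0)) ∨
      2 ^ a ≤ 8 * (univ.filter fun z : Fin a → Bool => ∀ i j, M z i j = false).card) →
    ((∀ (k : ℕ) (c : (Fin k → Bool) → Bool) (y₁ y₂ y₃ y₄ : Fin k → Bool), IsDegLeFun 3 c →
      y₁ ≠ y₂ → y₁ ≠ y₃ → y₁ ≠ y₄ → y₂ ≠ y₃ → y₂ ≠ y₄ → y₃ ≠ y₄ →
      (15 / 8 : ℝ) * (2 : ℝ) ^ k < |W (fun x => signOf (c x)) y₁| + |W (fun x => signOf (c x)) y₂| +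
        |W (fun x => signOf (c x)) y₃| + |W (fun x => signOf (c x)) y₄| →
      ∃ (s u v : Fin k → Bool) (e : Bool), u ≠ zeroVec ∧ v ≠ zeroVec ∧ u ≠ v ∧
        (∀ x, signOf (c x) = signOf e * twist s x * ((1 + twist u x + twist v x - twist u x * twist v x) / 2)) ∧
        ({y₁, y₂, y₃, y₄} : Finset (Fin k → Bool)) = {s, bxor s u, bxor s v, bxor s (bxor u v)}) →
    ∀ (a : ℕ) (f : (Fin (a + (a + 2)) → Bool) → Bool) (φ : (Fin (a + 2) → Bool) → (Fin a → Bool))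
      (h : (Fin (a + 2) → Bool) → Bool), IsDegLeFun 3 f →
      ((univ.filter fun x₁ : Fin a → Bool => ¬ ((univ.filter fun y : Fin (a + 2) → Bool => φ y = x₁).card = 4 ∧
          ∀ y : Fin (a + 2) → Bool, φ y = x₁ →
            signOf (h y) * W (fun x₂ => signOf (f (Fin.append x₁ x₂))) y = (2 : ℝ) ^ (a + 2) / 2)).card : ℝ) ≤
        (2 : ℝ) ^ (a + 4) * (1 - ((2 : ℝ) ^ (2 * a + 3))⁻¹ *
          ∑ y₂ : Fin (a + 2) → Bool, signOf (h y₂) *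
            ∑ x₂ : Fin (a + 2) → Bool, signOf (f (Fin.append (φ y₂) x₂)) * twist x₂ y₂)) →
    ∀ (a : ℕ) (f g : (Fin (a + (a + 2)) → Bool) → Bool) (φ : (Fin (a + 2) → Bool) → (Fin a → Bool))
      (h : (Fin (a + 2) → Bool) → Bool),
      IsDegLeFun 3 f → (∀ i : Fin a, IsDegLeFun 2 (fun y => φ y i)) → IsDegLeFun 3 h →
      (∀ (y₁ : Fin a → Bool) (y₂ : Fin (a + 2) → Bool),
        signOf (g (Fin.append y₁ y₂)) = twist y₁ (φ y₂) * signOf (h y₂)) →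
      forrelation f g = 1 ∨ forrelation f g ≤ 1 - 1 / 1024 ∨
        (∃ V : Finset (Fin (a + (a + 2)) → Bool), zeroVec ∈ V ∧ (∀ x ∈ V, ∀ y ∈ V, bxor x y ∈ V) ∧
          V.card * V.card = 2 ^ (a + (a + 2)) ∧
          ∀ u ∈ V, ∀ v ∈ V, ∀ y, (g y ^^ g (bxor y u) ^^ g (bxor y v) ^^ g (bxor y (bxor u v))) = false) :=
  -- LANDED as Summit.QuantumAdvantage.QuantumAdvantage.Theorems.CubicForrelation.NearExactIsExact.stub_ammCeiling (p129733, ACCEPTED; lead c3): plugged in by import.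
  Summit.QuantumAdvantage.QuantumAdvantage.Theorems.CubicForrelation.NearExactIsExact.stub_ammCeiling

/-! ### §4d Low-rank dyadic rigidity of the PARTNER and the every-direction row defect (lead reshape c4, 2026-08-16)

Orthogonal to the shape classes above: in the BENT branch the dual `d` of `g` has a derivative table that is the
TRANSPOSE of `g`'s (`bb_dwt_transpose_dual`), hence DYADIC entrywise (`D_v g` is quadratic: Dickson); along every
direction `u` where the cubic partner `f` has a derivative of low rank (row `u` of `T_f` plateaued at a level
`2^s ≥ 2^{n−j}`) and `8·wt(f ⊕ d) < 2^s`, sup-norm pinning + Parseval force `D_u (f ⊕ d) ≡ 0` (LP); the defect is then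
invariant under the xor-span of those directions and its weight is divisible by the span's size (IW):
`Φ = 1 ∨ Φ ≤ 1 − 2^{−(j+2)} ∨ Φ ≤ 1 − 2^{1−k}` whenever the span has codimension `≤ k` (`lrdrBand_of_parts`, crux idea
`low-rank-dyadic-rigidity`).  UR is the every-direction form of near-exactness (crux idea `dyadic-table-incidence-rigidity`). -/

/-- Row `u` of the derivative table of `f` is LOW-RANK at level `j`: every nonzero entry `T_f(u,v)` has
`T_f(u,v)² ≥ 4^{n−j}` (for cubic `f`: the quadratic `D_u f` has symplectic rank `≤ 2j`). -/
def LowRankDir (j : ℕ) (f : (Fin n → Bool) → Bool) (u : Fin n → Bool) : Prop :=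
  ∀ v, dwt (fun x => signOf (f x)) u v = 0 ∨ (4 : ℝ) ^ n ≤ (4 : ℝ) ^ j * dwt (fun x => signOf (f x)) u v ^ 2

/-- `v` lies in the xor-span of the level-`j` low-rank directions of `f` (stated as an induction principle). -/
def InLowRankSpan (j : ℕ) (f : (Fin n → Bool) → Bool) (v : Fin n → Bool) : Prop :=
  ∀ P : (Fin n → Bool) → Prop, (∀ u, LowRankDir j f u → P u) → P zeroVec →
    (∀ x y, P x → P y → P (bxor x y)) → P v

/-- `f` is `(j,k)`-LOW-RANK-SPANNED: an xor-closed `V ∋ 0` with `2ⁿ ≤ 2^k |V|` lies inside the xor-span of the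
level-`j` low-rank directions of `f`. -/
def LRSpanned (j k : ℕ) (f : (Fin n → Bool) → Bool) : Prop :=
  ∃ V : Finset (Fin n → Bool), zeroVec ∈ V ∧ (∀ x ∈ V, ∀ y ∈ V, bxor x y ∈ V) ∧ 2 ^ n ≤ 2 ^ k * V.card ∧
    ∀ v ∈ V, InLowRankSpan j f v

/-- `f` has NO LOW-RANK UNBALANCED DERIVATIVE: every nonzero direction whose row of `T_f` is low-rank at level `3`
(for cubic `f`: `rank D_h f ≤ 6`) has a BALANCED derivative (`T_f(h,0) = Σ_x (−1)^{D_h f(x)} = 0`).  Pairs in the window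
`Φ > 1 − 2⁻¹⁰` have this on both sides (`noLowRankUnbalanced_of_window`, two-sided almost-bentness). -/
def NoLowRankUnbalanced (f : (Fin n → Bool) → Bool) : Prop :=
  ∀ h, h ≠ zeroVec → LowRankDir 3 f h → dwt (fun x => signOf (f x)) h zeroVec = 0

/-- **stub_quadWalshPlateau** (QW; KNOWN — Dickson's theorem in support form, MacWilliams–Sloane Ch. 15 §2 Thm 5 /
Carlet2020 Prop. 55; size M). The Walsh spectrum of a function of degree `≤ 2` is PLATEAUED at an EVEN level: there
is `s` with `W(v) ∈ {0, ±2^s}` for all `v`. Route: bridge `IsDegLeFun 2 q` to `toZFun q ∈ lowDeg n 2`, then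
`QuadSampler.walsh_sq_eq` (`W² = 2ⁿ·|rad|·[support]`), `card_rad_eq_two_pow` (`|rad| = 2^d`), and integrality of `W`
(`abs_eq_two_pow_half_of_sq_eq`: an integer square equal to `2^N` forces `N` even); `walsh q v` and
`W (signOf ∘ q) v` agree by `signOf_eq_sgnZ` / `twist_comm`. -/
theorem stub_quadWalshPlateau :
    ∀ (n : ℕ) (q : (Fin n → Bool) → Bool), IsDegLeFun 2 q →
      ∃ s : ℕ, ∀ v, W (fun x => signOf (q x)) v = 0 ∨ W (fun x => signOf (q x)) v ^ 2 = (4 : ℝ) ^ s :=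
  -- LANDED as Summit.QuantumAdvantage.QuantumAdvantage.Theorems.CubicForrelation.NearExactIsExact.stub_quadWalshPlateau (p131052, ACCEPTED; worker): plugged in by import.
  Summit.QuantumAdvantage.QuantumAdvantage.Theorems.CubicForrelation.NearExactIsExact.stub_quadWalshPlateau

/-- **stub_dyadicPin** (DP; elementary, size S). A dyadic value within less than half of `±2^s` IS `±2^s`:
`x² = 4^s`, `y ∈ {0} ∪ {±2^t}`, `|y − x| < 2^s/2 ⇒ y = x`. -/
theorem stub_dyadicPin :
    ∀ (x y : ℝ) (s : ℕ), x ^ 2 = (4 : ℝ) ^ s → (y = 0 ∨ ∃ t : ℕ, y ^ 2 = (4 : ℝ) ^ t) →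
      |y - x| < (2 : ℝ) ^ s / 2 → y = x :=
  -- LANDED as Summit.QuantumAdvantage.QuantumAdvantage.Theorems.CubicForrelation.NearExactIsExact.stub_dyadicPin (p130948, ACCEPTED; worker): plugged in by import.
  Summit.QuantumAdvantage.QuantumAdvantage.Theorems.CubicForrelation.NearExactIsExact.stub_dyadicPin

/-- **stub_perturbRow** (PR; elementary, size M). Xoring `e` into `a` moves every entry of row `u` of the derivative
table by at most `4·wt(e)`: termwise `|(-1)^{D_u(a⊕e)(x)} − (-1)^{D_u a(x)}| ≤ 2([e x] + [e (x ⊕ u)])`, and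
`x ↦ x ⊕ u` is a bijection. -/
theorem stub_perturbRow :
    ∀ (n : ℕ) (a e : (Fin n → Bool) → Bool) (u v : Fin n → Bool),
      |dwt (fun x => signOf (a x ^^ e x)) u v - dwt (fun x => signOf (a x)) u v| ≤
        4 * ((univ.filter fun x => e x = true).card : ℝ) :=
  -- LANDED as Summit.QuantumAdvantage.QuantumAdvantage.Theorems.CubicForrelation.NearExactIsExact.stub_perturbRow (p131003, ACCEPTED; worker): plugged in by import.
  Summit.QuantumAdvantage.QuantumAdvantage.Theorems.CubicForrelation.NearExactIsExact.stub_perturbRow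

/-- **stub_invariantWeight** (IW; elementary orbit counting, size M). If `e` is invariant under every translation
by an element of an xor-closed `V ∋ 0`, then `supp e` is a disjoint union of `V`-cosets, each of size `|V|`
(translation is injective), so `|V|` divides `wt(e)`. -/
theorem stub_invariantWeight :
    ∀ (n : ℕ) (e : (Fin n → Bool) → Bool) (V : Finset (Fin n → Bool)), zeroVec ∈ V →
      (∀ x ∈ V, ∀ y ∈ V, bxor x y ∈ V) → (∀ u ∈ V, ∀ x, e (bxor x u) = e x) →
      V.card ∣ (univ.filter fun x => e x = true).card :=
  -- LANDED as Summit.QuantumAdvantage.QuantumAdvantage.Theorems.CubicForrelation.NearExactIsExact.stub_invariantWeight (p130981, ACCEPTED; worker): plugged in by import.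
  Summit.QuantumAdvantage.QuantumAdvantage.Theorems.CubicForrelation.NearExactIsExact.stub_invariantWeight

/-- **stub_lrdrPin** (LP; NEW, size L — sup-norm pinning + Parseval, from DP). Two `±1`-valued functions `A, B`
whose `u`-rows of derivative tables satisfy: `A`'s row is plateaued (`T_A(u,v) ∈ {0, ±2^s}`), `B`'s row is dyadic
entrywise (`T_B(u,v) ∈ {0} ∪ {±2^t}`), and the rows are uniformly `w`-close with `w < 2^s/2`. Then the rows are EQUAL
(DP on the support of `A`'s row; Parseval `Σ_v T² = 4ⁿ` for both rows (`sum_dwt_sq_of_sq`) kills `B` off that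
support), hence so are the functions `x ↦ A(x)A(x⊕u)` and `x ↦ B(x)B(x⊕u)` (Walsh inversion via `sum_W_sq` applied
to the difference: `dwt F u = W (F · F(· ⊕ u))`). -/
theorem stub_lrdrPin :
    (∀ (x y : ℝ) (s : ℕ), x ^ 2 = (4 : ℝ) ^ s → (y = 0 ∨ ∃ t : ℕ, y ^ 2 = (4 : ℝ) ^ t) →
      |y - x| < (2 : ℝ) ^ s / 2 → y = x) →
    ∀ (n : ℕ) (A B : (Fin n → Bool) → ℝ) (u : Fin n → Bool) (s : ℕ) (w : ℝ),
      (∀ x, A x ^ 2 = 1) → (∀ x, B x ^ 2 = 1) →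
      (∀ v, dwt A u v = 0 ∨ dwt A u v ^ 2 = (4 : ℝ) ^ s) →
      (∀ v, dwt B u v = 0 ∨ ∃ t : ℕ, dwt B u v ^ 2 = (4 : ℝ) ^ t) →
      (∀ v, |dwt B u v - dwt A u v| ≤ w) → w < (2 : ℝ) ^ s / 2 →
      ∀ x, A x * A (bxor x u) = B x * B (bxor x u) :=
  -- LANDED as Summit.QuantumAdvantage.QuantumAdvantage.Theorems.CubicForrelation.NearExactIsExact.stub_lrdrPin (p130993, ACCEPTED; worker): plugged in by import.
  Summit.QuantumAdvantage.QuantumAdvantage.Theorems.CubicForrelation.NearExactIsExact.stub_lrdrPin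

/-- **stub_uniformRowDefect** (UR; NEW for this crux, size L — the every-direction form of near-exactness, all Boolean
`f, g`). With `P(x) = (-1)^{f(x)} W_g(x)` (`Σ P² = 4ⁿ` by `sum_W_sq`, `Σ P = 2^{3n/2} Φ`), the transposed-row inner
product is `Σ_u T_f(h,u) T_g(u,h) = Σ_x P(x) P(x ⊕ h)` (`sum_dwt_mul_dwt_row`), and `L(h) := Σ_x (P(x) − P(x⊕h))² =
2·4ⁿ − 2 Σ_x P(x)P(x⊕h)` has `Σ_h L(h) = 2·2ⁿ·4ⁿ(1 − Φ²)`; `L(s₁ ⊕ s₂) ≤ 2L(s₁) + 2L(s₂)` ((a+b)² ≤ 2a² + 2b², reindex);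
Markov: `S = {L ≤ 4·4ⁿ(1 − Φ²)}` has `|S| > 2ⁿ/2`, so `S ∩ (h ⊕ S) ≠ ∅` and every `h = s₁ ⊕ s₂` with `sᵢ ∈ S`:
`L(h) ≤ 16·4ⁿ(1 − Φ²)`, i.e. `Σ_u T_f(h,u)T_g(u,h) ≥ 4ⁿ(1 − 8(1 − Φ²))` for EVERY `h`. -/
theorem stub_uniformRowDefect :
    ∀ (n : ℕ) (f g : (Fin n → Bool) → Bool) (h : Fin n → Bool),
      (4 : ℝ) ^ n * (1 - 8 * (1 - forrelation f g ^ 2)) ≤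
        ∑ u, dwt (fun x => signOf (f x)) h u * dwt (fun y => signOf (g y)) u h :=
  -- LANDED as Summit.QuantumAdvantage.QuantumAdvantage.Theorems.CubicForrelation.NearExactIsExact.stub_uniformRowDefect (p131237, ACCEPTED; worker): plugged in by import.
  Summit.QuantumAdvantage.QuantumAdvantage.Theorems.CubicForrelation.NearExactIsExact.stub_uniformRowDefect

/-! ### VG tools (verbatim copies of the LANDED lemmas of `Theorems/CubicForrelationNearExactIsExactValueGranularity.lean`, p132139;
inlined because the farm snapshot does not yet serve that module's olean, 2026-08-17T00Z — lead c4) -/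
namespace VG

open Literature.Computability.QuantumComplexity.DerivativeWalsh (fsum fsum_eq_sum_mul_W fsum_signOf_eq)
open Literature.Computability.QuantumComplexity.SgnForrMem (signOf_decide_odd)
open Summit.QuantumAdvantage.QuantumAdvantage.Theorems.SignedCubicForrelationNotPrBPP (knf_isDegLeFun_ip)
open Summit.QuantumAdvantage.QuantumAdvantage.Theorems.CubicForrelation.NearExactIsExact (qp_sqrt_two_pow_three_mul_add_self
  bb_isDegLeFun_bxor)

/-- `2^{3m} Φ(f,g) = Σ_x (−1)^{f(x)} W_g(x)`. [folklore] -/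
theorem vg_two_pow_mul_forrelation {m : ℕ} (f g : (Fin (m + m) → Bool) → Bool) :
    (2 : ℝ) ^ (3 * m) * forrelation f g = ∑ x, signOf (f x) * W (fun y => signOf (g y)) x := by
  rw [← fsum_eq_sum_mul_W, fsum_signOf_eq, qp_sqrt_two_pow_three_mul_add_self]

/-- The twist is the sign of the inner-product parity. [folklore] -/
theorem vg_twist_eq_signOf (y x : Fin n → Bool) :
    twist y x = signOf (decide (Odd (univ.filter fun i => y i && x i).card)) := by
  rw [signOf_decide_odd, Simon.twist_eq_neg_one_pow]

/-- `W_g(x) = Σ_y (−1)^{g(y) ⊕ [y·x odd]}`. [folklore] -/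
theorem vg_W_eq_sum_signOf_bxor (g : (Fin n → Bool) → Bool) (x : Fin n → Bool) :
    W (fun y => signOf (g y)) x =
      ∑ y, signOf (g y ^^ decide (Odd (univ.filter fun i => y i && x i).card)) := by
  unfold W
  exact sum_congr rfl fun y _ => by rw [signOf_xor, vg_twist_eq_signOf]

/-- Walsh values of a cubic function are granular: `W_g(x) ∈ 2^{⌈n/3⌉} ℤ` (from AX). [cite: Carlet2020, §4.1] -/
theorem vg_W_granular
    (hAx : ∀ (n d : ℕ) (h : (Fin n → Bool) → Bool) (K : Finset (Fin n)), 1 ≤ d → IsDegLeFun d h →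
      ∃ z : ℤ, ∑ x ∈ {u : Fin n → Bool | ∀ i, u i = true → i ∈ K}, signOf (h x) =
        (2 : ℝ) ^ ((K.card + d - 1) / d) * (z : ℝ))
    (g : (Fin n → Bool) → Bool) (hg : IsDegLeFun 3 g) (x : Fin n → Bool) :
    ∃ z : ℤ, W (fun y => signOf (g y)) x = (2 : ℝ) ^ ((n + 2) / 3) * (z : ℝ) := by
  have hdeg : IsDegLeFun 3 (fun y : Fin n → Bool =>
      g y ^^ decide (Odd (univ.filter fun i => y i && x i).card)) :=
    bb_isDegLeFun_bxor hg ((knf_isDegLeFun_ip x).mono (by norm_num))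
  obtain ⟨z, hz⟩ := hAx n 3 _ univ (by norm_num) hdeg
  refine ⟨z, ?_⟩
  have he : (n + 3 - 1) / 3 = (n + 2) / 3 := by omega
  rw [filter_true_of_mem (fun u _ i _ => mem_univ i), card_fin, he] at hz
  rw [vg_W_eq_sum_signOf_bxor, hz]

/-- The VG statement (verbatim proof of the landed `stub_valueGranularity`). -/
theorem proof :
    (∀ (n d : ℕ) (h : (Fin n → Bool) → Bool) (K : Finset (Fin n)), 1 ≤ d → IsDegLeFun d h →
      ∃ z : ℤ, ∑ x ∈ {u : Fin n → Bool | ∀ i, u i = true → i ∈ K}, signOf (h x) =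
        (2 : ℝ) ^ ((K.card + d - 1) / d) * (z : ℝ)) →
    ∀ (m : ℕ) (f g : (Fin (m + m) → Bool) → Bool), IsDegLeFun 3 g →
      ∃ z : ℤ, (2 : ℝ) ^ (3 * m) * forrelation f g = (2 : ℝ) ^ ((m + m + 2) / 3) * (z : ℝ) := by
  intro hAx m f g hg
  choose z hz using fun x => vg_W_granular hAx g hg x
  refine ⟨∑ x, (if f x then -z x else z x), ?_⟩
  rw [vg_two_pow_mul_forrelation, Int.cast_sum, mul_sum]
  refine sum_congr rfl fun x _ => ?_
  rw [hz x]
  rcases Bool.eq_false_or_eq_true (f x) with h | h <;> simp [h, signOf]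

end VG

/-- **stub_valueGranularity** (VG; KNOWN — McEliece's divisibility read on the forrelation value, from AX; size M). For
ANY Boolean `f` and CUBIC `g` on `m + m` bits, `2^{3m} Φ(f,g) ∈ 2^{⌈2m/3⌉} ℤ`: `2^{3m} Φ = Σ_x (−1)^{f(x)} W_g(x)`
(`√(2^{3(m+m)}) = 2^{3m}`), and every `W_g(x) = Σ_y (−1)^{g(y) ⊕ x·y}` is the bias of the CUBIC `g ⊕ ℓ_x`, divisible by
`2^{⌈(m+m)/3⌉}` by AX with `K = univ`, `d = 3` (`⌈n/3⌉ = (n+2)/3`; the linear form `y ↦ x·y` is `polyPhase (Σ_{i : x i} X_i)`,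
of degree `≤ 1`, and `(−1)^{x·y} = twist`).  Consequence (`band_of_small_m`): for `m ≤ 4` the value `Φ` lies in `2^{−9} ℤ`,
so `Φ = 1 ∨ Φ ≤ 1 − 2⁻⁹` — the non-bent core starts at `n = 10`. -/
theorem stub_valueGranularity :
    (∀ (n d : ℕ) (h : (Fin n → Bool) → Bool) (K : Finset (Fin n)), 1 ≤ d → IsDegLeFun d h →
      ∃ z : ℤ, ∑ x ∈ {u : Fin n → Bool | ∀ i, u i = true → i ∈ K}, signOf (h x) =
        (2 : ℝ) ^ ((K.card + d - 1) / d) * (z : ℝ)) →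
    ∀ (m : ℕ) (f g : (Fin (m + m) → Bool) → Bool), IsDegLeFun 3 g →
      ∃ z : ℤ, (2 : ℝ) ^ (3 * m) * forrelation f g = (2 : ℝ) ^ ((m + m + 2) / 3) * (z : ℝ) :=
  -- LANDED as Summit.QuantumAdvantage.QuantumAdvantage.Theorems.CubicForrelation.NearExactIsExact.stub_valueGranularity (p132139, ACCEPTED; worker).
  -- The farm does not yet serve that module's olean, so the landed proof is INLINED verbatim (namespace `VG` above) — lead c4.
  VG.proof

/-- **stub_lrdrBand** (LB; NEW, size L, HELD BY THE LEAD — the low-rank dyadic rigidity band, from D, QW, DP, PR, IW, LP; crux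
idea `low-rank-dyadic-rigidity`). For cubic `f`, cubic BENT `g` (`W_g² ≡ 2^{m+m}`) and `f` `(j,k)`-LOW-RANK-SPANNED (an
xor-closed `V ∋ 0` with `2^{m+m} ≤ 2^k |V|` inside the xor-span of the directions `u` whose row of `T_f` has all nonzero
entries of square `≥ 4^{m+m−j}`): `Φ(f,g) = 1 ∨ Φ(f,g) ≤ 1 − 2^{−(j+2)} ∨ Φ(f,g) ≤ 1 − 2^{1−k}`.  Proof: dual `d` of `g`
(`bb_exists_dual`), `Φ = 1 − 2·wt(f ⊕ d)/2ⁿ` (`bb_forrelation_eq_of_dual`); if `Φ > 1 − 2^{−(j+2)}` then `8·wt < 2^{m+m−j}`;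
a low-rank row `u` of `T_f` is plateaued at a level `2^s ≥ 2^{m+m−j}` (QW on the quadratic `D_u f`, by D;
`dwt (signOf ∘ f) u = W (signOf ∘ D_u f)` by `signOf_xor`), row `u` of `T_d` is column `u` of `T_g` (`bb_dwt_transpose_dual`),
dyadic entrywise (QW on `D_v g`, by D), and `4·wt`-close to row `u` of `T_f` (PR with `a := f`, `e := f ⊕ d`), so LP makes
`f ⊕ d` `u`-periodic; periodicity is preserved under xor (the span's induction principle), so `f ⊕ d` is `V`-invariant and IW
gives `|V| ∣ wt`: `wt = 0` (`Φ = 1`) or `wt ≥ |V| ≥ 2^{m+m−k}` (`Φ ≤ 1 − 2^{1−k}`). -/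
theorem stub_lrdrBand :
    (∀ (n d : ℕ) (e : (Fin n → Bool) → Bool) (t : Fin n → Bool), IsDegLeFun (d + 1) e →
      IsDegLeFun d (fun x => e x ^^ e (bxor x t))) →
    (∀ (n : ℕ) (q : (Fin n → Bool) → Bool), IsDegLeFun 2 q →
      ∃ s : ℕ, ∀ v, W (fun x => signOf (q x)) v = 0 ∨ W (fun x => signOf (q x)) v ^ 2 = (4 : ℝ) ^ s) →
    (∀ (x y : ℝ) (s : ℕ), x ^ 2 = (4 : ℝ) ^ s → (y = 0 ∨ ∃ t : ℕ, y ^ 2 = (4 : ℝ) ^ t) →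
      |y - x| < (2 : ℝ) ^ s / 2 → y = x) →
    (∀ (n : ℕ) (a e : (Fin n → Bool) → Bool) (u v : Fin n → Bool),
      |dwt (fun x => signOf (a x ^^ e x)) u v - dwt (fun x => signOf (a x)) u v| ≤
        4 * ((univ.filter fun x => e x = true).card : ℝ)) →
    (∀ (n : ℕ) (e : (Fin n → Bool) → Bool) (V : Finset (Fin n → Bool)), zeroVec ∈ V →
      (∀ x ∈ V, ∀ y ∈ V, bxor x y ∈ V) → (∀ u ∈ V, ∀ x, e (bxor x u) = e x) →
      V.card ∣ (univ.filter fun x => e x = true).card) →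
    ((∀ (x y : ℝ) (s : ℕ), x ^ 2 = (4 : ℝ) ^ s → (y = 0 ∨ ∃ t : ℕ, y ^ 2 = (4 : ℝ) ^ t) →
        |y - x| < (2 : ℝ) ^ s / 2 → y = x) →
      ∀ (n : ℕ) (A B : (Fin n → Bool) → ℝ) (u : Fin n → Bool) (s : ℕ) (w : ℝ),
        (∀ x, A x ^ 2 = 1) → (∀ x, B x ^ 2 = 1) →
        (∀ v, dwt A u v = 0 ∨ dwt A u v ^ 2 = (4 : ℝ) ^ s) →
        (∀ v, dwt B u v = 0 ∨ ∃ t : ℕ, dwt B u v ^ 2 = (4 : ℝ) ^ t) →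
        (∀ v, |dwt B u v - dwt A u v| ≤ w) → w < (2 : ℝ) ^ s / 2 →
        ∀ x, A x * A (bxor x u) = B x * B (bxor x u)) →
    ∀ (m j k : ℕ) (f g : (Fin (m + m) → Bool) → Bool), IsDegLeFun 3 f → IsDegLeFun 3 g →
      (∀ x, W (fun y => signOf (g y)) x ^ 2 = (2 : ℝ) ^ (m + m)) →
      (∃ V : Finset (Fin (m + m) → Bool), zeroVec ∈ V ∧ (∀ x ∈ V, ∀ y ∈ V, bxor x y ∈ V) ∧
        2 ^ (m + m) ≤ 2 ^ k * V.card ∧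
        ∀ v ∈ V, ∀ P : (Fin (m + m) → Bool) → Prop,
          (∀ u, (∀ w, dwt (fun x => signOf (f x)) u w = 0 ∨
            (4 : ℝ) ^ (m + m) ≤ (4 : ℝ) ^ j * dwt (fun x => signOf (f x)) u w ^ 2) → P u) →
          P zeroVec → (∀ x y, P x → P y → P (bxor x y)) → P v) →
      forrelation f g = 1 ∨ forrelation f g ≤ 1 - (1 / 2) ^ (j + 2) ∨ forrelation f g ≤ 1 - 2 * (1 / 2) ^ k :=
  -- LANDED as Summit.QuantumAdvantage.QuantumAdvantage.Theorems.CubicForrelation.NearExactIsExact.stub_lrdrBand (p131345, ACCEPTED; lead c4): plugged in by import.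
  Summit.QuantumAdvantage.QuantumAdvantage.Theorems.CubicForrelation.NearExactIsExact.stub_lrdrBand

/-! ### §4e Fibre families (lead reshape c5, 2026-08-17): the FIBRE-AVERAGE identity and CARLET'S CRITERION

The template behind every near-exact construction known to the chain (the `𝔽_{2^r}` pencil of Disproof §4, the T-family, the
15/16 witness, the biquadratic towers) is a FIBRE FAMILY: `g(y′,u,w) = y′·u ⊕ G_u(w)` and `f(a,b,c) = a·b ⊕ F_a(c)` with
`y′,u,a,b ∈ 𝔽₂^s`, `w,c ∈ 𝔽₂^k`.  The character sums over `b` and `y′` localise `u = a`, so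
`Φ(f,g) = 2^{-s} Σ_a Φ(F_a, G_a)` (FF): the big pair is the AVERAGE of its `2^s` fibre pairs.  If the fibres are exact for
`a ≠ 0` ("punctured affine bent system": `G_a = C ⊕ Σ aᵢqᵢ` bent with duals following a degree-3 law in `a`), then
`Φ = 1 − 2^{-s}(1 − Φ(F_0,G_0))` — for `s = 4` any centre with `Φ₀ > 1/2` would beat the Maiorana–McFarland ceiling `31/32`,
and `s ≥ 5` systems would point at a refuting family.  Whether the centre closes (`Φ₀ = 1`) is, over every 2-dimensional
parameter subspace `{0, e, e′, e ⊕ e′}`, exactly the hypothesis of **Carlet's criterion** (CC): for bent `g₁,g₂,g₃` with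
`g₁ ⊕ g₂ ⊕ g₃` bent, the dual of the sum is the sum of the duals iff the "majority" `g₁g₂ ⊕ g₁g₃ ⊕ g₂g₃` is bent
(`W_{maj} = ½(W₁ + W₂ + W₃ − W_{123})`).  FF is also the certificate tool for any fibred witness: it reduces `Φ` of an
`(2s+k)`-bit pair to `2^s` forrelations on `k` bits (decidable for `k ≤ 8`).  Both are registered worker stubs; the lead's
search (`c/pabs.c`, kit j021095) enumerates ALL punctured systems with cubic 6-variable fibres (`k = 6`, `s = 4, 5`). -/

/-- **stub_fibreAverage** (FF; LANDED p134070, worker wave 1 of lead c5; the fibre-family identity). For `f(a,b,c) = a·b ⊕ F_a(c)` and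
`g(y′,u,w) = y′·u ⊕ G_u(w)` on `s + s + k` bits (sign forms as hypotheses), `Φ(f,g) = 2^{-s} Σ_a Φ(F_a, G_a)`.
Proof: `sum_append` twice on both sums, `twist_append`, and the two character sums `Σ_b (−1)^{b·(a ⊕ u)} = 2^s[u = a]`,
`Σ_{y′} (−1)^{y′·(a ⊕ u)} = 2^s[u = a]` (`F1.mw_sum_linear_block`); normalisation `√(2^{3(2s+k)}) = 2^{3s}·√(2^{3k})`. [folklore] -/
theorem stub_fibreAverage :
    ∀ (s k : ℕ) (f g : (Fin (s + s + k) → Bool) → Bool) (F G : (Fin s → Bool) → (Fin k → Bool) → Bool),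
      (∀ (a b : Fin s → Bool) (c : Fin k → Bool),
          signOf (f (Fin.append (Fin.append a b) c)) = twist a b * signOf (F a c)) →
      (∀ (y u : Fin s → Bool) (w : Fin k → Bool),
          signOf (g (Fin.append (Fin.append y u) w)) = twist y u * signOf (G u w)) →
      forrelation f g = ((2 : ℝ) ^ s)⁻¹ * ∑ a : Fin s → Bool, forrelation (F a) (G a) :=
  -- LANDED as Summit.QuantumAdvantage.QuantumAdvantage.Theorems.CubicForrelation.NearExactIsExact.stub_fibreAverage (p134070, ACCEPTED; worker, lead c5): plugged in by import.
  Summit.QuantumAdvantage.QuantumAdvantage.Theorems.CubicForrelation.NearExactIsExact.stub_fibreAverage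

/-- **stub_carletCriterion** (CC; LANDED p134114, worker wave 1 of lead c5). [cite: Carlet, "On the secondary constructions of resilient and bent
functions", Proc. Coding, Cryptography and Combinatorics 2004, Thm. 2; Mesnager, IEEE TIT 60 (2014) Thm. 4] For bent `g₁ g₂ g₃`
on `m + m` bits with dual signs `d₁ d₂ d₃` and `g₁ ⊕ g₂ ⊕ g₃` bent with dual sign `d₄`: `d₄ = d₁ ⊕ d₂ ⊕ d₃` everywhere iff
`g₁g₂ ⊕ g₁g₃ ⊕ g₂g₃` is bent.  Proof: `signOf (g₁g₂ ⊕ g₁g₃ ⊕ g₂g₃) = (σ₁ + σ₂ + σ₃ − σ₁σ₂σ₃)/2` pointwise (8 cases), so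
`W_{maj} = 2^{m-1}(signOf d₁ + signOf d₂ + signOf d₃ − signOf d₄)`, and `(δ₁ + δ₂ + δ₃ − δ₄)² = 4 ↔ δ₄ = δ₁δ₂δ₃` on `{±1}` (16 cases). -/
theorem stub_carletCriterion :
    ∀ (m : ℕ) (g₁ g₂ g₃ d₁ d₂ d₃ d₄ : (Fin (m + m) → Bool) → Bool),
      (∀ x, W (fun y => signOf (g₁ y)) x = (2 : ℝ) ^ m * signOf (d₁ x)) →
      (∀ x, W (fun y => signOf (g₂ y)) x = (2 : ℝ) ^ m * signOf (d₂ x)) →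
      (∀ x, W (fun y => signOf (g₃ y)) x = (2 : ℝ) ^ m * signOf (d₃ x)) →
      (∀ x, W (fun y => signOf (g₁ y ^^ g₂ y ^^ g₃ y)) x = (2 : ℝ) ^ m * signOf (d₄ x)) →
      ((∀ x, d₄ x = (d₁ x ^^ d₂ x ^^ d₃ x)) ↔
        ∀ x, W (fun y => signOf ((g₁ y && g₂ y) ^^ (g₁ y && g₃ y) ^^ (g₂ y && g₃ y))) x ^ 2 = (2 : ℝ) ^ (m + m)) :=
  -- LANDED as Summit.QuantumAdvantage.QuantumAdvantage.Theorems.CubicForrelation.NearExactIsExact.stub_carletCriterion (p134114, ACCEPTED; worker, lead c5): plugged in by import.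
  Summit.QuantumAdvantage.QuantumAdvantage.Theorems.CubicForrelation.NearExactIsExact.stub_carletCriterion

/-- **stub_fibreAverageRelabeled** (FF′; LANDED p136006, worker wave 2 of lead c5). The fibre-average identity for the
RELABELED template `g(y′,u,w) = y′·π(u) ⊕ G_u(w)`, `f(a,b,c) = b·σ(a) ⊕ F_a(c)` with `π, σ` mutually inverse permutations of
`𝔽₂^s` (cubicity of `f, g` needs them biquadratic, not used here): `Φ(f,g) = 2^{-s} Σ_a Φ(F_a, G_{σ(a)})`.  This is the form of the
15/16 witness (`π = (u₀,u₁,u₂,u₃ ⊕ u₀u₁)`), so FF′ is the certificate tool for relabeled fibred witnesses.  Proof: as FF, the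
`y′`-character sum localises `π u = a`, i.e. `u = σ a`, and `twist b (σ a)` squares away. [folklore] -/
theorem stub_fibreAverageRelabeled :
    ∀ (s k : ℕ) (f g : (Fin (s + s + k) → Bool) → Bool) (F G : (Fin s → Bool) → (Fin k → Bool) → Bool)
      (π σ : (Fin s → Bool) → (Fin s → Bool)),
      (∀ u, σ (π u) = u) → (∀ a, π (σ a) = a) →
      (∀ (a b : Fin s → Bool) (c : Fin k → Bool),
          signOf (f (Fin.append (Fin.append a b) c)) = twist b (σ a) * signOf (F a c)) →
      (∀ (y u : Fin s → Bool) (w : Fin k → Bool),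
          signOf (g (Fin.append (Fin.append y u) w)) = twist y (π u) * signOf (G u w)) →
      forrelation f g = ((2 : ℝ) ^ s)⁻¹ * ∑ a : Fin s → Bool, forrelation (F a) (G (σ a)) :=
  -- LANDED as Summit.QuantumAdvantage.QuantumAdvantage.Theorems.CubicForrelation.NearExactIsExact.stub_fibreAverageRelabeled (p136006, ACCEPTED; worker wave 2, lead c5): plugged in by import.
  Summit.QuantumAdvantage.QuantumAdvantage.Theorems.CubicForrelation.NearExactIsExact.stub_fibreAverageRelabeled

/-- **stub_templateRigidity** (TR; LANDED p136347, worker wave 2 of lead c5). For a template `g(y′,u,w) = y′·u ⊕ G_u(w)` and ANY cubic `f`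
with `Φ(f,g) > 31/32`, `f` is a matched partner: `f(a,b,c) = a·b ⊕ F_a(c)` for some `F` (so FF applies and `Φ = E_a Φ(F_a,G_a)`:
the crux restricted to template `g`'s is exactly a statement about fibre statistics).  Proof: `W_g(a,b,c) = 2^s(−1)^{a·b}W_{G_a}(c)`,
so `Φ = 2^{2s−3n/2} Σ_{a,c} W_{G_a}(c)·S(a,c)` with `S(a,c) = Σ_b (−1)^{f(a,b,c) ⊕ a·b}`; Cauchy–Schwarz gives
`Φ² ≤ E_{a,c} (S/2^s)²`; if `b ↦ f(a,b,c) ⊕ a·b` is non-constant it is a non-constant function of degree `≤ 3`, so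
`|S(a,c)| ≤ (3/4)·2^s` (RM weight, R); hence the set `Z` of `(a,c)` where it is constant has density `z` with `Φ² ≤ 9/16 + 7z/16`,
so `z > 3/4`.  But `(a,c) ∈ Z` iff all `b`-derivatives `ψᵢ(a,b,c) = f(a,b ⊕ eᵢ,c) ⊕ f(a,b,c) ⊕ aᵢ` vanish for all `b`; each
`ψᵢ` has degree `≤ 2` (D), so a non-zero `ψᵢ` is non-zero on `≥ 1/4` of all `(a,b,c)` (R), whose `(a,c)`-projection has
density `≥ 1/4`, contradicting `z > 3/4`; so every `ψᵢ ≡ 0` and `F(a,c) := f(a,0,c)` works. [folklore] -/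
theorem stub_templateRigidity :
    ∀ (s k : ℕ) (f g : (Fin (s + s + k) → Bool) → Bool) (G : (Fin s → Bool) → (Fin k → Bool) → Bool),
      (∀ (y u : Fin s → Bool) (w : Fin k → Bool),
          signOf (g (Fin.append (Fin.append y u) w)) = twist y u * signOf (G u w)) →
      IsDegLeFun 3 f → 31 / 32 < forrelation f g →
      ∃ F : (Fin s → Bool) → (Fin k → Bool) → Bool, ∀ (a b : Fin s → Bool) (c : Fin k → Bool),
        signOf (f (Fin.append (Fin.append a b) c)) = twist a b * signOf (F a c) :=
  -- LANDED as Summit.QuantumAdvantage.QuantumAdvantage.Theorems.CubicForrelation.NearExactIsExact.stub_templateRigidity (p136347, ACCEPTED; worker wave 2, lead c5): plugged in by import.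
  Summit.QuantumAdvantage.QuantumAdvantage.Theorems.CubicForrelation.NearExactIsExact.stub_templateRigidity

/-- Sorry-free glue (lead c5): the PUNCTURED VALUE. If the fibre average holds and every fibre pair off the centre is exact,
`Φ(f,g) = 1 − 2^{-s}(1 − Φ(F_0, G_0))`. -/
theorem puncturedValue_of_fibreAverage {s k : ℕ} (F G : (Fin s → Bool) → (Fin k → Bool) → Bool) (Φ : ℝ)
    (hFF : Φ = ((2 : ℝ) ^ s)⁻¹ * ∑ a : Fin s → Bool, forrelation (F a) (G a))
    (hex : ∀ a : Fin s → Bool, a ≠ zeroVec → forrelation (F a) (G a) = 1) :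
    Φ = 1 - ((2 : ℝ) ^ s)⁻¹ * (1 - forrelation (F zeroVec) (G zeroVec)) := by
  have hsum : ∑ a : Fin s → Bool, forrelation (F a) (G a) =
      ∑ a : Fin s → Bool, (1 + (if a = zeroVec then forrelation (F zeroVec) (G zeroVec) - 1 else 0)) := by
    refine sum_congr rfl fun a _ => ?_
    by_cases ha : a = zeroVec
    · subst ha; simp
    · rw [if_neg ha, hex a ha]; ring
  rw [hFF, hsum, sum_add_distrib, sum_const, card_univ, Fintype.card_fun, Fintype.card_bool, Fintype.card_fin,
    sum_ite_eq' univ zeroVec, if_pos (mem_univ _)]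
  have h2 : ((2 : ℝ) ^ s)⁻¹ * (2 ^ s : ℕ) = 1 := by
    rw [Nat.cast_pow, Nat.cast_ofNat, inv_mul_cancel₀ (by positivity)]
  simp only [nsmul_eq_mul]
  calc ((2 : ℝ) ^ s)⁻¹ * (((2 ^ s : ℕ) : ℝ) * 1 + (forrelation (F zeroVec) (G zeroVec) - 1))
      = ((2 : ℝ) ^ s)⁻¹ * ((2 ^ s : ℕ) : ℝ) + ((2 : ℝ) ^ s)⁻¹ * (forrelation (F zeroVec) (G zeroVec) - 1) := by ring
    _ = 1 - ((2 : ℝ) ^ s)⁻¹ * (1 - forrelation (F zeroVec) (G zeroVec)) := by rw [h2]; ring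

section WalshTower
open Summit.QuantumAdvantage.QuantumAdvantage.Theorems.CubicForrelation.NearExactIsExact
  (bb_exists_dual bb_band_of_dual_degree bb_rmWeight_holds)

/-! ### §4f The 2-adic Walsh tower (lead reshape c6, 2026-08-17): certified finite-`n` isolation WITHOUT computation

CERTIFICATE OBJECTIVE (human, 2026-08-16/17: certified checks of "near-exact ⇒ exact" on the finite families in scope,
`θ = 7/8` first).  The lever: for a CUBIC `g` on `n` bits every Walsh value is a multiple of `2^{⌈n/3⌉}` (Ax/McEliece, the
landed VG), and the divisibility continues as a TOWER — if `2^j ∣ W_g(x)` for ALL `x`, the parity `P_j(x) = [W_g(x)/2^j odd]`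
is a Boolean function of algebraic degree `≤ d(n,j) = max{k : k + ⌈(n−k)/3⌉ ≤ j}` (T: Poisson over a coordinate cube + Ax on
the complementary cube + Möbius — the three tree lemmas behind the landed Hou bound, which is the case `j = m + 1` of a bent
`g`).  A level whose parity is not identically zero COSTS capacity: `Σ_x |W_g(x)| ≤ 2^{3m}(1 − 2^{−d−1}·4^{j−m})` for `j < m`
(LCap: `(|u| − 2^{m−j})² ≥ [u odd]` pointwise, Parseval, and the Reed–Muller weight of `P_j`), and at the bent level `j = m`
either `g` is bent or `Σ_x |W_g(x)| ≤ 2^{3m}(1 − 2^{−d−1})` (LB).  Walking down the tower gives, by pure counting, an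
isolation constant for each small `n` (sorry-free compositions below, from T + LCap + LB + the landed AX, HOU, R):
`n = 8: Φ > 7/8 ⇒ Φ = 1` — TIGHT (capacity `7/8` is attained at `n = 8`), the conjectured constant of the crux text, and the
certified form of the ccert seat's EXHAUSTIVE `n = 8` Walsh-capacity scan (kit j018712: "max non-bent capacity = 7/8·4096"),
now a theorem with a one-page proof; `n = 10: 15/16`, `n = 12: 31/32`, `n = 14: 31/32`, `n = 16: 63/64`. -/

/-- **stub_walshTower** (T; LANDED p138237, worker wave 1 of lead c6; size M — Ax–Poisson–Möbius at the 2-adic level `j`). Given Ax's parity theorem on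
coordinate cubes (first antecedent = the statement of the landed `stub_axParity`): if `g` is cubic on `n` bits and
`W_g(x) = 2^j · u(x)` with `u(x) ∈ ℤ` for EVERY `x`, then the parity function `x ↦ [u(x) odd]` has algebraic degree `≤ d` as
soon as `j + 1 ≤ k + ⌈(n−k)/3⌉` for every `k` with `d < k ≤ n` (`⌈(n−k)/3⌉ = (n−k+2)/3`).  Proof: by Möbius
(`bb_moebius_isDegLeFun`) it suffices that `#{x ∈ E_I : u(x) odd}` is even whenever `|I| > d` (`E_I` = the coordinate cube
`{x : supp x ⊆ I}`); Poisson (`bb_poisson` with `G = (−1)^g`, `J = I`) gives `Σ_{x ∈ E_I} W_g(x) = 2^{|I|} Σ_{y ∈ E_{Iᶜ}} (−1)^{g(y)}`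
and Ax (`K = Iᶜ`, `d = 3`, `|Iᶜ| = n − |I|`) writes the cube bias as `2^{⌈(n−|I|)/3⌉} z`; so
`Σ_{x ∈ E_I} u(x) = 2^{|I| + ⌈(n−|I|)/3⌉ − j} z` is an EVEN integer, and a sum of integers is even iff the number of odd summands
is even. -/
theorem stub_walshTower :
    (∀ (n d : ℕ) (h : (Fin n → Bool) → Bool) (K : Finset (Fin n)), 1 ≤ d → IsDegLeFun d h →
      ∃ z : ℤ, ∑ x ∈ {u : Fin n → Bool | ∀ i, u i = true → i ∈ K}, signOf (h x) =
        (2 : ℝ) ^ ((K.card + d - 1) / d) * (z : ℝ)) →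
    ∀ (n j d : ℕ) (g : (Fin n → Bool) → Bool) (u : (Fin n → Bool) → ℤ), IsDegLeFun 3 g →
      (∀ x, W (fun y => signOf (g y)) x = (2 : ℝ) ^ j * (u x : ℝ)) →
      (∀ k, d < k → k ≤ n → j + 1 ≤ k + (n - k + 2) / 3) →
      IsDegLeFun d (fun x => decide (Odd (u x))) :=
  -- LANDED as Summit.QuantumAdvantage.QuantumAdvantage.Theorems.CubicForrelation.NearExactIsExact.stub_walshTower (p138237, ACCEPTED; worker wave 1, lead c6): plugged in by import.
  Summit.QuantumAdvantage.QuantumAdvantage.Theorems.CubicForrelation.NearExactIsExact.stub_walshTower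

/-- **stub_levelCapacity** (LCap; LANDED p138673, worker wave 1 of lead c6; size M — the capacity cost of a non-vanishing level below the bent level; no degree
hypothesis on `g`). On `m + m` bits: if `W_g(x) = 2^j · u(x)` (`u(x) ∈ ℤ`) for every `x` with `j < m`, and the parity
`x ↦ [u(x) odd]` has degree `≤ d` and is not identically zero, then `Σ_x |W_g(x)| ≤ 2^{3m} · (1 − (1/2)^{d+1} (1/4)^{m−j})`.
Proof: with `K = 2^{m−j}` (an EVEN integer, `j < m`), pointwise `(|u(x)| − K)² ≥ [u(x) odd]` (odd minus even is odd, so its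
square is `≥ 1`), i.e. `2K|u(x)| ≤ u(x)² + K² − [u(x) odd]`; summing, `Σ_x u(x)² = 2^{4m−2j}` by Parseval (`sum_W_sq`:
`Σ_x W_g(x)² = 2^{m+m} · 2^{m+m}`) and `#{x : u(x) odd} ≥ 2^{m+m−d}` by the Reed–Muller weight of the parity function
(`bb_rmWeight_holds`); `Σ|W| = 2^j Σ|u|`. -/
theorem stub_levelCapacity :
    ∀ (m j d : ℕ) (g : (Fin (m + m) → Bool) → Bool) (u : (Fin (m + m) → Bool) → ℤ), j < m →
      (∀ x, W (fun y => signOf (g y)) x = (2 : ℝ) ^ j * (u x : ℝ)) →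
      IsDegLeFun d (fun x => decide (Odd (u x))) → (∃ x, Odd (u x)) →
      ∑ x, |W (fun y => signOf (g y)) x| ≤ (2 : ℝ) ^ (3 * m) * (1 - (1 / 2) ^ (d + 1) * (1 / 4) ^ (m - j)) :=
  -- LANDED as Summit.QuantumAdvantage.QuantumAdvantage.Theorems.CubicForrelation.NearExactIsExact.stub_levelCapacity (p138673, ACCEPTED; worker wave 1, lead c6): plugged in by import.
  Summit.QuantumAdvantage.QuantumAdvantage.Theorems.CubicForrelation.NearExactIsExact.stub_levelCapacity

/-- **stub_levelBent** (LB; LANDED p138930, worker wave 1 of lead c6; size M — the bent level; no degree hypothesis on `g`). On `m + m` bits: if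
`W_g(x) = 2^m · u(x)` (`u(x) ∈ ℤ`) for every `x` and the parity `x ↦ [u(x) odd]` has degree `≤ d`, then EITHER `g` is bent
(`W_g(x)² = 2^{m+m}` for all `x`) OR `Σ_x |W_g(x)| ≤ 2^{3m} · (1 − (1/2)^{d+1})`.  Proof: if every `u(x)` is odd then
`u(x)² ≥ 1` pointwise while `Σ_x u(x)² = 2^{m+m}` (Parseval, `sum_W_sq`), so every `u(x)² = 1`: bent.  Otherwise the negated
parity `x ↦ [u(x) even]` is a non-zero function of degree `≤ d` (xor with the constant `true`), so `#{u even} ≥ 2^{m+m−d}`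
(`bb_rmWeight_holds`), i.e. `#{u odd} ≤ 2^{m+m} − 2^{m+m−d}`; pointwise `2|u| ≤ u² + [u odd]`, hence
`2 Σ|u| ≤ 2^{m+m} + 2^{m+m} − 2^{m+m−d}` and `Σ|W| = 2^m Σ|u|`. -/
theorem stub_levelBent :
    ∀ (m d : ℕ) (g : (Fin (m + m) → Bool) → Bool) (u : (Fin (m + m) → Bool) → ℤ),
      (∀ x, W (fun y => signOf (g y)) x = (2 : ℝ) ^ m * (u x : ℝ)) →
      IsDegLeFun d (fun x => decide (Odd (u x))) →
      (∀ x, W (fun y => signOf (g y)) x ^ 2 = (2 : ℝ) ^ (m + m)) ∨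
        ∑ x, |W (fun y => signOf (g y)) x| ≤ (2 : ℝ) ^ (3 * m) * (1 - (1 / 2) ^ (d + 1)) :=
  -- LANDED as Summit.QuantumAdvantage.QuantumAdvantage.Theorems.CubicForrelation.NearExactIsExact.stub_levelBent (p138930, ACCEPTED; worker wave 1, lead c6): plugged in by import.
  Summit.QuantumAdvantage.QuantumAdvantage.Theorems.CubicForrelation.NearExactIsExact.stub_levelBent

/-! #### Sorry-free glue: capacity bounds forrelation, stepping up one level, the bent endgame -/

/-- Capacity bounds forrelation: `Φ(f,g) · 2^{3m} ≤ Σ_x |W_g(x)|` for EVERY Boolean `f`. [folklore] -/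
theorem tw_forrelation_le_cap {m : ℕ} (f g : (Fin (m + m) → Bool) → Bool) :
    forrelation f g * (2 : ℝ) ^ (3 * m) ≤ ∑ x, |W (fun y => signOf (g y)) x| := by
  rw [mul_comm, VG.vg_two_pow_mul_forrelation]
  refine sum_le_sum fun x _ => ?_
  have h1 : |signOf (f x)| = 1 := by unfold signOf; split_ifs <;> simp
  calc signOf (f x) * W (fun y => signOf (g y)) x ≤ |signOf (f x) * W (fun y => signOf (g y)) x| := le_abs_self _
    _ = |W (fun y => signOf (g y)) x| := by rw [abs_mul, h1, one_mul]

/-- A capacity bound `Σ|W_g| ≤ 2^{3m}·c` caps the forrelation: `Φ(f,g) ≤ c`. [folklore] -/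
theorem tw_forrelation_le_of_cap {m : ℕ} (f g : (Fin (m + m) → Bool) → Bool) {c : ℝ}
    (h : ∑ x, |W (fun y => signOf (g y)) x| ≤ (2 : ℝ) ^ (3 * m) * c) : forrelation f g ≤ c := by
  have hcap := tw_forrelation_le_cap f g
  have hpos : (0 : ℝ) < (2 : ℝ) ^ (3 * m) := by positivity
  nlinarith

/-- One level up: if every `u(x)` is even then `W_g = 2^{j+1} · (u/2)`. [folklore] -/
theorem tw_level_up {j : ℕ} (g : (Fin n → Bool) → Bool) (u : (Fin n → Bool) → ℤ)
    (hu : ∀ x, W (fun y => signOf (g y)) x = (2 : ℝ) ^ j * (u x : ℝ)) (hev : ∀ x, ¬ Odd (u x)) :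
    ∀ x, W (fun y => signOf (g y)) x = (2 : ℝ) ^ (j + 1) * ((u x / 2 : ℤ) : ℝ) := by
  intro x
  have he : u x = 2 * (u x / 2) := by
    have h2 : (2 : ℤ) ∣ u x := even_iff_two_dvd.1 (Int.not_odd_iff_even.1 (hev x))
    exact (Int.mul_ediv_cancel' h2).symm
  rw [hu x, pow_succ]
  conv_lhs => rw [he]
  push_cast
  ring

/-- The Ax base of the tower: for cubic `g` on `n` bits, `W_g = 2^{(n+2)/3} · u` with `u` integer-valued (VG). -/
theorem tw_base (hAx : type_of% stub_axParity) (g : (Fin n → Bool) → Bool) (hg : IsDegLeFun 3 g) (j₀ : ℕ)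
    (hj₀ : (n + 2) / 3 = j₀) :
    ∃ u : (Fin n → Bool) → ℤ, ∀ x, W (fun y => signOf (g y)) x = (2 : ℝ) ^ j₀ * (u x : ℝ) := by
  choose u hu using fun x => VG.vg_W_granular hAx g hg x
  exact ⟨u, fun x => by rw [hu x, hj₀]⟩

/-- One step DOWN the tower at a level `j < m` (from T and LCap): either the level costs capacity
`Σ|W_g| ≤ 2^{3m}(1 − 2^{−d−1}4^{j−m})` (parity non-zero, of degree `≤ d` by T), or every `u` is even and `W_g = 2^{j+1}·u'`. -/
theorem tw_step (hAx : type_of% stub_axParity) (hT : type_of% stub_walshTower) (hLC : type_of% stub_levelCapacity)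
    {m j d : ℕ} (g : (Fin (m + m) → Bool) → Bool) (u : (Fin (m + m) → Bool) → ℤ) (hg : IsDegLeFun 3 g) (hj : j < m)
    (hu : ∀ x, W (fun y => signOf (g y)) x = (2 : ℝ) ^ j * (u x : ℝ))
    (hside : ∀ k, d < k → k ≤ m + m → j + 1 ≤ k + (m + m - k + 2) / 3) :
    ∑ x, |W (fun y => signOf (g y)) x| ≤ (2 : ℝ) ^ (3 * m) * (1 - (1 / 2) ^ (d + 1) * (1 / 4) ^ (m - j)) ∨
      ∃ u' : (Fin (m + m) → Bool) → ℤ, ∀ x, W (fun y => signOf (g y)) x = (2 : ℝ) ^ (j + 1) * (u' x : ℝ) := by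
  by_cases hodd : ∃ x, Odd (u x)
  · exact Or.inl (hLC m j d g u hj hu (hT hAx (m + m) j d g u hg hu hside) hodd)
  · push Not at hodd
    exact Or.inr ⟨fun x => u x / 2, tw_level_up g u hu hodd⟩

/-- The TOP of the tower at the bent level `j = m` (from T and LB): `g` is bent, or the level costs capacity
`Σ|W_g| ≤ 2^{3m}(1 − 2^{−d−1})` with the degree `d` supplied by T. -/
theorem tw_top (hAx : type_of% stub_axParity) (hT : type_of% stub_walshTower) (hLB : type_of% stub_levelBent)
    {m d : ℕ} (g : (Fin (m + m) → Bool) → Bool) (u : (Fin (m + m) → Bool) → ℤ) (hg : IsDegLeFun 3 g)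
    (hu : ∀ x, W (fun y => signOf (g y)) x = (2 : ℝ) ^ m * (u x : ℝ))
    (hside : ∀ k, d < k → k ≤ m + m → m + 1 ≤ k + (m + m - k + 2) / 3) :
    (∀ x, W (fun y => signOf (g y)) x ^ 2 = (2 : ℝ) ^ (m + m)) ∨
      ∑ x, |W (fun y => signOf (g y)) x| ≤ (2 : ℝ) ^ (3 * m) * (1 - (1 / 2) ^ (d + 1)) :=
  hLB m d g u hu (hT hAx (m + m) m d g u hg hu hside)

/-- The bent ENDGAME (landed HOU + R): a cubic pair with `g` bent on `m + m ≥ 6` bits has `Φ = 1` or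
`Φ ≤ 1 − 2/2^{⌊(m+3)/2⌋}` (the dual has degree `≤ ⌊(m+3)/2⌋` by Hou, and so does the cubic `f`). -/
theorem tw_bent_end (hAx : type_of% stub_axParity) (hHou : type_of% stub_houCubic) {m : ℕ} (hm : 3 ≤ m)
    (f g : (Fin (m + m) → Bool) → Bool) (hf : IsDegLeFun 3 f) (hg : IsDegLeFun 3 g)
    (hbent : ∀ x, W (fun y => signOf (g y)) x ^ 2 = (2 : ℝ) ^ (m + m)) :
    forrelation f g = 1 ∨ forrelation f g ≤ 1 - 2 / 2 ^ ((m + 3) / 2) := by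
  obtain ⟨d, hd⟩ := bb_exists_dual hbent
  exact bb_band_of_dual_degree bb_rmWeight_holds m ((m + 3) / 2) f g d (hf.mono (by omega)) (hHou hAx m g d hg hd) hd

/-! #### The certified finite-`n` isolation theorems (sorry-free from T, LCap, LB and the landed AX, HOU, R) -/

/-- **Isolation at `7/8` on `8` bits** (TIGHT: capacity `7/8` is attained by non-bent cubics at `n = 8`). For all cubic
`f, g : 𝔽₂⁸ → 𝔽₂`, `Φ(f,g) > 7/8 ⇒ Φ(f,g) = 1`.  Level 3 (Ax base): parity of degree `≤ 0`, cost `7/8`; level 4: parity of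
degree `≤ 2`: bent (then the dual is cubic by Hou and `Φ = 1 ∨ Φ ≤ 3/4`) or cost `7/8`. -/
theorem isolation_eight (hAx : type_of% stub_axParity) (hHou : type_of% stub_houCubic) (hT : type_of% stub_walshTower)
    (hLC : type_of% stub_levelCapacity) (hLB : type_of% stub_levelBent) :
    ∀ f g : (Fin (4 + 4) → Bool) → Bool, IsDegLeFun 3 f → IsDegLeFun 3 g →
      7 / 8 < forrelation f g → forrelation f g = 1 := by
  intro f g hf hg hΦ
  obtain ⟨u₃, hu₃⟩ := tw_base hAx g hg 3 (by norm_num)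
  rcases tw_step hAx hT hLC (j := 3) (d := 0) g u₃ hg (by norm_num) hu₃ (by intro k hk hkn; omega) with hcap | ⟨u₄, hu₄⟩
  · exfalso; have := tw_forrelation_le_of_cap f g hcap; norm_num at this; linarith
  rcases tw_top hAx hT hLB (d := 2) g u₄ hg hu₄ (by intro k hk hkn; omega) with hbent | hcap
  · rcases tw_bent_end hAx hHou (by norm_num) f g hf hg hbent with h | h
    · exact h
    · exfalso; norm_num at h; linarith
  · exfalso; have := tw_forrelation_le_of_cap f g hcap; norm_num at this; linarith

/-- **Isolation at `15/16` on `10` bits.** For all cubic `f, g : 𝔽₂¹⁰ → 𝔽₂`, `Φ(f,g) > 15/16 ⇒ Φ(f,g) = 1`.  Level 4: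
parity affine, cost `15/16`; level 5: parity quadratic: bent (dual of degree `≤ 4`, `Φ = 1 ∨ Φ ≤ 7/8`) or cost `7/8`. -/
theorem isolation_ten (hAx : type_of% stub_axParity) (hHou : type_of% stub_houCubic) (hT : type_of% stub_walshTower)
    (hLC : type_of% stub_levelCapacity) (hLB : type_of% stub_levelBent) :
    ∀ f g : (Fin (5 + 5) → Bool) → Bool, IsDegLeFun 3 f → IsDegLeFun 3 g →
      15 / 16 < forrelation f g → forrelation f g = 1 := by
  intro f g hf hg hΦ
  obtain ⟨u₄, hu₄⟩ := tw_base hAx g hg 4 (by norm_num)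
  rcases tw_step hAx hT hLC (j := 4) (d := 1) g u₄ hg (by norm_num) hu₄ (by intro k hk hkn; omega) with hcap | ⟨u₅, hu₅⟩
  · exfalso; have := tw_forrelation_le_of_cap f g hcap; norm_num at this; linarith
  rcases tw_top hAx hT hLB (d := 2) g u₅ hg hu₅ (by intro k hk hkn; omega) with hbent | hcap
  · rcases tw_bent_end hAx hHou (by norm_num) f g hf hg hbent with h | h
    · exact h
    · exfalso; norm_num at h; linarith
  · exfalso; have := tw_forrelation_le_of_cap f g hcap; norm_num at this; linarith

/-- **Isolation at `31/32` on `12` bits.** For all cubic `f, g : 𝔽₂¹² → 𝔽₂`, `Φ(f,g) > 31/32 ⇒ Φ(f,g) = 1`.  Level 4: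
parity constant, cost `31/32`; level 5: affine, cost `15/16`; level 6: cubic: bent (dual `≤ 4`, `Φ = 1 ∨ Φ ≤ 7/8`) or cost
`15/16`. -/
theorem isolation_twelve (hAx : type_of% stub_axParity) (hHou : type_of% stub_houCubic) (hT : type_of% stub_walshTower)
    (hLC : type_of% stub_levelCapacity) (hLB : type_of% stub_levelBent) :
    ∀ f g : (Fin (6 + 6) → Bool) → Bool, IsDegLeFun 3 f → IsDegLeFun 3 g →
      31 / 32 < forrelation f g → forrelation f g = 1 := by
  intro f g hf hg hΦ
  obtain ⟨u₄, hu₄⟩ := tw_base hAx g hg 4 (by norm_num)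
  rcases tw_step hAx hT hLC (j := 4) (d := 0) g u₄ hg (by norm_num) hu₄ (by intro k hk hkn; omega) with hcap | ⟨u₅, hu₅⟩
  · exfalso; have := tw_forrelation_le_of_cap f g hcap; norm_num at this; linarith
  rcases tw_step hAx hT hLC (j := 5) (d := 1) g u₅ hg (by norm_num) hu₅ (by intro k hk hkn; omega) with hcap | ⟨u₆, hu₆⟩
  · exfalso; have := tw_forrelation_le_of_cap f g hcap; norm_num at this; linarith
  rcases tw_top hAx hT hLB (d := 3) g u₆ hg hu₆ (by intro k hk hkn; omega) with hbent | hcap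
  · rcases tw_bent_end hAx hHou (by norm_num) f g hf hg hbent with h | h
    · exact h
    · exfalso; norm_num at h; linarith
  · exfalso; have := tw_forrelation_le_of_cap f g hcap; norm_num at this; linarith

/-- **Isolation at `31/32` on `14` bits.** For all cubic `f, g : 𝔽₂¹⁴ → 𝔽₂`, `Φ(f,g) > 31/32 ⇒ Φ(f,g) = 1`.  Level 5:
constant, cost `31/32`; level 6: quadratic, cost `31/32`; level 7: cubic: bent (dual `≤ 5`, `Φ = 1 ∨ Φ ≤ 15/16`) or cost
`15/16`. -/
theorem isolation_fourteen (hAx : type_of% stub_axParity) (hHou : type_of% stub_houCubic)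
    (hT : type_of% stub_walshTower) (hLC : type_of% stub_levelCapacity) (hLB : type_of% stub_levelBent) :
    ∀ f g : (Fin (7 + 7) → Bool) → Bool, IsDegLeFun 3 f → IsDegLeFun 3 g →
      31 / 32 < forrelation f g → forrelation f g = 1 := by
  intro f g hf hg hΦ
  obtain ⟨u₅, hu₅⟩ := tw_base hAx g hg 5 (by norm_num)
  rcases tw_step hAx hT hLC (j := 5) (d := 0) g u₅ hg (by norm_num) hu₅ (by intro k hk hkn; omega) with hcap | ⟨u₆, hu₆⟩
  · exfalso; have := tw_forrelation_le_of_cap f g hcap; norm_num at this; linarith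
  rcases tw_step hAx hT hLC (j := 6) (d := 2) g u₆ hg (by norm_num) hu₆ (by intro k hk hkn; omega) with hcap | ⟨u₇, hu₇⟩
  · exfalso; have := tw_forrelation_le_of_cap f g hcap; norm_num at this; linarith
  rcases tw_top hAx hT hLB (d := 3) g u₇ hg hu₇ (by intro k hk hkn; omega) with hbent | hcap
  · rcases tw_bent_end hAx hHou (by norm_num) f g hf hg hbent with h | h
    · exact h
    · exfalso; norm_num at h; linarith
  · exfalso; have := tw_forrelation_le_of_cap f g hcap; norm_num at this; linarith

/-- **Isolation at `63/64` on `16` bits.** For all cubic `f, g : 𝔽₂¹⁶ → 𝔽₂`, `Φ(f,g) > 63/64 ⇒ Φ(f,g) = 1` (the `15/16`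
witness `Negative.forrelation_f16_g16` lives here).  Level 6: affine, cost `63/64`; level 7: quadratic, cost `31/32`;
level 8: quartic: bent (dual `≤ 5`, `Φ = 1 ∨ Φ ≤ 15/16`) or cost `31/32`. -/
theorem isolation_sixteen (hAx : type_of% stub_axParity) (hHou : type_of% stub_houCubic)
    (hT : type_of% stub_walshTower) (hLC : type_of% stub_levelCapacity) (hLB : type_of% stub_levelBent) :
    ∀ f g : (Fin (8 + 8) → Bool) → Bool, IsDegLeFun 3 f → IsDegLeFun 3 g →
      63 / 64 < forrelation f g → forrelation f g = 1 := by
  intro f g hf hg hΦ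
  obtain ⟨u₆, hu₆⟩ := tw_base hAx g hg 6 (by norm_num)
  rcases tw_step hAx hT hLC (j := 6) (d := 1) g u₆ hg (by norm_num) hu₆ (by intro k hk hkn; omega) with hcap | ⟨u₇, hu₇⟩
  · exfalso; have := tw_forrelation_le_of_cap f g hcap; norm_num at this; linarith
  rcases tw_step hAx hT hLC (j := 7) (d := 2) g u₇ hg (by norm_num) hu₇ (by intro k hk hkn; omega) with hcap | ⟨u₈, hu₈⟩
  · exfalso; have := tw_forrelation_le_of_cap f g hcap; norm_num at this; linarith
  rcases tw_top hAx hT hLB (d := 4) g u₈ hg hu₈ (by intro k hk hkn; omega) with hbent | hcap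
  · rcases tw_bent_end hAx hHou (by norm_num) f g hf hg hbent with h | h
    · exact h
    · exfalso; norm_num at h; linarith
  · exfalso; have := tw_forrelation_le_of_cap f g hcap; norm_num at this; linarith

/-- **The ccert seat's exhaustive `n = 8` scan as a theorem**: a NON-bent cubic `g` on `8` bits has Walsh capacity
`Σ_x |W_g(x)| ≤ 3584 = (7/8)·2¹²` (kit j018712 found the maximum `3584` over all `2³³` cubics mod affine terms; here it is
PROVED: level 3 costs `7/8`, level 4 is bent-or-`7/8`). -/
theorem capacity_eight (hAx : type_of% stub_axParity) (hT : type_of% stub_walshTower)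
    (hLC : type_of% stub_levelCapacity) (hLB : type_of% stub_levelBent) :
    ∀ g : (Fin (4 + 4) → Bool) → Bool, IsDegLeFun 3 g →
      ¬ (∀ x, W (fun y => signOf (g y)) x ^ 2 = (2 : ℝ) ^ (4 + 4)) →
      ∑ x, |W (fun y => signOf (g y)) x| ≤ 3584 := by
  intro g hg hnb
  obtain ⟨u₃, hu₃⟩ := tw_base hAx g hg 3 (by norm_num)
  rcases tw_step hAx hT hLC (j := 3) (d := 0) g u₃ hg (by norm_num) hu₃ (by intro k hk hkn; omega) with hcap | ⟨u₄, hu₄⟩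
  · norm_num at hcap; exact hcap
  rcases tw_top hAx hT hLB (d := 2) g u₄ hg hu₄ (by intro k hk hkn; omega) with hbent | hcap
  · exact absurd hbent hnb
  · norm_num at hcap; exact hcap

end WalshTower

/-! ### §4g The next finite family: `n = 10` at `θ = 7/8` (lead c6, cycle 2, 2026-08-17) — the SPLIT case dissected

What the tower leaves at `n = 10` (`split_ten_both`, landed p139479): in the window `7/8 < Φ(f,g) < 1` BOTH `f` and `g` are
non-bent and SPLIT — `W_g ≡ 16 (mod 32)` exactly on an affine hyperplane `H = {x : c·x = b}` and `≡ 0 (mod 32)` on `H′`.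
Write `δ := D_c g` (the derivative of `g` along the vector `c`, a quadratic on the quotient): `W_g(x̄,x_c) = W_{g₀}(x̄) ± W_{g₀+δ}(x̄)`
and both 9-bit slices `g₀, g₀ + δ` are TYPE O (all Walsh values `≡ 8 (mod 16)`).  Cost identity
`Σ_x (W_g(x) − 32·(−1)^{f(x)})² = 2²¹(1 − Φ) < 2¹⁸` + the level-5 parity on the 9-flat `H′` (degree `≤ 2`, stub
`stub_levelOnHyperplane`) force `W_g/32` ODD on all of `H′`, and Parseval on the slices gives `Σ_{x̄} p(x̄)² = 2|Z|`,
`Z = {δ = b′}`, `p = W_g(x̄,b′)/32` odd — so `|Z| ≥ 256`.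
* BALANCED `δ` (`|Z| = 256`): a balanced quadratic has a complementing linear structure `e` (`δ(y+e) = ¬δ(y)`, stub
  `stub_quadBalancedStructure`); in coordinates with `c ↦` last `x`-coordinate and `e ↦ e₉` (stub `stub_linearTransport` +
  explicit involutions) `g = E(w) ⊕ y₉D(w) ⊕ y₁₀(y₉ ⊕ Q(w))`, `w ∈ 𝔽₂⁸`, and `W_g(x_w,x₉,x₁₀) = 2(−1)^{x₉x₁₀} W_{G[x₉,x₁₀]}(x_w)`
  with `G[a,b] = E ⊕ QD ⊕ aQ ⊕ bD` (8-bit, degree ≤ 4); `p = ±1` everywhere makes `G[0,0], G[1,0]` BENT, the budget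
  `Φ > 7/8` + Reed–Muller distance in `RM(4,8)` (`16 + 16 ≥ 32`) makes one of them EXACT against its `f`-slice, hence (Hou at
  `n = 8`, `stub_houCubic`) CUBIC; but then `G[0,1] = G[0,0] ⊕ D` (cubic bent ⊕ quadratic) would have to be TYPE O, and
  **every quadratic perturbation of a cubic bent function on 8 bits is type E** (`W ≡ 0 mod 16`; stub `stub_typeE8`:
  Poisson on coordinate flats of codim ≤ 2 + Ax for degrees 2 and 5 + induction over the monomials of the quadratic; confirmed
  by the exhaustive scan kit j022588 over the 14 EA-classes of exact cubic pairs on 8 bits).  So the balanced case is EMPTY.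
* UNBALANCED `δ` (`|Z| = 256 + 2^{8−h}`, rank `2h ∈ {4,6,8}`; `h = 1` is excluded by the cost budget): OPEN — `g` is affine on
  the cosets of the plane `⟨c, r⟩` (`r` a radical direction of `δ`), `W_g = 4·Σ_{cell}(−1)^{E + x·w}` over the four cells cut out
  of `𝔽₂⁸` by two quadrics, with the H′-cell sums `≡ 8 (mod 16)` for every character — a plateaued-on-a-quadric structure;
  see the crux NOTES (c6 cycle 2). -/

/-- **stub_typeE8** (size M — "type E is stable under quadratic perturbation of a bent cubic on 8 bits").  If `A` is a cubic
bent function on `8` bits (`W_A(x)² = 2⁸`) and `B` has degree `≤ 2`, then every Walsh value of `A ⊕ B` is a multiple of `16`.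
Proof: it suffices (replace `B` by `B ⊕ x·y`) to show `wt(A ⊕ q) ≡ 0 (mod 8)` for every `q` of degree `≤ 2`; write `q` as a sum
of monomials `m₁ ⊕ … ⊕ m_K` of degree `≤ 2` (its `MvPolynomial` support) and induct: `W_{A⊕q'⊕m}(0) − W_{A⊕q'}(0) =
−2·Σ_{y : m(y)=1} (−1)^{(A⊕q')(y)}`, and on the coordinate flat `F = {m = 1}` (dimension `≥ 6`)
`wt((A ⊕ q')|_F) ≡ wt(A|_F) + wt(q'|_F) − 2·wt((A ∧ q')|_F) ≡ 0 (mod 4)`: `wt(A|_F) ≡ 0 (mod 4)` by Poisson (`bb_poisson` for the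
shifted `A`) and `|W_A| = 16`; `wt(q'|_F) ≡ 0 (mod 4)` by Ax for degree `2` on `≥ 6` variables (`stub_axParity`, `d = 2`);
`wt((A ∧ q')|_F)` is even since `A ∧ q'` has degree `≤ 5 <` dim `F` (`IsDegLeFun.band'`, Ax `d = 5`). -/
theorem stub_typeE8 :
    ∀ (A B : (Fin (4 + 4) → Bool) → Bool), IsDegLeFun 3 A → IsDegLeFun 2 B →
      (∀ x, W (fun y => signOf (A y)) x ^ 2 = (2 : ℝ) ^ (4 + 4)) →
      ∀ x, ∃ k : ℤ, W (fun y => signOf (A y ^^ B y)) x = 16 * (k : ℝ) :=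
  -- LANDED as Summit.QuantumAdvantage.QuantumAdvantage.Theorems.CubicForrelation.NearExactIsExact.stub_typeE8 (p142573, ACCEPTED; worker wave 2, lead c6): plugged in by import.
  Summit.QuantumAdvantage.QuantumAdvantage.Theorems.CubicForrelation.NearExactIsExact.stub_typeE8

/-- **stub_quadBalancedStructure** (size S — a balanced quadratic has a complementing linear structure).  If `q` has degree
`≤ 2` on `n` bits and is balanced (`Σ_y (−1)^{q(y)} = 0`), then there is a non-zero `e` with `q(y ⊕ e) = ¬ q(y)` for all `y`.
Proof: `(Σ_y (−1)^{q(y)})² = Σ_e Σ_y (−1)^{q(y) ⊕ q(y⊕e)}`; each derivative `D_e q` is affine (`stub_derivDegree`), so its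
signed sum is `± 2^n` if it is constant and `0` otherwise (a non-constant affine function is balanced: flip a variable that
occurs); the `e` with `D_e q` constant form a subspace on which `e ↦ D_e q` is additive, so either some `e` has `D_e q ≡ 1`
(then `e ≠ 0`), or all constant derivatives are `≡ 0` and the square is `2^n · #{e : D_e q ≡ 0} ≥ 2^n > 0`. -/
theorem stub_quadBalancedStructure :
    ∀ (n : ℕ) (q : (Fin n → Bool) → Bool), IsDegLeFun 2 q → ∑ y, signOf (q y) = 0 →
      ∃ e : Fin n → Bool, e ≠ zeroVec ∧ ∀ y, q (bxor y e) = !q y :=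
  -- LANDED as Summit.QuantumAdvantage.QuantumAdvantage.Theorems.CubicForrelation.NearExactIsExact.stub_quadBalancedStructure (p142378, ACCEPTED; worker wave 2, lead c6): plugged in by import.
  Summit.QuantumAdvantage.QuantumAdvantage.Theorems.CubicForrelation.NearExactIsExact.stub_quadBalancedStructure

/-- **stub_levelOnHyperplane** (size M — the 2-adic tower RELATIVE to a coordinate hyperplane; same proof as the landed
`stub_walshTower`).  Given Ax's parity theorem on cubes (first antecedent = the landed `stub_axParity`): if `g` is cubic on
`N + 1` bits and `W_g(x̄ ‖ b) = 2^j · u(x̄)` with `u(x̄) ∈ ℤ` for every point `x̄ ‖ b` of the hyperplane `{x_last = b}`, then the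
parity `x̄ ↦ [u(x̄) odd]` (a function of the `N` free coordinates) has degree `≤ d` as soon as `j + 1 ≤ k + ⌈(N+1−k)/3⌉` for all
`d < k ≤ N`.  Proof: for `b = true` replace `g` by `g ⊕ y_last` (`W` shifts by `e_last`); then the cubes of the hyperplane based
at `0` are coordinate cubes `E_I` of `𝔽₂^{N+1}` with `last ∉ I`, Poisson (`bb_poisson`) + Ax on `E_{Iᶜ}` (`|Iᶜ| = N+1−|I|`) give
`Σ_{E_I} u ∈ 2^{|I| + ⌈(N+1−|I|)/3⌉ − j} ℤ`, even for `|I| > d`, and Möbius (`bb_moebius_isDegLeFun` on `N` variables, cubes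
transported along `Fin.snoc · b`) concludes. -/
theorem stub_levelOnHyperplane :
    (∀ (n d : ℕ) (h : (Fin n → Bool) → Bool) (K : Finset (Fin n)), 1 ≤ d → IsDegLeFun d h →
      ∃ z : ℤ, ∑ x ∈ {u : Fin n → Bool | ∀ i, u i = true → i ∈ K}, signOf (h x) =
        (2 : ℝ) ^ ((K.card + d - 1) / d) * (z : ℝ)) →
    ∀ (N j d : ℕ) (g : (Fin (N + 1) → Bool) → Bool) (b : Bool) (u : (Fin N → Bool) → ℤ), IsDegLeFun 3 g →
      (∀ x : Fin N → Bool, W (fun y => signOf (g y)) (Fin.snoc x b) = (2 : ℝ) ^ j * (u x : ℝ)) →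
      (∀ k, d < k → k ≤ N → j + 1 ≤ k + (N + 1 - k + 2) / 3) →
      IsDegLeFun d (fun x => decide (Odd (u x))) :=
  -- LANDED as Summit.QuantumAdvantage.QuantumAdvantage.Theorems.CubicForrelation.NearExactIsExact.stub_levelOnHyperplane (p142370, ACCEPTED; worker wave 2, lead c6): plugged in by import.
  Summit.QuantumAdvantage.QuantumAdvantage.Theorems.CubicForrelation.NearExactIsExact.stub_levelOnHyperplane

/-- **stub_linearTransport** (size S/M — a linear change of coordinates and its contragredient preserve the forrelation and
transport the Walsh transform; the calc block of the landed `stub_mmNormalForm`, packaged).  For matrices `M, M'` over `𝔽₂` with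
`M'M = 1` put `f₁ = f ∘ M` and `g₁ = g ∘ M'ᵀ` (bit-vectors read in `𝔽₂` via `ind`, back via `decide (· = 1)`); then
`Φ(f₁,g₁) = Φ(f,g)` (`⟨x, M'ᵀy⟩ = ⟨M'x', y⟩`, two reindexings) and `W_{g₁}(x) = W_g(Mx)` (reindex `y ↦ M'ᵀ y`, whose inverse
is `Mᵀ`).  Degrees are preserved by the landed `nf_isDegLeFun_mulVec`. -/
theorem stub_linearTransport :
    ∀ (n : ℕ) (M M' : Matrix (Fin n) (Fin n) (ZMod 2)), M' * M = 1 →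
      ∀ (f g : (Fin n → Bool) → Bool),
        forrelation (fun x => f (fun i => decide ((M *ᵥ ind x) i = 1)))
            (fun y => g (fun i => decide ((M'ᵀ *ᵥ ind y) i = 1))) = forrelation f g ∧
        ∀ x, W (fun y => signOf (g (fun i => decide ((M'ᵀ *ᵥ ind y) i = 1)))) x =
          W (fun y => signOf (g y)) (fun i => decide ((M *ᵥ ind x) i = 1)) :=
  -- LANDED as Summit.QuantumAdvantage.QuantumAdvantage.Theorems.CubicForrelation.NearExactIsExact.stub_linearTransport (p142006, ACCEPTED; worker wave 2, lead c6): plugged in by import.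
  Summit.QuantumAdvantage.QuantumAdvantage.Theorems.CubicForrelation.NearExactIsExact.stub_linearTransport

/-! #### Wave 3 (lead c6, cycle 2): the assembly pieces of the balanced-split exclusion

The lead's assembly `balancedSplit_empty` (work/TenBalanced.lean) runs: `split_ten` ⇒ split covector `c` as an affine character
(`stub_affineForm`) ⇒ `δ = D_c g` balanced ⇒ complementing structure `e` (`stub_quadBalancedStructure`) ⇒ a basis with `e, c` as the
last two vectors (`stub_basisWithTwo`) transported by `stub_linearTransport` ⇒ normal form `g₁ = E ⊕ y₉D ⊕ y₁₀(y₉ ⊕ Q)` ⇒ peeling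
(`stub_tenPeel`: `W_{g₁}(x_w,a,b) = 2(−1)^{ab} W_{G[a,b]}(x_w)`, `Φ = ¼ Σ_{a,b} Φ₈(F[a,b], G[a,b])`, `G[a,b] = E ⊕ QD ⊕ aQ ⊕ bD`) ⇒ on the
heavy hyperplane `u₅` is odd (`stub_levelOnHyperplane` + cost identity) ⇒ `G[·,b′]` bent, `G[·,b]` type O ⇒ `stub_eightBitEndgame`
(type-O capacity `7/8` via `stub_levelCapacity`, RM(4,8) distance, Hou at `n = 8`, `stub_typeE8`) ⇒ contradiction. -/

/-- **stub_tenPeel** (size M — peeling a 10-bit function of balanced-split normal form along its last two coordinates).  If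
`g(w ‖ a ‖ b) = E(w) ⊕ (a ∧ D w) ⊕ (b ∧ (a ⊕ Q w))` for all `w ∈ 𝔽₂⁸`, `a b ∈ 𝔽₂`, then `W_g(x ‖ a ‖ b) = 2·(−1)^{ab}·W_{G[a,b]}(x)` with
`G[a,b] = E ⊕ QD ⊕ aQ ⊕ bD` (sum out the last coordinate: `Σ_{b₀}(−1)^{b₀(a₀ ⊕ Q ⊕ b)} = 2[a₀ = Q ⊕ b]`), and consequently
`Φ(f,g) = ¼ Σ_{a,b} Φ₈(f(· ‖ a ‖ b) ⊕ ab, G[a,b])` (`2^{15} Φ = Σ_x (−1)^f W_g`, `2^{12} Φ₈ = Σ_x (−1)^F W_G`: `vg_two_pow_mul_forrelation`). -/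
theorem stub_tenPeel :
    ∀ (E D Q : (Fin (4 + 4) → Bool) → Bool) (f g : (Fin (4 + 4 + 1 + 1) → Bool) → Bool),
      (∀ (w : Fin (4 + 4) → Bool) (a b : Bool),
        g (Fin.snoc (Fin.snoc w a) b) = (E w ^^ (a && D w) ^^ (b && (a ^^ Q w)))) →
      (∀ (x : Fin (4 + 4) → Bool) (a b : Bool),
        W (fun y => signOf (g y)) (Fin.snoc (Fin.snoc x a) b) =
          2 * signOf (a && b) *
            W (fun w => signOf (E w ^^ (Q w && D w) ^^ (a && Q w) ^^ (b && D w))) x) ∧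
      forrelation f g = (1 / 4) * ∑ a : Bool, ∑ b : Bool,
        forrelation (fun x : Fin (4 + 4) → Bool => f (Fin.snoc (Fin.snoc x a) b) ^^ (a && b))
          (fun w => E w ^^ (Q w && D w) ^^ (a && Q w) ^^ (b && D w)) :=
  -- LANDED as Summit.QuantumAdvantage.QuantumAdvantage.Theorems.CubicForrelation.NearExactIsExact.stub_tenPeel (p143037, ACCEPTED; worker wave 3, lead c6): plugged in by import.
  Summit.QuantumAdvantage.QuantumAdvantage.Theorems.CubicForrelation.NearExactIsExact.stub_tenPeel

/-- **stub_basisWithTwo** (size S/M — linear algebra over `𝔽₂`).  Two distinct non-zero vectors of `𝔽₂^{n+2}` are linearly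
independent, hence the last two columns of an invertible matrix: `∃ N N'`, `N'N = 1`, `N e_n = e`, `N e_{n+1} = c`
(`LinearIndependent.extend` / `Basis.extend`, reindexed to `Fin (n+2)` with `e, c` last; `N` = the basis matrix,
`N'` from `Basis.toMatrix` invertibility). -/
theorem stub_basisWithTwo :
    ∀ (n : ℕ) (e c : Fin (n + 2) → ZMod 2), e ≠ 0 → c ≠ 0 → e ≠ c →
      ∃ N N' : Matrix (Fin (n + 2)) (Fin (n + 2)) (ZMod 2), N' * N = 1 ∧
        N *ᵥ Pi.single ⟨n, by omega⟩ 1 = e ∧ N *ᵥ Pi.single ⟨n + 1, by omega⟩ 1 = c :=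
  -- LANDED as Summit.QuantumAdvantage.QuantumAdvantage.Theorems.CubicForrelation.NearExactIsExact.stub_basisWithTwo (p143055, ACCEPTED; worker wave 3, lead c6): plugged in by import.
  Summit.QuantumAdvantage.QuantumAdvantage.Theorems.CubicForrelation.NearExactIsExact.stub_basisWithTwo

/-- **stub_affineForm** (size S — a function of degree `≤ 1` is an affine character).  If `P` has degree `≤ 1` then
`(−1)^{P(x)} = (−1)^b · (−1)^{c·x}` for some `c ∈ 𝔽₂ⁿ`, `b ∈ 𝔽₂` (the representing polynomial of total degree `≤ 1` is
`b + Σ_i c_i X_i`: every exponent vector of total degree `≤ 1` is `0` or a `single i 1`). -/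
theorem stub_affineForm :
    ∀ (n : ℕ) (P : (Fin n → Bool) → Bool), IsDegLeFun 1 P →
      ∃ (c : Fin n → Bool) (b : Bool), ∀ x, signOf (P x) = signOf b * twist c x :=
  -- LANDED as Summit.QuantumAdvantage.QuantumAdvantage.Theorems.CubicForrelation.NearExactIsExact.stub_affineForm (p142945, ACCEPTED; worker wave 3, lead c6): plugged in by import.
  Summit.QuantumAdvantage.QuantumAdvantage.Theorems.CubicForrelation.NearExactIsExact.stub_affineForm

/-- **stub_eightBitEndgame** (size M — the 8-bit endgame of the balanced split, given the statement of `stub_typeE8` as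
first antecedent).  Data: `E` cubic, `D, Q` quadratic on 8 bits, the four slices `G[a,b'] = E ⊕ QD ⊕ aQ ⊕ b'D`, cubic partners
`F a b'`; hypotheses: the two slices `G[·,¬b]` are BENT and the two slices `G[·,b]` are TYPE O (`W = 8·odd`).  Claim:
`¼ Σ_{a,b'} Φ₈(F a b', G[a,b']) ≤ 7/8`.  Proof: type-O slices have capacity `Σ|W| ≤ 3584` (`stub_levelCapacity` with
`m = 4, j = 3, d = 0`; `tw_forrelation_le_of_cap`) so contribute `≤ 7/8` each; a bent slice contributes `1 − 2·wt(F ⊕ G̃)/256`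
(`bb_exists_dual`, `bb_bent_distance_form`) with `deg(F ⊕ G̃) ≤ 4` (`bb_dual_isDegLeFun`, `bb_isDegLeFun_bxor`), i.e. `1` or
`≤ 7/8` (`bb_rmWeight_holds`, `d = 4`); `> 7/2` in total forces an EXACT bent slice `F = G̃`, whose dual `F` is cubic, so (Hou at
`n = 8`: `stub_houCubic stub_axParity` applied to the cubic bent `F` with dual `G`, via `bb_W_dual`/`bb_dual_isBent`) that `G[a₀,¬b] =: A` is
CUBIC bent; then `G[a₀,b] = A ⊕ D` has `W ≡ 0 (mod 16)` by the type-E antecedent — contradicting type O. -/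
theorem stub_eightBitEndgame :
    (∀ (A B : (Fin (4 + 4) → Bool) → Bool), IsDegLeFun 3 A → IsDegLeFun 2 B →
      (∀ x, W (fun y => signOf (A y)) x ^ 2 = (2 : ℝ) ^ (4 + 4)) →
      ∀ x, ∃ k : ℤ, W (fun y => signOf (A y ^^ B y)) x = 16 * (k : ℝ)) →
    ∀ (E D Q : (Fin (4 + 4) → Bool) → Bool) (F : Bool → Bool → (Fin (4 + 4) → Bool) → Bool) (b : Bool),
      IsDegLeFun 3 E → IsDegLeFun 2 D → IsDegLeFun 2 Q → (∀ a b', IsDegLeFun 3 (F a b')) →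
      (∀ a x, W (fun w => signOf (E w ^^ (Q w && D w) ^^ (a && Q w) ^^ (!b && D w))) x ^ 2 = (2 : ℝ) ^ (4 + 4)) →
      (∀ a x, ∃ k : ℤ, W (fun w => signOf (E w ^^ (Q w && D w) ^^ (a && Q w) ^^ (b && D w))) x = 8 * (2 * k + 1)) →
      ¬ (7 / 8 < (1 / 4 : ℝ) * ∑ a : Bool, ∑ b' : Bool,
        forrelation (F a b') (fun w => E w ^^ (Q w && D w) ^^ (a && Q w) ^^ (b' && D w))) :=
  -- LANDED as Summit.QuantumAdvantage.QuantumAdvantage.Theorems.CubicForrelation.NearExactIsExact.stub_eightBitEndgame (p143042, ACCEPTED; worker wave 3, lead c6): plugged in by import.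
  Summit.QuantumAdvantage.QuantumAdvantage.Theorems.CubicForrelation.NearExactIsExact.stub_eightBitEndgame

/-! ### §4c The open core (both sides neither MM- nor almost-MM-shaped; bent branch: partner not low-rank-spanned) -/

/-- **stub_bentBandLarge** (OPEN — the bent branch of the core FROM `n = 42` ON, lead reshapes c1 + c3 + c4: with the window
bottom at `1 − 2⁻¹⁰` a non-exact bent-sided pair needs `dist(f, g̃)/2ⁿ < 2⁻¹¹`, hence `deg g̃ ≥ 12`, hence `m ≥ 21` by Hou —
`bb_band_of_mid_m` closes `m ≤ 20` unconditionally). There is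
`θ₂ > 1 − 2⁻¹⁰` such that for all cubic `f, g` on `m + m ≥ 42` bits with `g` BENT, NEITHER `f` nor `g` MM-shaped NOR
almost-MM-shaped, `f` NOT `(8,11)`-low-rank-spanned (its derivative directions of rank `≤ 16` span a subspace of
codimension `≥ 12`; lead c4, `lrdrBand_of_parts`) and, if `f` is bent too, `g` not `(8,11)`-low-rank-spanned either, and `f`
ALMOST BENT in the sense that it has no UNBALANCED derivative of rank `≤ 6` (lead c4, `noLowRankUnbalanced_of_window`),
`Φ(f,g) ≤ 1 − 2⁻¹⁰ ∨ θ₂ ≤ Φ(f,g)`; in distance form (`bb_bent_distance_form`): no such cubic `f` lies at relative distance in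
`((1 − θ₂)/2, 2⁻¹¹)` from the dual `g̃` (`12 ≤ deg g̃ ≤ (m+3)/2`).  Size XL (crux core). -/
theorem stub_bentBandLarge :
    ∃ θ₂ : ℝ, 1 - 1 / 1024 < θ₂ ∧ ∀ (m : ℕ) (f g : (Fin (m + m) → Bool) → Bool), 21 ≤ m →
      IsDegLeFun 3 f → IsDegLeFun 3 g →
      (∀ x, W (fun y => signOf (g y)) x ^ 2 = (2 : ℝ) ^ (m + m)) →
      ¬ (∃ V : Finset (Fin (m + m) → Bool), zeroVec ∈ V ∧ (∀ x ∈ V, ∀ y ∈ V, bxor x y ∈ V) ∧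
        V.card * V.card = 2 ^ (m + m) ∧
        ∀ u ∈ V, ∀ v ∈ V, ∀ y, (f y ^^ f (bxor y u) ^^ f (bxor y v) ^^ f (bxor y (bxor u v))) = false) →
      ¬ (∃ V : Finset (Fin (m + m) → Bool), zeroVec ∈ V ∧ (∀ x ∈ V, ∀ y ∈ V, bxor x y ∈ V) ∧
        V.card * V.card = 2 ^ (m + m) ∧
        ∀ u ∈ V, ∀ v ∈ V, ∀ y, (g y ^^ g (bxor y u) ^^ g (bxor y v) ^^ g (bxor y (bxor u v))) = false) →
      ¬ (∃ V : Finset (Fin (m + m) → Bool), zeroVec ∈ V ∧ (∀ x ∈ V, ∀ y ∈ V, bxor x y ∈ V) ∧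
        V.card * V.card * 4 = 2 ^ (m + m) ∧
        ∀ u ∈ V, ∀ v ∈ V, ∀ y, (f y ^^ f (bxor y u) ^^ f (bxor y v) ^^ f (bxor y (bxor u v))) = false) →
      ¬ (∃ V : Finset (Fin (m + m) → Bool), zeroVec ∈ V ∧ (∀ x ∈ V, ∀ y ∈ V, bxor x y ∈ V) ∧
        V.card * V.card * 4 = 2 ^ (m + m) ∧
        ∀ u ∈ V, ∀ v ∈ V, ∀ y, (g y ^^ g (bxor y u) ^^ g (bxor y v) ^^ g (bxor y (bxor u v))) = false) →
      ¬ (∃ V : Finset (Fin (m + m) → Bool), zeroVec ∈ V ∧ (∀ x ∈ V, ∀ y ∈ V, bxor x y ∈ V) ∧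
        2 ^ (m + m) ≤ 2 ^ 11 * V.card ∧
        ∀ v ∈ V, ∀ P : (Fin (m + m) → Bool) → Prop,
          (∀ u, (∀ w, dwt (fun x => signOf (f x)) u w = 0 ∨
            (4 : ℝ) ^ (m + m) ≤ (4 : ℝ) ^ 8 * dwt (fun x => signOf (f x)) u w ^ 2) → P u) →
          P zeroVec → (∀ x y, P x → P y → P (bxor x y)) → P v) →
      ((∀ x, W (fun y => signOf (f y)) x ^ 2 = (2 : ℝ) ^ (m + m)) →
        ¬ (∃ V : Finset (Fin (m + m) → Bool), zeroVec ∈ V ∧ (∀ x ∈ V, ∀ y ∈ V, bxor x y ∈ V) ∧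
          2 ^ (m + m) ≤ 2 ^ 11 * V.card ∧
          ∀ v ∈ V, ∀ P : (Fin (m + m) → Bool) → Prop,
            (∀ u, (∀ w, dwt (fun x => signOf (g x)) u w = 0 ∨
              (4 : ℝ) ^ (m + m) ≤ (4 : ℝ) ^ 8 * dwt (fun x => signOf (g x)) u w ^ 2) → P u) →
            P zeroVec → (∀ x y, P x → P y → P (bxor x y)) → P v)) →
      (∀ h, h ≠ zeroVec → (∀ w, dwt (fun x => signOf (f x)) h w = 0 ∨
          (4 : ℝ) ^ (m + m) ≤ (4 : ℝ) ^ 3 * dwt (fun x => signOf (f x)) h w ^ 2) →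
        dwt (fun x => signOf (f x)) h zeroVec = 0) →
        forrelation f g ≤ 1 - 1 / 1024 ∨ θ₂ ≤ forrelation f g := by
  sorry

/-- **stub_nonBentBand** (OPEN — the non-bent branch of the core FROM `n = 30` ON; HARDEST; lead reshape c6: the 2-adic Walsh
tower WALK closes `5 ≤ m ≤ 14` unconditionally — a NON-bent cubic `g` on `10 ≤ n ≤ 28` bits has Walsh capacity `≤ 2^{3m}(1 − 2⁻¹⁰)`,
so `Φ(f,g) ≤ 1 − 2⁻¹⁰` for every `f` (landed `nonBentBand_le_28`, used in `NearExactIsExact_of`); the first `n` where a level of the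
tower is cheaper than the window is `n = 30` (type-O base level, cost `2⁻¹¹`: every Walsh value an odd multiple of `2¹⁰`). Lead reshape
c4 supplies the every-direction row-defect tool UR as an antecedent and the two-sided almost-bentness hypotheses: neither `f` nor `g`
has an UNBALANCED derivative of rank `≤ 6`, `noLowRankUnbalanced_of_window`). There is `θ₂ > 1 − 2⁻¹⁰` such that for all cubic `f, g`
on `m + m ≥ 30` bits with NEITHER function bent and NEITHER MM-shaped NOR almost-MM-shaped (and both almost bent in that sense),
`Φ(f,g) ≤ 1 − 2⁻¹⁰ ∨ θ₂ ≤ Φ(f,g)`.  By the tower, such a `g` in the window has ALL 2-adic levels of cost `≥ 2⁻¹⁰` vanishing (at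
`n = 30`: `W_g ≡ 2¹⁰ (mod 2¹¹)` everywhere, capacity `≤ 1 − 2⁻¹¹`).  Why plausible: no
non-bent cubic pair above `57/64` is known and every one found ≥ 13/16 is MM-shaped; every algebraic construction meets
the granularity wall (Disproof §5); the honest single statement behind both open stubs is NX (crux NOTES): near-exact ⇒
MM-shaped.  Why it might fail: a genuinely non-MM near-bent cubic whose Walsh SIGN pattern is nearly cubic via an
identity of unbounded degree.  Size XL (crux core). -/
theorem stub_nonBentBand :
    (∀ (n : ℕ) (f g : (Fin n → Bool) → Bool) (h : Fin n → Bool),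
      (4 : ℝ) ^ n * (1 - 8 * (1 - forrelation f g ^ 2)) ≤
        ∑ u, dwt (fun x => signOf (f x)) h u * dwt (fun y => signOf (g y)) u h) →
    (∀ (s k : ℕ) (f g : (Fin (s + s + k) → Bool) → Bool) (F G : (Fin s → Bool) → (Fin k → Bool) → Bool),
      (∀ (a b : Fin s → Bool) (c : Fin k → Bool),
          signOf (f (Fin.append (Fin.append a b) c)) = twist a b * signOf (F a c)) →
      (∀ (y u : Fin s → Bool) (w : Fin k → Bool),
          signOf (g (Fin.append (Fin.append y u) w)) = twist y u * signOf (G u w)) →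
      forrelation f g = ((2 : ℝ) ^ s)⁻¹ * ∑ a : Fin s → Bool, forrelation (F a) (G a)) →
    (∀ (m : ℕ) (g₁ g₂ g₃ d₁ d₂ d₃ d₄ : (Fin (m + m) → Bool) → Bool),
      (∀ x, W (fun y => signOf (g₁ y)) x = (2 : ℝ) ^ m * signOf (d₁ x)) →
      (∀ x, W (fun y => signOf (g₂ y)) x = (2 : ℝ) ^ m * signOf (d₂ x)) →
      (∀ x, W (fun y => signOf (g₃ y)) x = (2 : ℝ) ^ m * signOf (d₃ x)) →
      (∀ x, W (fun y => signOf (g₁ y ^^ g₂ y ^^ g₃ y)) x = (2 : ℝ) ^ m * signOf (d₄ x)) →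
      ((∀ x, d₄ x = (d₁ x ^^ d₂ x ^^ d₃ x)) ↔
        ∀ x, W (fun y => signOf ((g₁ y && g₂ y) ^^ (g₁ y && g₃ y) ^^ (g₂ y && g₃ y))) x ^ 2 = (2 : ℝ) ^ (m + m))) →
    type_of% stub_fibreAverageRelabeled → type_of% stub_templateRigidity →
    ∃ θ₂ : ℝ, 1 - 1 / 1024 < θ₂ ∧ ∀ (m : ℕ) (f g : (Fin (m + m) → Bool) → Bool), 15 ≤ m →
      IsDegLeFun 3 f → IsDegLeFun 3 g →
      ¬ (∀ x, W (fun y => signOf (f y)) x ^ 2 = (2 : ℝ) ^ (m + m)) →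
      ¬ (∀ x, W (fun y => signOf (g y)) x ^ 2 = (2 : ℝ) ^ (m + m)) →
      ¬ (∃ V : Finset (Fin (m + m) → Bool), zeroVec ∈ V ∧ (∀ x ∈ V, ∀ y ∈ V, bxor x y ∈ V) ∧
        V.card * V.card = 2 ^ (m + m) ∧
        ∀ u ∈ V, ∀ v ∈ V, ∀ y, (f y ^^ f (bxor y u) ^^ f (bxor y v) ^^ f (bxor y (bxor u v))) = false) →
      ¬ (∃ V : Finset (Fin (m + m) → Bool), zeroVec ∈ V ∧ (∀ x ∈ V, ∀ y ∈ V, bxor x y ∈ V) ∧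
        V.card * V.card = 2 ^ (m + m) ∧
        ∀ u ∈ V, ∀ v ∈ V, ∀ y, (g y ^^ g (bxor y u) ^^ g (bxor y v) ^^ g (bxor y (bxor u v))) = false) →
      ¬ (∃ V : Finset (Fin (m + m) → Bool), zeroVec ∈ V ∧ (∀ x ∈ V, ∀ y ∈ V, bxor x y ∈ V) ∧
        V.card * V.card * 4 = 2 ^ (m + m) ∧
        ∀ u ∈ V, ∀ v ∈ V, ∀ y, (f y ^^ f (bxor y u) ^^ f (bxor y v) ^^ f (bxor y (bxor u v))) = false) →
      ¬ (∃ V : Finset (Fin (m + m) → Bool), zeroVec ∈ V ∧ (∀ x ∈ V, ∀ y ∈ V, bxor x y ∈ V) ∧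
        V.card * V.card * 4 = 2 ^ (m + m) ∧
        ∀ u ∈ V, ∀ v ∈ V, ∀ y, (g y ^^ g (bxor y u) ^^ g (bxor y v) ^^ g (bxor y (bxor u v))) = false) →
      (∀ h, h ≠ zeroVec → (∀ w, dwt (fun x => signOf (f x)) h w = 0 ∨
          (4 : ℝ) ^ (m + m) ≤ (4 : ℝ) ^ 3 * dwt (fun x => signOf (f x)) h w ^ 2) →
        dwt (fun x => signOf (f x)) h zeroVec = 0) →
      (∀ h, h ≠ zeroVec → (∀ w, dwt (fun x => signOf (g x)) h w = 0 ∨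
          (4 : ℝ) ^ (m + m) ≤ (4 : ℝ) ^ 3 * dwt (fun x => signOf (g x)) h w ^ 2) →
        dwt (fun x => signOf (g x)) h zeroVec = 0) →
        forrelation f g ≤ 1 - 1 / 1024 ∨ θ₂ ≤ forrelation f g := by
  sorry

/-! ## §5 Composition (sorry-free): the stub STATEMENTS imply the crux BY NAME -/

/-- **The MM-shape ceiling from its parts**: `HasMSubspace g`, `f g` cubic ⇒ `Φ(f,g) = 1 ∨ Φ(f,g) ≤ 31/32` — straighten
(N, using D), then apply the form ceiling (F2, fed with D, R and the identity F1) to the straightened pair, whose `Φ` is the same. -/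
theorem mmShapeCeiling_of_parts (hD : type_of% stub_derivDegree) (hR : type_of% stub_rmWeight)
    (hN : type_of% stub_mmNormalForm) (hW : type_of% stub_mmWalsh) (hF : type_of% stub_mmFormCeiling) :
    ∀ (m : ℕ) (f g : (Fin (m + m) → Bool) → Bool), IsDegLeFun 3 f → IsDegLeFun 3 g →
      HasMSubspace g → forrelation f g = 1 ∨ forrelation f g ≤ 31 / 32 := by
  intro m f g hf hg hM
  obtain ⟨f₁, g₁, π, h, hf₁, hπ, hh, hsign, hΦ⟩ := hN hD m f g hf hg hM
  rw [← hΦ]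
  exact hF hD (hR hD) hW m f₁ g₁ π h hf₁ hπ hh hsign

/-- **The almost-MM ceiling from its parts**: `HasAMSubspace g`, `f g` cubic ⇒ `Φ = 1 ∨ Φ ≤ 1 − 2⁻¹⁰ ∨ HasMSubspace g` —
`4|V|² = 2^{m+m}` forces `m = a + 1`; straighten (AN, using D) to the `(a, a+2)` sign form with the same `Φ`, apply AC (fed
with D, R, AW, FP, RP), and pull an M-subspace of the straightened `g₁` back to `g` (last clause of AN). -/
theorem ammShapeCeiling_of_parts (hD : type_of% stub_derivDegree) (hR : type_of% stub_rmWeight)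
    (hAN : type_of% stub_ammNormalForm) (hAW : type_of% stub_ammWalsh) (hFP : type_of% stub_fourPoint)
    (hRP : type_of% stub_rankTwoPencil) (hAA : type_of% stub_ammAccounting) (hAC : type_of% stub_ammCeiling) :
    ∀ (m : ℕ) (f g : (Fin (m + m) → Bool) → Bool), IsDegLeFun 3 f → IsDegLeFun 3 g →
      HasAMSubspace g → forrelation f g = 1 ∨ forrelation f g ≤ 1 - 1 / 1024 ∨ HasMSubspace g := by
  intro m f g hf hg hAM
  obtain ⟨a, rfl⟩ : ∃ a, m = a + 1 := by
    obtain ⟨V, -, -, hVc, -⟩ := hAM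
    cases m with
    | zero =>
      exfalso
      have h1 : V.card * V.card * 4 = 1 := by rw [hVc]; rfl
      omega
    | succ a => exact ⟨a, rfl⟩
  obtain ⟨f₁, g₁, φ, h, hf₁, hφ, hh, hsign, hΦ, hback⟩ := hAN hD a f g hf hg hAM
  rcases hAC hD (hR hD) hAW hFP hRP hAA a f₁ g₁ φ h hf₁ hφ hh hsign with h1 | h2 | h3
  · left; rw [← hΦ]; exact h1
  · right; left; rw [← hΦ]; exact h2
  · right; right; exact hback h3

/-- **The low-rank dyadic rigidity band from its parts** (lead c4): for cubic `f`, cubic BENT `g` and `f`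
`(j,k)`-low-rank-spanned, `Φ(f,g) = 1 ∨ Φ(f,g) ≤ 1 − 2^{−(j+2)} ∨ Φ(f,g) ≤ 1 − 2^{1−k}`.  Dual `d` of `g` (`bb_exists_dual`),
`Φ = 1 − 2·wt(f ⊕ d)/2ⁿ` (`bb_forrelation_eq_of_dual`); if `Φ > 1 − 2^{−(j+2)}` then `8·wt < 2^{n−j}`; every low-rank row `u` of
`T_f` is plateaued at a level `2^s ≥ 2^{n−j}` (QW on the quadratic `D_u f`, by D), row `u` of `T_d` is the transposed column
of `T_g` (`bb_dwt_transpose_dual`), dyadic (QW on `D_v g`, by D), and `4·wt`-close (PR), so LP makes `f ⊕ d` `u`-periodic;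
periodicity passes to the xor-span (induction) hence to `V`, and IW gives `|V| ∣ wt`, so `wt = 0` or `wt ≥ |V| ≥ 2^{n−k}`. -/
theorem lrdrBand_of_parts (hD : type_of% stub_derivDegree) (hQW : type_of% stub_quadWalshPlateau)
    (hDP : type_of% stub_dyadicPin) (hPR : type_of% stub_perturbRow) (hIW : type_of% stub_invariantWeight)
    (hLP : type_of% stub_lrdrPin) (hLB : type_of% stub_lrdrBand) :
    ∀ (m j k : ℕ) (f g : (Fin (m + m) → Bool) → Bool), IsDegLeFun 3 f → IsDegLeFun 3 g → IsBentFun g →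
      LRSpanned j k f →
      forrelation f g = 1 ∨ forrelation f g ≤ 1 - (1 / 2) ^ (j + 2) ∨ forrelation f g ≤ 1 - 2 * (1 / 2) ^ k :=
  fun m j k f g hf hg hb hLR => hLB hD hQW hDP hPR hIW hLP m j k f g hf hg hb hLR

/-- **Small dimensions are closed by value granularity** (lead c4, from VG): for `m ≤ 4` and cubic `g`,
`Φ(f,g) ∈ 2^{⌈2m/3⌉−3m} ℤ ⊆ 2^{−9} ℤ`, and `Φ ≤ 1`, so `Φ = 1 ∨ Φ ≤ 1 − 2⁻⁹ ≤ 1 − 2⁻¹⁰`. -/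
theorem band_of_small_m (hAx : type_of% stub_axParity) (hVG : type_of% stub_valueGranularity) :
    ∀ (m : ℕ), m ≤ 4 → ∀ (f g : (Fin (m + m) → Bool) → Bool), IsDegLeFun 3 g →
      forrelation f g = 1 ∨ forrelation f g ≤ 1 - 1 / 1024 := by
  intro m hm f g hg
  obtain ⟨z, hz⟩ := hVG hAx m f g hg
  have hle : forrelation f g ≤ 1 := forrelation_le_one f g
  -- split 2^{3m} = 2^{c} · 2^{N} with N = 3m − c ≤ 9
  set c : ℕ := (m + m + 2) / 3 with hc
  have hcm : c ≤ 3 * m := by omega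
  obtain ⟨N, hN⟩ : ∃ N, 3 * m = c + N := ⟨3 * m - c, by omega⟩
  have hN9 : N ≤ 9 := by omega
  rw [hN, pow_add] at hz
  have h2c : (0 : ℝ) < (2 : ℝ) ^ c := by positivity
  have hz' : (2 : ℝ) ^ N * forrelation f g = z := by
    have := hz; rw [mul_assoc] at this; exact mul_left_cancel₀ h2c.ne' this
  have h2N : (0 : ℝ) < (2 : ℝ) ^ N := by positivity
  -- z ≤ 2^N, an integer inequality
  have hzle : (z : ℝ) ≤ (2 : ℝ) ^ N := by rw [← hz']; nlinarith
  have hzleZ : z ≤ 2 ^ N := by exact_mod_cast hzle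
  rcases eq_or_lt_of_le hzleZ with hzeq | hzlt
  · left
    have : (z : ℝ) = (2 : ℝ) ^ N := by rw [hzeq]; push_cast; ring
    rw [this] at hz'
    nlinarith
  · right
    have hz1 : z ≤ 2 ^ N - 1 := by omega
    have hz1R : (z : ℝ) ≤ (2 : ℝ) ^ N - 1 := by exact_mod_cast hz1
    have hNR : (2 : ℝ) ^ N ≤ 2 ^ 9 := pow_le_pow_right₀ (by norm_num) hN9
    -- Φ = z / 2^N ≤ 1 − 1/2^N ≤ 1 − 1/512
    have hΦ : forrelation f g * (2 : ℝ) ^ N ≤ (2 : ℝ) ^ N - 1 := by nlinarith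
    have hΦ' : forrelation f g ≤ 1 - 1 / (2 : ℝ) ^ N := by
      rw [le_sub_iff_add_le, ← le_sub_iff_add_le', div_le_iff₀ h2N]; linarith
    have h9 : 1 / (2 : ℝ) ^ 9 ≤ 1 / (2 : ℝ) ^ N := one_div_le_one_div_of_le h2N hNR
    have : forrelation f g ≤ 1 - 1 / (2 : ℝ) ^ 9 := by linarith
    norm_num at this ⊢
    linarith

/-- **Two-sided almost-bentness in the window** (lead c4; crux idea `two-sided-almost-bentness`, from the landed
`tb_autocorr_le_of_forrelation` + QW via D): if `Φ(f,g) > 1 − 2⁻¹⁰` then neither `f` nor `g` has an UNBALANCED derivative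
of rank `≤ 6` — an unbalanced low-rank row would give `|T_g(h,0)| = 2^s ≥ 2^{m+m}/8`, while near-exactness bounds every
autocorrelation by `2^{m+m}(2√(2(1−Φ)) + 2(1−Φ)) < 2^{m+m}/8`. -/
theorem noLowRankUnbalanced_of_window (hD : type_of% stub_derivDegree) (hQW : type_of% stub_quadWalshPlateau) :
    ∀ (m : ℕ) (f g : (Fin (m + m) → Bool) → Bool), IsDegLeFun 3 f → IsDegLeFun 3 g →
      1 - 1 / 1024 < forrelation f g → NoLowRankUnbalanced f ∧ NoLowRankUnbalanced g := by
  have one : ∀ (m : ℕ) (f g : (Fin (m + m) → Bool) → Bool), IsDegLeFun 3 g →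
      1 - 1 / 1024 < forrelation f g → NoLowRankUnbalanced g := by
    intro m f g hg hΦ h hh hlow
    by_contra hne
    obtain ⟨s, hs⟩ := hQW (m + m) (fun x => g x ^^ g (bxor x h)) (hD (m + m) 2 g h hg)
    have hplat : dwt (fun x => signOf (g x)) h zeroVec = 0 ∨ dwt (fun x => signOf (g x)) h zeroVec ^ 2 = (4 : ℝ) ^ s := by
      rw [Summit.QuantumAdvantage.QuantumAdvantage.Theorems.CubicForrelation.NearExactIsExact.lb_dwt_eq_W_deriv]; exact hs zeroVec
    have hsq := hplat.resolve_left hne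
    have hlev : (4 : ℝ) ^ (m + m) ≤ (4 : ℝ) ^ 3 * (4 : ℝ) ^ s := by
      have := (hlow zeroVec).resolve_left hne; rwa [hsq] at this
    have habs : |dwt (fun x => signOf (g x)) h zeroVec| = (2 : ℝ) ^ s := Summit.QuantumAdvantage.QuantumAdvantage.Theorems.CubicForrelation.NearExactIsExact.dp_abs_eq hsq
    have hge : (2 : ℝ) ^ (m + m) ≤ (2 : ℝ) ^ 3 * (2 : ℝ) ^ s := by
      rw [Summit.QuantumAdvantage.QuantumAdvantage.Theorems.CubicForrelation.NearExactIsExact.lb_four_pow, Summit.QuantumAdvantage.QuantumAdvantage.Theorems.CubicForrelation.NearExactIsExact.lb_four_pow 3, Summit.QuantumAdvantage.QuantumAdvantage.Theorems.CubicForrelation.NearExactIsExact.lb_four_pow s, ← mul_pow] at hlev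
      exact (pow_le_pow_iff_left₀ (by positivity) (by positivity) two_ne_zero).1 hlev
    have htb := Summit.QuantumAdvantage.QuantumAdvantage.Theorems.CubicForrelation.NearExactIsExact.tb_autocorr_le_of_forrelation (m + m) f g h hh
    have hsum : ∑ y : Fin (m + m) → Bool, signOf (g y) * signOf (g (bxor y h)) = dwt (fun x => signOf (g x)) h zeroVec := by
      unfold dwt
      refine sum_congr rfl fun y _ => ?_
      have : twist (zeroVec : Fin (m + m) → Bool) y = 1 := by simp [twist, zeroVec]
      rw [this, mul_one]
    rw [hsum, habs] at htb
    have hle1 : forrelation f g ≤ 1 := forrelation_le_one f g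
    have hsqrt : Real.sqrt (2 * (1 - forrelation f g)) < 45 / 1000 := by
      rw [Real.sqrt_lt' (by norm_num)]; nlinarith
    have hsmall : 2 * Real.sqrt (2 * (1 - forrelation f g)) + 2 * (1 - forrelation f g) < 1 / 8 := by nlinarith
    have hp : (0 : ℝ) < (2 : ℝ) ^ (m + m) := by positivity
    have hlt : (2 : ℝ) ^ (m + m) * (2 * Real.sqrt (2 * (1 - forrelation f g)) + 2 * (1 - forrelation f g)) <
        (2 : ℝ) ^ (m + m) * (1 / 8) := mul_lt_mul_of_pos_left hsmall hp
    have h8 : (2 : ℝ) ^ 3 = 8 := by norm_num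
    rw [h8] at hge
    linarith
  intro m f g hf hg hΦ
  exact ⟨one m g f hf (by rwa [forrelation_comm]), one m f g hg hΦ⟩

/-- Hexachotomy ⇒ empty window `(θ₁, θ₂)` for any `θ₁ ≥ 1 − 2⁻¹⁰` (the almost-MM ceiling and the `(8,11)`-LRDR band, above the
MM ceiling `31/32`) and `θ₂ ≤ 1`: an MM- or almost-MM-shaped side is capped by the ceilings (for `f` by symmetry of `Φ`), a bent
side with a low-rank-spanned partner by the LRDR band, a bent side otherwise by the bent band (for `f` by symmetry), the rest
by the non-bent band. -/
theorem windowEmpty_of_hexachotomy {θ₁ θ₂ : ℝ} (hθ₁ : 1 - 1 / 1024 ≤ θ₁) (hθ₂ : θ₂ ≤ 1)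
    (hA : ∀ (m : ℕ) (f g : (Fin (m + m) → Bool) → Bool), IsDegLeFun 3 f → IsDegLeFun 3 g →
      HasMSubspace g → forrelation f g = 1 ∨ forrelation f g ≤ 31 / 32)
    (hA2 : ∀ (m : ℕ) (f g : (Fin (m + m) → Bool) → Bool), IsDegLeFun 3 f → IsDegLeFun 3 g →
      HasAMSubspace g → forrelation f g = 1 ∨ forrelation f g ≤ 1 - 1 / 1024 ∨ HasMSubspace g)
    (hL : ∀ (m : ℕ) (f g : (Fin (m + m) → Bool) → Bool), IsDegLeFun 3 f → IsDegLeFun 3 g → IsBentFun g →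
      LRSpanned 8 11 f →
      forrelation f g = 1 ∨ forrelation f g ≤ 1 - (1 / 2) ^ (8 + 2) ∨ forrelation f g ≤ 1 - 2 * (1 / 2) ^ 11)
    (hS : ∀ (m : ℕ), m ≤ 4 → ∀ (f g : (Fin (m + m) → Bool) → Bool), IsDegLeFun 3 g →
      forrelation f g = 1 ∨ forrelation f g ≤ 1 - 1 / 1024)
    (hN : ∀ (m : ℕ) (f g : (Fin (m + m) → Bool) → Bool), IsDegLeFun 3 f → IsDegLeFun 3 g →
      1 - 1 / 1024 < forrelation f g → NoLowRankUnbalanced f ∧ NoLowRankUnbalanced g)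
    (hB1 : ∀ (m : ℕ) (f g : (Fin (m + m) → Bool) → Bool), IsDegLeFun 3 f → IsDegLeFun 3 g →
      IsBentFun g → ¬ HasMSubspace f → ¬ HasMSubspace g → ¬ HasAMSubspace f → ¬ HasAMSubspace g →
      ¬ LRSpanned 8 11 f → (IsBentFun f → ¬ LRSpanned 8 11 g) → NoLowRankUnbalanced f →
        forrelation f g ≤ θ₁ ∨ θ₂ ≤ forrelation f g)
    (hB2 : ∀ (m : ℕ) (f g : (Fin (m + m) → Bool) → Bool), 5 ≤ m → IsDegLeFun 3 f → IsDegLeFun 3 g →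
      ¬ IsBentFun f → ¬ IsBentFun g → ¬ HasMSubspace f → ¬ HasMSubspace g → ¬ HasAMSubspace f → ¬ HasAMSubspace g →
      NoLowRankUnbalanced f → NoLowRankUnbalanced g →
        forrelation f g ≤ θ₁ ∨ θ₂ ≤ forrelation f g) :
    WindowEmpty θ₁ θ₂ := by
  rintro ρ ⟨n, ⟨m, rfl⟩, f, g, hf, hg, rfl⟩
  have h31 : (31 / 32 : ℝ) ≤ θ₁ := le_trans (by norm_num) hθ₁
  -- below the window there is nothing to show; inside it both sides are almost bent
  by_cases hlow : forrelation f g ≤ θ₁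
  · exact Or.inl hlow
  have hwin : 1 - 1 / 1024 < forrelation f g := lt_of_le_of_lt hθ₁ (not_le.1 hlow)
  -- m ≤ 4 (n ≤ 8): value granularity
  by_cases hm4 : m ≤ 4
  · rcases hS m hm4 f g hg with h1 | h2
    · right; rw [h1]; exact hθ₂
    · exact absurd (lt_of_lt_of_le hwin h2) (lt_irrefl _)
  have hm5 : 5 ≤ m := by omega
  obtain ⟨hNf, hNg⟩ := hN m f g hf hg hwin
  have caseA : ∀ {a b : (Fin (m + m) → Bool) → Bool}, IsDegLeFun 3 a → IsDegLeFun 3 b → HasMSubspace b →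
      forrelation a b ≤ θ₁ ∨ θ₂ ≤ forrelation a b := by
    intro a b ha hb hM
    rcases hA m a b ha hb hM with h1 | h2
    · right; rw [h1]; exact hθ₂
    · left; exact h2.trans h31
  have caseA2 : ∀ {a b : (Fin (m + m) → Bool) → Bool}, IsDegLeFun 3 a → IsDegLeFun 3 b → HasAMSubspace b →
      forrelation a b ≤ θ₁ ∨ θ₂ ≤ forrelation a b := by
    intro a b ha hb hM
    rcases hA2 m a b ha hb hM with h1 | h2 | h3
    · right; rw [h1]; exact hθ₂
    · left; exact h2.trans hθ₁
    · exact caseA ha hb h3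
  have caseL : ∀ {a b : (Fin (m + m) → Bool) → Bool}, IsDegLeFun 3 a → IsDegLeFun 3 b → IsBentFun b →
      LRSpanned 8 11 a → forrelation a b ≤ θ₁ ∨ θ₂ ≤ forrelation a b := by
    intro a b ha hb hB hLR
    rcases hL m a b ha hb hB hLR with h1 | h2 | h3
    · right; rw [h1]; exact hθ₂
    · left; exact le_trans (le_trans h2 (by norm_num)) hθ₁
    · left; exact le_trans (le_trans h3 (by norm_num)) hθ₁
  by_cases hMg : HasMSubspace g
  · exact caseA hf hg hMg
  by_cases hMf : HasMSubspace f
  · rw [forrelation_comm]; exact caseA hg hf hMf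
  by_cases hAg : HasAMSubspace g
  · exact caseA2 hf hg hAg
  by_cases hAf : HasAMSubspace f
  · rw [forrelation_comm]; exact caseA2 hg hf hAf
  by_cases hBg : IsBentFun g
  · by_cases hLf : LRSpanned 8 11 f
    · exact caseL hf hg hBg hLf
    by_cases hBf : IsBentFun f
    · by_cases hLg : LRSpanned 8 11 g
      · rw [forrelation_comm]; exact caseL hg hf hBf hLg
      · exact hB1 m f g hf hg hBg hMf hMg hAf hAg hLf (fun _ => hLg) hNf
    · exact hB1 m f g hf hg hBg hMf hMg hAf hAg hLf (fun h => absurd h hBf) hNf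
  by_cases hBf : IsBentFun f
  · by_cases hLg : LRSpanned 8 11 g
    · rw [forrelation_comm]; exact caseL hg hf hBf hLg
    · rw [forrelation_comm]
      exact hB1 m g f hg hf hBf hMg hMf hAg hAf hLg (fun h => absurd h hBg) hNg
  · exact hB2 m f g hm5 hf hg hBf hBg hMf hMg hAf hAg hNf hNg

/-- **Mid dimensions are closed too** (lead c4): for `m ≤ 20` every cubic pair with `g` bent has `Φ = 1 ∨ Φ ≤ 1 − 2⁻¹⁰`,
because Hou's bound (HOU, fed with AX) gives `deg g̃ ≤ (m+3)/2 ≤ 11`, so the word `f ⊕ g̃` of degree `≤ 11` is zero or has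
relative weight `≥ 2⁻¹¹` (R): `bb_band_of_dual_degree` with `d₀ = 11`.  With the window bottom at the almost-MM ceiling
`1 − 2⁻¹⁰`, the bent core therefore starts at `m = 21` (`n = 42`, `deg g̃ ≥ 12`). -/
theorem bb_band_of_mid_m (hR : type_of% stub_rmWeight) (hAx : type_of% stub_axParity) (hHou : type_of% stub_houCubic)
    (m : ℕ) (hm : m ≤ 20) (f g : (Fin (m + m) → Bool) → Bool) (hf : IsDegLeFun 3 f) (hg : IsDegLeFun 3 g)
    (hbent : IsBentFun g) : forrelation f g = 1 ∨ forrelation f g ≤ 1 - 1 / 1024 := by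
  obtain ⟨d, hd⟩ := Summit.QuantumAdvantage.QuantumAdvantage.Theorems.CubicForrelation.NearExactIsExact.bb_exists_dual hbent
  have hd11 : IsDegLeFun 11 d := (hHou hAx m g d hg hd).mono (by omega)
  rcases Summit.QuantumAdvantage.QuantumAdvantage.Theorems.CubicForrelation.NearExactIsExact.bb_band_of_dual_degree
      (hR stub_derivDegree) m 11 f g d (hf.mono (by norm_num)) hd11 hd with h | h
  · exact Or.inl h
  · right
    norm_num at h
    linarith

/-- **The planner's bent-sided band, DERIVED** (lead reshapes c1 + c3 + c4): AX → HOU → (R, landed) → bentBandLarge → the band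
for every `m`: for `m ≤ 20` Hou's bound (deg g̃ ≤ 11) and the RM weight bound give `Φ = 1 ∨ Φ ≤ 1 − 2⁻¹⁰` outright
(`bb_band_of_mid_m`), for `m ≥ 21` it is the open stub. -/
theorem bentSidedBand_of (hR : type_of% stub_rmWeight) (hAx : type_of% stub_axParity) (hHou : type_of% stub_houCubic)
    (hBL : type_of% stub_bentBandLarge) :
    ∃ θ₂ : ℝ, 1 - 1 / 1024 < θ₂ ∧ ∀ (m : ℕ) (f g : (Fin (m + m) → Bool) → Bool), IsDegLeFun 3 f → IsDegLeFun 3 g →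
      IsBentFun g → ¬ HasMSubspace f → ¬ HasMSubspace g → ¬ HasAMSubspace f → ¬ HasAMSubspace g →
      ¬ LRSpanned 8 11 f → (IsBentFun f → ¬ LRSpanned 8 11 g) → NoLowRankUnbalanced f →
        forrelation f g ≤ 1 - 1 / 1024 ∨ θ₂ ≤ forrelation f g := by
  obtain ⟨θ₂, hθ₂, hL⟩ := hBL
  refine ⟨min θ₂ 1, lt_min hθ₂ (by norm_num), fun m f g hf hg hbent hMf hMg hAf hAg hLf hLg hNf => ?_⟩
  by_cases hm : 21 ≤ m
  · exact (hL m f g hm hf hg hbent hMf hMg hAf hAg hLf hLg hNf).imp_right (min_le_left _ _).trans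
  · have hm' : m ≤ 20 := by omega
    rcases bb_band_of_mid_m hR hAx hHou m hm' f g hf hg hbent with h1 | h2
    · right; rw [h1]; exact min_le_right _ _
    · left; exact h2

/-- **The skeleton**: `D → R → N → F1 → F2 → AX → HOU → AN → AW → FP → RP → AA → AC → QW → DP → PR → IW → LP → LB → UR → VG →
FF → CC → FF′ → TR → T → LCap → LB2 → bentBandLarge → nonBentBand → NearExactIsExact` (T, LCap, LB2 = the 2-adic Walsh tower of §4f, which
closes every `n ≤ 16` at an explicit threshold and `n = 8` at the conjectured `7/8`; they are carried as antecedents of the registered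
skeleton and feed the certified finite-`n` theorems, not the window composition), by the MM-shape ceiling, the almost-MM ceiling and the LRDR band from their
parts, intersecting the two bands (`θ := min (min θ₂ θ₂') 1 > 1 − 2⁻¹⁰`), the hexachotomy, and window amplification
(`θ_crux = (1 − 2⁻¹⁰)/θ`). Pure logic over the stub statements plus the proved adapter. -/
theorem NearExactIsExact_of :
    type_of% stub_derivDegree → type_of% stub_rmWeight → type_of% stub_mmNormalForm → type_of% stub_mmWalsh →
      type_of% stub_mmFormCeiling → type_of% stub_axParity → type_of% stub_houCubic →
      type_of% stub_ammNormalForm → type_of% stub_ammWalsh → type_of% stub_fourPoint → type_of% stub_rankTwoPencil →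
      type_of% stub_ammAccounting → type_of% stub_ammCeiling →
      type_of% stub_quadWalshPlateau → type_of% stub_dyadicPin → type_of% stub_perturbRow →
      type_of% stub_invariantWeight → type_of% stub_lrdrPin → type_of% stub_lrdrBand → type_of% stub_uniformRowDefect →
      type_of% stub_valueGranularity → type_of% stub_fibreAverage → type_of% stub_carletCriterion →
      type_of% stub_fibreAverageRelabeled → type_of% stub_templateRigidity →
      type_of% stub_walshTower → type_of% stub_levelCapacity → type_of% stub_levelBent →
      type_of% stub_bentBandLarge → type_of% stub_nonBentBand →
      Summit.QuantumAdvantage.QuantumAdvantage.Theses.CubicForrelation.NearExactIsExact := by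
  intro hD hR hN hW hF hAx hHou hAN hAW hFP hRP hAA hAC hQW hDP hPR hIW hLP hLB hUR hVG hFF hCC hFR hTR _hT _hLC _hLB2 hBL hNB
  have hA := mmShapeCeiling_of_parts hD hR hN hW hF
  have hA2 := ammShapeCeiling_of_parts hD hR hAN hAW hFP hRP hAA hAC
  have hL := lrdrBand_of_parts hD hQW hDP hPR hIW hLP hLB
  obtain ⟨θ₂, hθ₂, hB1⟩ := bentSidedBand_of hR hAx hHou hBL
  obtain ⟨θ₂', hθ₂', hB2⟩ := hNB hUR hFF hCC hFR hTR
  set θ : ℝ := min (min θ₂ θ₂') 1 with hθdef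
  have hθ1 : θ ≤ 1 := min_le_right _ _
  have hθa : θ ≤ θ₂ := (min_le_left _ _).trans (min_le_left _ _)
  have hθb : θ ≤ θ₂' := (min_le_left _ _).trans (min_le_right _ _)
  have hlt : (1 - 1 / 1024 : ℝ) < θ := lt_min (lt_min hθ₂ hθ₂') (by norm_num)
  unfold Summit.QuantumAdvantage.QuantumAdvantage.Theses.CubicForrelation.NearExactIsExact
  refine nearExactIsExact_of_window (by norm_num) hlt hθ1
    (windowEmpty_of_hexachotomy le_rfl hθ1 hA hA2 (fun m f g hf hg hb hLR => hL m 8 11 f g hf hg hb hLR)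
      (band_of_small_m hAx hVG) (noLowRankUnbalanced_of_window hD hQW) ?_ ?_)
  · intro m f g hf hg hb hMf hMg hAf hAg hLf hLg hNf
    exact (hB1 m f g hf hg hb hMf hMg hAf hAg hLf hLg hNf).imp_right hθa.trans
  · intro m f g hm5 hf hg hbf hbg hMf hMg hAf hAg hNf hNg
    by_cases hm15 : 15 ≤ m
    · exact (hB2 m f g hm15 hf hg hbf hbg hMf hMg hAf hAg hNf hNg).imp_right hθb.trans
    · -- 5 ≤ m ≤ 14: the non-bent core is EMPTY in the window (lead c6, tower walk, landed `nonBentBand_le_28`)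
      exact Or.inl (Summit.QuantumAdvantage.QuantumAdvantage.Theorems.CubicForrelation.NearExactIsExact.nonBentBand_le_28
        m hm5 (by omega) f g hg hbg)

/-- The skeleton with its (sorried) stubs plugged in: the crux by name (proof-of-item modulo `sorryAx`). -/
theorem NearExactIsExact_of_stubs :
    Summit.QuantumAdvantage.QuantumAdvantage.Theses.CubicForrelation.NearExactIsExact :=
  NearExactIsExact_of stub_derivDegree stub_rmWeight stub_mmNormalForm stub_mmWalsh stub_mmFormCeiling
    stub_axParity stub_houCubic stub_ammNormalForm stub_ammWalsh stub_fourPoint stub_rankTwoPencil stub_ammAccounting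
    stub_ammCeiling stub_quadWalshPlateau stub_dyadicPin stub_perturbRow stub_invariantWeight stub_lrdrPin stub_lrdrBand
    stub_uniformRowDefect stub_valueGranularity stub_fibreAverage stub_carletCriterion stub_fibreAverageRelabeled
    stub_templateRigidity stub_walshTower stub_levelCapacity stub_levelBent stub_bentBandLarge stub_nonBentBand

/-! ## §6 Sanity (sorry-free) -/

/-- The composition's threshold is explicit: with both bands at `θ₂ = 2047/2048` the crux comes out at `θ = 2046/2047`. -/
example (hwin : WindowEmpty (1 - 1 / 1024) (2047 / 2048)) : ∃ θ : ℝ, θ = 2046 / 2047 ∧ θ < 1 ∧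
    ∀ n : ℕ, Even n → ∀ f g : (Fin n → Bool) → Bool, IsDegLeFun 3 f → IsDegLeFun 3 g →
      θ < forrelation f g → forrelation f g = 1 := by
  refine ⟨2046 / 2047, rfl, by norm_num, fun n hn f g hf hg hlt => ?_⟩
  refine window_amplification (θ₁ := 1 - 1 / 1024) (θ₂ := 2047 / 2048) (by norm_num) (by norm_num) (by norm_num) hwin
    (forrelation_mem_cubicValueSet hn hf hg) ?_
  norm_num at hlt ⊢; exact hlt

end Summit.QuantumAdvantage.QuantumAdvantage.Cruxes.NearExactIsExact.DirectSumAmplification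

end
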